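/-
# SplitsliceG3 v1.5.2 (bsd-idea-14 g36; §2, §3 added g39; §5 added g40 — v1.5 = v1.4 + §5·H PARITY: the odd-parity case of GAP 2 is VACUOUS for an imaginary quadratic `K` (`even_add_of_isUnramifiedAt_of_hasInfinityType`: everywhere-unramified of type `(−(m+1), n+1)` ⇒ `m + n` even, since `ξ(−1) = 1`), so the ORIGINAL all-parity `RankinSelbergContinuationSupply K f` is a THEOREM for every newform from Jacquet's Literature fact (`rankinSelbergContinuationSupply_of_jacquet`, `rankinSelbergContinuationSupply_iff_even`) + the DUAL CHARACTER `ξᴰ = (ξ∘σ)⁻¹` of the G3a table discharges §1's value relations (`dualValues_galConj_inv`; `typeTwoEulerFactor_galConj_inv`, `typeTwoDenominator_galConj_inv`, `typeTwoInterpolationValueL_galConj_inv`, `isUnramifiedAt_galConj_inv`, `hasInfinityType_galConj_inv`, `rankinSelbergEulerProductHecke_galConj_inv`) and, at the crux's own binders, UNCONDITIONALLY (`complexConj_smul_eq_of_split`: complex conjugation swaps the two primes above the split `p`; `dualValues_cruxFrame`, `typeTwoEulerFactor_cruxDual`, `typeTwoInterpolationValueL_cruxDual`) + (v1.5.2) §5·I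 the POINT INVOLUTION `τ₂` ON AVATARS: at the crux's tower `(κ₁, κ₂) = (cyclotomic, anticyclotomic)` the conjugate avatar `r ∘ θ_c` of `ξ ∘ c` (X11b transport) factors through the pair and sits at `(x₁, x₂⁻¹)`, the dual `ξᴰ` at `(x₁⁻¹, x₂)` — the substitution `diagFrame (−1) 1` of §2 (`conjAvatar_cruxFrame`, `dualPoint_cyc_anticyc`); no statement of v1.4 changed; v1.4 = v1.3.1 + §5·G GAP 2♭: GAP 2 DISCHARGED in the kernel (`rankinSelbergContinuationSupplyEven_of_jacquet`) from the tree's LITERATURE FACT `jacquet1972_exists_entire_rankinSelbergHecke` (Jacquet 1972 Cor. 19.15, `Literature/NumberTheory/EllipticCurves/RankinSelbergHeckeContinuation.lean`) by two unconditional Euler-product identities (norm shift `L(f/K, φ‖·‖^u, s) = L(f/K, φ, s+u)`, Galois transport `L(f/K, φ∘σ, s) = L(f/K, φ, s)`), the construction's taming exponent doubled so that only the EVEN parity `RankinSelbergContinuationSupplyEven` is consumed, + headline `eq_of_isGreenbergLFunctionAnyRoot₂_of_cm_jacquet_ribet[_of_isNewformOf]` (crux-frame uniqueness for a newform `f` from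 the two PRINTED theorems); v1.3.1 = v1.3 + §5·F GAP 1♭: GAP 1 at `D = |d_K|` DISCHARGED in the kernel (`cmNewformLevelSupply_discr`) from the PRINTED theorem `Ribet1977UnramifiedSharpLevel` (Hecke–Shimura–Ribet with the sharp level `|d_K|` for conductor-one characters = the tree's `Ribet1977_cmNewform_of_heckeCharacter` with the level pinned; typed as an input) + `eq_of_isGreenbergLFunctionAnyRoot₂_of_cm_ribet`; v1.3 = v1.2.4 + §5 CM LINE SEQUENCES: the `LineSupply` of §3·V CONSTRUCTED in the kernel for every imaginary quadratic `K`, odd split `p`, generator pair, modulo exactly two named `Prop` inputs GAP 1 `CMNewformLevelSupply` / GAP 2 `RankinSelbergContinuationSupply`, by porting the sibling crux 22628's PROVED `Theorems.CycTangentCMCycTangentBoundFrameUniquenessCM.isKatzMeasure₂_unique_of_cm` with a constructed seed character of type `(1, 0)`; v1.2.1 = v1.2 + §3·S `CharSupply` glue: root `α` and Katz value `y` discharged; v1.2.2 = + §3·T GAP 3♭: two-variable de Shalit (52)–(53), the avatar is the product of two `p`-adic powers of its base points; v1.2.3 = + §3·V G3b♭′ LINE DOOR shaped to the sibling crux's proved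 line supplies; v1.2.4 = + §3·W sequences ↦ `LineSupply` with the sibling's hypothesis list verbatim) — the EXACT rows of the G3 factor table, kernel-checked,
# plus (§2, g39) the algebra of INTEGRAL functional-equation factors
# plus (§3, g39) G3b♭: the value frame `IsGreenbergLFunctionAnyRoot₂` PINS `G` given a fibred supply of data
# (`eq_of_isGreenbergLFunctionAnyRoot₂_of_frameSupply`, from the tree's PROVED fibred identity principle)

Crux item `stmt-BirchSwinnertonDyer-20728` (`SignedBaseChange.TwoVariableEulerSystemDivisibility`), crux idea
«splitslice» (`Cruxes/TwoVariableEulerSystemDivisibility/Ideas/splitslice.md`), item G3, desk check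
`Cruxes/TwoVariableEulerSystemDivisibility/G3-CHECK-g36.md` (crux write fd72a996ef89), §3 "factor table".

WHAT IS PROVED (pure algebra over the tree's type-II value frame of
`Literature/NumberTheory/EllipticCurves/YanZhu2026/GreenbergMainTheorems.lean` §C and its reduction-type-free
parametrisation `typeTwoInterpolationValueL` of `BurungaleSkinnerTianWan2024/GreenbergMainStatementOPEN.lean`, the frame
used by `IsGreenbergLFunctionAnyRoot₂`): under the two VALUE RELATIONS that the dual character `ξ' = ξ^D := (ξ^c)⁻¹`
(Büyükboduk–Lei, arXiv:1707.00557 Def. 2.9) satisfies at the split pair `(v, vbar = c v)` —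
`ξ'(𝔭̄) = ξ(𝔭)⁻¹` and `ξ'(𝔭) = ξ(𝔭̄)⁻¹`, here as the hypotheses `hb`, `hv` on `heckeValueExtZero` —
  * `typeTwoEulerFactor_dual`   : the type-II Euler factor `𝓔` is INVARIANT (its four factors are permuted);
  * `typeTwoDenominator_dual`   : the type-II denominator `(1 − ξ^{1−c}(𝔭̄))(1 − p⁻¹ξ^{1−c}(𝔭̄))` is INVARIANT;
  * `typeTwoInterpolationValueL_dual_cross` : hence the parametrised interpolation value changes ONLY through
    the archimedean constant and the `L`-value slot: `V(ξ', a', b', L1') · (arch(a,b) · L1) = V(ξ, a, b, L1) · (arch(a',b') · L1')`.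
The remaining ratio `arch(a',b')·L1' / (arch(a,b)·L1)` with `(a', b') = (−(m+1), n+1)` for `(a, b) = (−(n+1), m+1)`
is the business of the complex functional equation of `L(f × θ_ψ, s)` (Li 1979 Thm. 2.2 = BL19 Thm. 2.18) — the
ONE named Literature fact of the typing proposal G3a; it is NOT asserted here.

The value relations themselves (`hb`, `hv` from `ξ' = (ξ^c)⁻¹`) are hypotheses: the tree has no complex-
conjugation action on `HeckeCharacter K` to state them from; they are what a typer of G3a supplies.

§2 (g39, after the presearch `Cruxes/TwoVariableEulerSystemDivisibility/G3A-CHECK-g39.md`): the p-adic functional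
equations IN PRINT for two-variable `p`-adic `L`-functions over `K` (type I: Castella–Wan arXiv:1607.02019 §2, eq. (fun-eq)
in the proof of Prop. 2.5, `𝓛(X,Y) ↦ 𝓛(1/(1+Y) − 1, 1/(1+X) − 1) = ε·𝓛(X,Y)`, `ε = −ε_K(N)`; Büyükboduk–Lei arXiv:1707.00557
Def. 3.8 + Thm. 3.9, `𝔏_{α,α} = 𝒢_f · 𝔏_{α,α}^τ`, `τ : γ_𝔭 ↦ γ_{𝔭^c}⁻¹`, `𝒢_f ∈ Λ_{𝒪_L}(Γ)`, `𝒢_f^{ac} ≡ ε(f/K)`) all have the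
shape `G = U · τ G` with `τ` = the route's `τ₂` (`γ_cyc ↦ γ_cyc⁻¹`, `γ_ac ↦ γ_ac`; `SplitsliceG2ct.lean` v0.6 §12:
`τ₂ = frameSubst ℤ_[p] (diagFrame (−1) 1)`) and an INTEGRAL factor `U`. §2 records, over an arbitrary commutative domain,
what such a shape gives for free, so that the typing proposal G3a may state the WEAKEST form `∃ U, G = U * τ₂ G` (no
`IsUnit U` clause, no sign):
  * `feFactor_mul_map_eq_one`, `isUnit_feFactor` : `G ≠ 0`, `τ (τ G) = G`, `G = U · τ G` ⇒ `U · τ U = 1`, so `U` is a unit;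
  * `span_map_eq_of_fe` : hence `Ideal.span {τ G} = Ideal.span {G}` — EXACTLY the G3a shape door 5 consumes;
  * `map_feFactor_eq_one` : if a ring map `π` has `π (τ G) = π G` and `π G ≠ 0` then `π U = 1`;
  * `constantCoeff_map_eq_of_fixes_C`, `constantCoeff_feFactor_eq_one` : on `PowerSeries (PowerSeries R)` with the outer
    variable inverted (`(1 + X) · τ (1 + X) = 1`) and the inner one fixed (`τ (C g) = C g`) — the `τ₂` pattern — the factor
    satisfies `constantCoeff U = 1` as soon as `constantCoeff G ≠ 0`: the FE unit is `≡ 1` ON THE ANTICYCLOTOMIC LINE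
    `T_cyc = 0`. For the type-II (Greenberg/BDP) `G` of the crux, `G(0, T_ac)` is the (non-zero) BDP-type anticyclotomic
    function, so any correctly typed G3a has `U ≡ 1 (mod T_cyc)`; contrast type I, where `𝒢_f^{ac} = ε(f/K) = −1` forces
    `𝔏^{ac} = 0` (BL19 Cor. 3.10, CW16 Cor. 2.6). This is the cheapest falsifier of a mis-signed G3a statement.
  The three hypotheses `hτ` (involution), `hX`, `hC` are discharged for the actual `τ₂`-frame
  `frameSubst 𝒪 (diagFrame (−1) 1)` over ANY `𝒪` (so on `Λ₂^ur`) by `SplitsliceG2ct.lean` v0.7 §13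
  (`frameSubst_diagFrame_negOne_one_frameSubst`, `one_add_X_mul_frameSubst_diagFrame_negOne_one`,
  `frameSubst_diagFrame_negOne_one_C`); they stay abstract here because Cruxes files cannot import each other.

§3 (g39) G3b♭ — THE FRAME PINS `G` (`eq_of_isGreenbergLFunctionAnyRoot₂_of_frameSupply`): two series framed by the
same `IsGreenbergLFunctionAnyRoot₂ ι v vbar κ₁ κ₂ g₁ g₂ f D hK LK ·` are EQUAL, given a fibred supply `FrameSupply …` of
interpolation data (for each `c` of an infinite set of first coordinates in a closed disc `‖c‖ ≤ ‖ϖ‖ < 1`, infinitely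
many second coordinates in some closed disc, each point `(c, y₂) = (r(g₁) − 1, r(g₂) − 1)` carrying frame data
`(ξ, r, m, n, α, θ, L, y)`). Proof = the frame prescribes at a data point a value depending only on the data + the tree's
PROVED fibred identity principle `IntSeries.eq_of_infinite_hasValueAt₂_eq_fibred` (Gouvêa Cor. 5.6.4, de Shalit II.6.4
proof). So G3b (card §F: normalisation / uniqueness of `G`, `[S/M]`) is REDUCED IN THE KERNEL to the supply statement —
an honest CM-theory existence/density statement (NOT asserted: e.g. for `D ≠ −3, −4` everywhere-unramified characters of
type `(−(m+1), n+1)` need `m ≡ n (mod 2)`, and `FactorsThroughPair` (avatar trivial on the torsion of `Gal(K(p^∞)/K)`)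
imposes congruences on `(m+1, n+1)` modulo `p − 1` and the class-group part — infinitely many `(m, n)` survive in each
residue pattern, which is all the fibred principle needs; a typer's fact or a prover's lemma), and G3a then needs NO
separate uniqueness fact (`frame_functionalEquation_of_frameSupply`). `isGreenbergLFunctionAnyRoot₂_of_no_data` records
the honest converse: with no data point at all every series is framed, so SOME supply hypothesis is necessary.
§3·S (v1.2.1): `CharSupply` = `FrameSupply` without the two SERVED data (memo `G3B-CHECK-g39.md` §1: S4 root `α` —
`exists_heckeRoot`, `ℂ` algebraically closed; S7 Katz value `y` — `exists_hasValueAt₂_zero_left` from the tree's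
`IntSeries.summable_coeff_mul_pow_mul_pow` and `norm_avatarValueAt_sq_sub_one_lt` ⇐ tree
`norm_avatarValueAt_sub_one_lt_of_factorsThroughPair`); `frameSupply_of_charSupply`, `eq_of_isGreenbergLFunctionAnyRoot₂_of_charSupply`.
What `CharSupply` still asks is exactly the memo's S1–S3, S5, S6, S8 (three of them in-print typing gaps).
§3·T (v1.2.2, GAP 3♭): `isContinuousChar₂_apply_eq_onePlusPow_mul` — a continuous character `F` of `ℤ_p²` with principal-unit
base values is `F(a,b) = (1 + (F(1,0) − 1))^a · (1 + (F(0,1) − 1))^b` for ALL `a, b ∈ ℤ_p` (density of `ℕ × ℕ`, tree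
`continuous_onePlusPow` / `PadicInt.denseRange_natCast`); `avatarValueAt_eq_onePlusPow_mul` — de Shalit II.4.17 (52)–(53)
in two variables: `r(σ) = (1 + (r(γ₁) − 1))^{κ₁σ} · (1 + (r(γ₂) − 1))^{κ₂σ}` for `r` through the pair (tree descent
`ZpExtension.pairChar`, `isContinuousChar₂_pairChar`); `avatarValueAt_inv_eq`, `avatarValueAt_inv_eq_onePlusPow_neg_one` (the
crux's frame `(γ₁⁻¹, γ₂⁻¹)` reads the INVERSE base points). What GAP 3 keeps is arithmetic only: the base points `r_ξ(γᵢ)`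
as functions of the infinity type of `ξ` (memo `G3B-CHECK-g39.md` GAP 3; de Shalit II.4.17 two-variable).
§3·V (v1.2.3, G3b♭′ LINE DOOR): `LineSupply` (data on infinitely many non-proportional monomial lines, infinitely many
points per line in a closed disc of radius `< 1`) ⇒ `G = G'` (`eq_of_isGreenbergLFunctionAnyRoot₂_of_lineSupply`: tree
`IntSeries.hasValueAt_monomialLine_iff` + `IntSeries.eq_of_infinite_hasValueAt_eq` per line, then `IntSeries.eq_of_monomialLine_eq`
p587151); adapter `lineSupply_of_lineData` from the SHAPE of the sibling crux's proved supplies (lines `κ_s ≥ pairKer`, generators `γ_s`,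
`r` through `κ_s`, parameter `x = r(γ_s) − 1`; `Theorems.CycTangentCMCycTangentBoundFrameUniqueness.isKatzMeasure₂_ext_of_lineSupplies`,
`Theorems.CycTangentCMCycTangentBoundPairSupply.exists_isPAdicAvatarOf_pow_factorsThroughPair` p584708,
`Theorems.PrintCf2.KatzPeriodRigidity.exists_frameSupply₂_lin`), via tree `avatarValueAt_eq_onePlusPow`. Through this door GAP 3 is
not needed and S1/S2/S8 are sibling theorems by name; RS-specific residue = S5 (GAP 2), S6 (GAP 1), everywhere-unramified `ξ`.
§3·W (v1.2.4): `infinite_setOf_of_tendsto_zero` (a sequence `→ 0`, frequently `≠ 0`, has infinitely many values in every closed disc)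
and `lineSupply_of_lineSeq` — `LineSupply` from line SEQUENCES with EXACTLY the hypothesis list `κ γ hγ hc₂ hprop hr hκr hlim hne` of the
sibling's `isKatzMeasure₂_ext_of_lineSupplies` (Katz data clause ↦ Greenberg data clause), so the sibling's supply CONSTRUCTIONS
(`…FrameUniquenessCM.isKatzMeasure₂_unique_of_cm` proof parts: `exists_pow_forall_isUnramifiedAt`, p584708, p591594 lines
`κ_s = p(s+1)κ_𝔭 − κ_𝔭∘θ`, `exists_splitPrimeLine_factorsThroughZp`, p590734) feed this door after supplying the RS data per point.

§5 (v1.3, g40): CM LINE SEQUENCES — `exists_hasInfinityType_one_zero` (seed: a Hecke character of type `(1, 0)` on every imaginary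
quadratic `K`, any class number, from `X11b.Three.LambdaSupply.exists_character_quotient_type_one` + uniqueness of infinity types +
a norm twist), the two named inputs `CMNewformLevelSupply K D` (GAP 1: CM newform of an everywhere-unramified character at level
`Γ₁(D)`; Hecke–Shimura at `D = |d_K|`) and `RankinSelbergContinuationSupply K f` (GAP 2: entire continuation of
`rankinSelbergEulerProductHecke f ξ`; Rankin–Selberg for the crux's newform `f`), and `lineSupply_of_cm` — sibling Steps 1–8
(tamed pair-avatars p584708, split-prime line, outer complex conjugation, lines `κ_s = p(s+1)κ_𝔭 − κ_𝔭∘θ_c`, `φ_s = χ₁^{a_s}(χ₁∘θ_c)⁻¹`,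
`φ_s(γ_s) ≠ 1` by ramification of a type-`(−NW, 0)` avatar at `v`) with Step 8 re-typed for the Greenberg frame: characters
`ρ_{s,k} = Ψ₁^{W a_s p^k}·(Ψ₁^{W p^k}∘c)⁻¹` of type `(−(m+1), n+1)`, `m+1 = NWa_sp^k`, `n+1 = NWp^k`, unramified EVERYWHERE, through
`κ_s ≥ pairKer` hence through the pair, base `(γ₁⁻¹, γ₂⁻¹)` — discharging every hypothesis of §3·W `lineSupply_of_lineSeq` but
`hθ`/`hL`, which are GAP 1 / GAP 2. Headline `eq_of_isGreenbergLFunctionAnyRoot₂_of_cm` (+ `_cruxFrame` at `(D, h_K) = (|d_K|, h(K))`):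
two series in the crux's CM-supplied Greenberg frame are EQUAL. Residual G3b (`LineSupply`) is thereby closed in the kernel modulo
GAP 1 / GAP 2, which stay literature-typing wants on the card's residual table.

§5·F (v1.3.1, g40): GAP 1♭ — `Ribet1977UnramifiedSharpLevel : Prop` (the tree's Ribet fact VERBATIM with `∀ w, ψ unramified at w`
added and the level PINNED to `|d_K|`: Ribet 1977 §3 Thm. (3.4) / Cor. (3.5) / Remark (3.5) at `𝔪 = 𝔣_ψ = (1)`; a printed theorem,
typed as an INPUT — its move into `Literature/` is the typing want), `cmNewformLevelSupply_discr : … → CMNewformLevelSupply K |d_K|`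
(kernel: `ξ/‖·‖^{m+1}` is everywhere unramified of type `(0, m+n+2)`), `eq_of_isGreenbergLFunctionAnyRoot₂_of_cm_ribet` (crux-frame
uniqueness granted the printed fact and GAP 2). After §5·F the residual of G3b is: ONE printed theorem to move into Literature
(GAP 1) + GAP 2 (Rankin–Selberg continuation for the newform `f`, [M]).

§5·G (v1.4, g40): GAP 2♭ — GAP 2 is consumed only in its EVEN-parity form `RankinSelbergContinuationSupplyEven K f` (`m + n` even;
v1.4 doubles the taming exponent of Step 2, `W = 2MN₀`, so the line sequences have `m + n` even), and that form is PROVED from the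
tree's Literature fact `jacquet1972_exists_entire_rankinSelbergHecke` (Jacquet 1972, Cor. 19.15, typed 2026-08-29 in
`RankinSelbergHeckeContinuation.lean` for everywhere-unramified characters of unitary type `(n', −n')` on `re s > 3/2`) for every
NEWFORM `f` (`IsNewform0 f`; the crux's `IsNewformOf W f` gives it by `.1`): `rankinSelbergContinuationSupplyEven_of_jacquet`, via
the termwise identities `rankinSelbergEulerProductHecke_mul_normCharacter_zpow` (norm shift) and `rankinSelbergEulerProductHecke_galConj`
(Galois transport; `Equiv.tprod_eq` along `v ↦ σv`, `N(σv) = N(v)`), applied to `φ₀ = (ξ∘c)‖·‖^{n−r}`, `2r = m + n`. Headline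
`eq_of_isGreenbergLFunctionAnyRoot₂_of_cm_jacquet_ribet` (+ `_of_isNewformOf`): crux-frame uniqueness for a newform `f` granted the
two PRINTED theorems `Ribet1977UnramifiedSharpLevel` and `jacquet1972_exists_entire_rankinSelbergHecke`. After §5·G the residual of
G3b is: the move of `Ribet1977UnramifiedSharpLevel` into Literature (a verbatim specialisation of the tree's Ribet fact) — GAP 2 is
now a by-name Literature fact, no typing owed by this crux.

§5·H (v1.5, g40): PARITY and the DUAL CHARACTER. (i) `even_add_of_isUnramifiedAt_of_hasInfinityType`: an everywhere-unramified
Hecke character of an imaginary quadratic field of type `(−(m+1), n+1)` has `m + n` EVEN (`ξ` kills the principal idele `−1`, `−1` is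
a unit at every finite place and `ξ` has the empty module of definition, so `ξ((−1)_∞) = 1`; the infinity type gives
`ξ((−1)_∞) = (−1)^{m+1}(−1)^{−(n+1)}`) — hence the odd-parity case of GAP 2 is VACUOUS, `RankinSelbergContinuationSupplyEven K f ↔
RankinSelbergContinuationSupply K f` (`rankinSelbergContinuationSupply_iff_even`), and the ORIGINAL all-parity GAP 2 is a theorem for
every newform: `rankinSelbergContinuationSupply_of_jacquet`. (ii) The dual character `ξᴰ := (ξ∘σ)⁻¹` of the G3a functional-equation
table (§1, G3-CHECK-g36.md §3): for `σ` swapping `v` and `v̄` it satisfies §1's value relations (`dualValues_galConj_inv`: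
`ξᴰ(𝔭̄) = ξ(𝔭)⁻¹`, `ξᴰ(𝔭) = ξ(𝔭̄)⁻¹` in the extended-by-zero currency, via `heckeValueExtZero_inv` / `heckeValueExtZero_galConj`), so
`𝓔(ξᴰ, f, 1) = 𝓔(ξ, f, 1)`, the type-II denominator and the `(𝓔, den)`-slots of `typeTwoInterpolationValueL` are D-invariant
(`typeTwoEulerFactor_galConj_inv`, `typeTwoDenominator_galConj_inv`, `typeTwoInterpolationValueL_galConj_inv`); `ξᴰ` is everywhere
unramified of type `(−(n+1), m+1)` (`isUnramifiedAt_galConj_inv`, `hasInfinityType_galConj_inv`: the range of the frame is D-stable with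
`m ↔ n`), and `L(f/K, ξᴰ, s) = L(f/K, ξ⁻¹, s)` as Euler products (`rankinSelbergEulerProductHecke_galConj_inv`); (iii) at the crux's own
data the swap hypothesis is DISCHARGED: `complexConj_smul_eq_of_split` (imaginary quadratic `K`, two distinct primes `v ≠ v̄` containing `p`
⇒ `c • v = v̄ ∧ c • v̄ = v`, by transitivity of `Gal(K/ℚ)` on the primes above `(p)` and `|Gal| = 2`), so `dualValues_cruxFrame`,
`typeTwoEulerFactor_cruxDual`, `typeTwoInterpolationValueL_cruxDual` hold under the crux binders `hv hvbar hne` verbatim (`ncard = 2` unused). What G3a still needs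
beyond these kernel rows is unchanged: the complex functional equation `s ↦ 2 − s` of `L(f/K, ξ, s)` (Li 1979 Thm. 2.2 / Jacquet) with its
root number, the point involution `τ₂` on avatars, and `⟨θ̄, θ̄⟩ = ⟨θ, θ⟩` — not asserted here.

§5·I (v1.5.2, g40): THE POINT INVOLUTION `τ₂` ON AVATARS — the second of those three items, now a kernel row. For a map
`θ : Γ_K → Γ_K` fixing `κ₁` and inverting `κ₂` (`κ₁(θ g) = κ₁ g`, `κ₂(θ g) = κ₂(g)⁻¹`) and `r` through the pair with adapted
generators `(γ₁, γ₂)`: `r(θ γ₁) = r(γ₁)`, `r(θ γ₂) = r(γ₂)⁻¹` (`avatarValueAt_conj_left/right`, from `avatarValueAt_eq_of_factorsThroughPair`: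
a character of the `ℤ_p²`-tower only sees the `(κ₁, κ₂)`-coordinates), so a dual avatar `r'` with values `r'(g) = r(θ g)⁻¹` sits at
`(r'(γ₁⁻¹), r'(γ₂⁻¹)) = (x₁⁻¹, x₂)` where `(x₁, x₂) = (r(γ₁⁻¹), r(γ₂⁻¹))` is the crux frame's point of `ξ` (`dualPoint`) and again
factors through the pair (`dual_factorsThroughPair_values`). At the crux's tower the hypotheses on `θ` are DISCHARGED: the cyclotomic
`ℤ_p`-extension is fixed by any lift `θ` of conjugation by `c ∈ Γ_ℚ` (`apply_conj_eq_of_isCyclotomic`: `κ₁` factors through `χ_p`,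
tree `IsCyclotomic.apply_eq_of_cyclotomicCharacter_eq`, and `χ_p` comes from `Γ_ℚ`, tree `cyclotomicCharacter_absGaloisRestrict`, with
`ℤ_pˣ` commutative) and the anticyclotomic one is inverted (`apply_conj_eq_inv_of_isAnticyclotomic` = the tree's definition
`ZpExtension.IsAnticyclotomic` read at `θ`); hence `dualPoint_cyc_anticyc` under the crux binders `κ₁.IsCyclotomic`, `κ₂.IsAnticyclotomic`,
and the assembled row `conjAvatar_cruxFrame`: for `K` imaginary quadratic (CM, `[K:ℚ] = 2`), `c ∉ res Γ_K` and the tree's canonical lift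
`θ_c = absGaloisOuterConj ℚ K c`, the conjugate avatar `r ∘ θ_c` IS the avatar of `ξ ∘ c` (X11b
`LambdaSupply.isPAdicAvatarOf_galConj_complexConj_comp`, PROVED in the tree), factors through `(κ₁, κ₂)`, and sits at `(x₁, x₂⁻¹)` — so
`ξᴰ = (ξ ∘ c)⁻¹` sits at `(x₁⁻¹, x₂)`, i.e. `τ₂ = frameSubst (diagFrame (−1) 1)` of §2 EXACTLY (first coordinate inverted, second fixed;
consistent with the types: `D` negates `p + q = n − m`, the cyclotomic direction, and fixes `p − q`). What G3a still needs after v1.5.2: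
the complex functional equation with its root number and `⟨θ̄, θ̄⟩ = ⟨θ, θ⟩` only.

Imports Literature and (v1.3) ONE Summits-side PROVED Theorems file, the sibling crux's
`Theorems.CycTangentCMCycTangentBoundFrameUniquenessCM` (Theorems files are importable; no Cruxes file is imported — they are not
importable on the farm). No `sorry`.
Nothing here bears on the summit: no summit statement is proved; BSD is not proved.
-/
import Literature.NumberTheory.EllipticCurves.BurungaleSkinnerTianWan2024.GreenbergMainStatementOPEN
import Literature.NumberTheory.EllipticCurves.IntSeriesIdentityPrinciple
import Literature.NumberTheory.EllipticCurves.DeShalit1987.KatzMeasureUnitTwistPair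
import Literature.NumberTheory.EllipticCurves.DeShalit1987.KatzMeasureFromDistribution
import Literature.NumberTheory.EllipticCurves.IntSeriesOnePlusPowExponentLaws
import Literature.NumberTheory.EllipticCurves.IntSeriesLinesRigidity
import Literature.NumberTheory.EllipticCurves.DeShalit1987.KatzMeasureMonomialLinesFrames
import Literature.NumberTheory.GaloisRepresentations.HeckeCharacterInfinityTypeUnique
import Literature.NumberTheory.EllipticCurves.RankinSelbergHeckeContinuation
import Literature.NumberTheory.Automorphic.GaloisActionPlaces
import Literature.NumberTheory.GaloisRepresentations.HeckeCharacterDictionary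
import Literature.NumberTheory.QuadraticFields.ConjugateIdealClass
import Literature.NumberTheory.EllipticCurves.ZpExtensionCyclotomicSplitPrimeNonsplitProofs
import Literature.NumberTheory.GaloisRepresentations.LocalKroneckerWeberInertiaProofs
import Summits.BirchSwinnertonDyer.BirchSwinnertonDyer.Theorems.CycTangentCMCycTangentBoundFrameUniquenessCM

set_option linter.dupNamespace false

namespace Summit.BirchSwinnertonDyer.BirchSwinnertonDyer.Cruxes.TwoVariableEulerSystemDivisibility.SplitsliceG3

open Literature.NumberTheory.EllipticCurves Literature.NumberTheory.GaloisRepresentations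
  IsDedekindDomain NumberField

variable {K : Type} [Field K] [NumberField K] {p : ℕ}

/-- support: **the type-II Euler factor is invariant under the dual character.** If `ξ'` takes at
`vbar` the inverse of `ξ`'s value at `v` and at `v` the inverse of `ξ`'s value at `vbar` (the value
relations of `ξ' = (ξ^c)⁻¹` at a split pair), then `𝓔(ξ', f, 1) = 𝓔(ξ, f, 1)` for every root
parameter `α`: the four factors `(1 − p⁻¹ξ(𝔭̄)α)(1 − ξ(𝔭̄)α⁻¹)(1 − p⁻¹ξ⁻¹(𝔭)α)(1 − ξ⁻¹(𝔭)α⁻¹)` are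
permuted `1 ↔ 3`, `2 ↔ 4`. (G3-CHECK-g36.md §3, row "𝓔".) -/
theorem typeTwoEulerFactor_dual (α : ℂ) (ξ ξ' : HeckeCharacter K) (v vbar : HeightOneSpectrum (𝓞 K))
    (hb : heckeValueExtZero ξ' vbar = (heckeValueExtZero ξ v)⁻¹)
    (hv : heckeValueExtZero ξ' v = (heckeValueExtZero ξ vbar)⁻¹) :
    typeTwoEulerFactor p α ξ' v vbar = typeTwoEulerFactor p α ξ v vbar := by
  simp only [typeTwoEulerFactor, hb, hv, inv_inv]
  ring

/-- support: **the type-II denominator is invariant under the dual character**: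
`ξ'^{1−c}(𝔭̄) = ξ'(𝔭̄)/ξ'(𝔭) = ξ(𝔭)⁻¹/ξ(𝔭̄)⁻¹ = ξ(𝔭̄)/ξ(𝔭) = ξ^{1−c}(𝔭̄)`.
(G3-CHECK-g36.md §3, row "typeTwoDenominator".) -/
theorem typeTwoDenominator_dual (ξ ξ' : HeckeCharacter K) (v vbar : HeightOneSpectrum (𝓞 K))
    (hb : heckeValueExtZero ξ' vbar = (heckeValueExtZero ξ v)⁻¹)
    (hv : heckeValueExtZero ξ' v = (heckeValueExtZero ξ vbar)⁻¹) :
    typeTwoDenominator p ξ' v vbar = typeTwoDenominator p ξ v vbar := by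
  have hx : (heckeValueExtZero ξ v)⁻¹ / (heckeValueExtZero ξ vbar)⁻¹ =
      heckeValueExtZero ξ vbar / heckeValueExtZero ξ v := by
    rw [div_eq_mul_inv, inv_inv, mul_comm, ← div_eq_mul_inv]
  simp only [typeTwoDenominator, hb, hv, hx]

/-- support: **the parametrised interpolation value changes only through the archimedean constant and
the `L`-value slot.** Cross-multiplied form (no division by possibly-zero constants): for any two
parameter triples `(a, b, L1)`, `(a', b', L1')`,
`V(ξ', a', b', L1') · (arch(a, b) · L1) = V(ξ, a, b, L1) · (arch(a', b') · L1')`.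
With `(a, b) = (−(n+1), m+1)` and `(a', b') = (−(m+1), n+1)` the remaining ratio is exactly what the
complex functional equation of `L(f × θ_ψ, s)` (Li 1979 Thm. 2.2; Büyükboduk–Lei arXiv:1707.00557
Thm. 2.18) controls — G3a's single named fact, not asserted here. (G3-CHECK-g36.md §3–§4.) -/
theorem typeTwoInterpolationValueL_dual_cross (Nlev : ℕ) (v vbar : HeightOneSpectrum (𝓞 K)) (α : ℂ)
    (ξ ξ' : HeckeCharacter K)
    (hb : heckeValueExtZero ξ' vbar = (heckeValueExtZero ξ v)⁻¹)
    (hv : heckeValueExtZero ξ' v = (heckeValueExtZero ξ vbar)⁻¹)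
    (a b a' b' : ℤ) (pet : ℝ) (L1 L1' : ℂ) :
    typeTwoInterpolationValueL p Nlev v vbar α ξ' a' b' pet L1' *
        (typeTwoArchimedeanConstant Nlev a b pet * L1) =
      typeTwoInterpolationValueL p Nlev v vbar α ξ a b pet L1 *
        (typeTwoArchimedeanConstant Nlev a' b' pet * L1') := by
  simp only [typeTwoInterpolationValueL, typeTwoEulerFactor_dual α ξ ξ' v vbar hb hv,
    typeTwoDenominator_dual ξ ξ' v vbar hb hv]
  ring

/-- support: the dual relations are an INVOLUTION at the level of values: applying them twice returns
`ξ`'s values (so the table's symmetry is genuinely two-sided). -/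
theorem dual_dual {x y x' y' x'' y'' : ℂ} (hb : x' = y⁻¹) (hv : y' = x⁻¹)
    (hb' : x'' = y'⁻¹) (hv' : y'' = x'⁻¹) : x'' = x ∧ y'' = y := by
  subst hb hv
  simp [hb', hv']

/-- support: combined with the tree's root symmetry `typeTwoEulerFactor_div` (`α ↦ p/α`), the Euler
factor of the dual character at the other root is again `𝓔(ξ, f, 1)` — the frame's "any root" clause
and the dual symmetry commute. -/
theorem typeTwoEulerFactor_dual_div (α : ℂ) (hα : α ≠ 0) (hp : (p : ℂ) ≠ 0)
    (ξ ξ' : HeckeCharacter K) (v vbar : HeightOneSpectrum (𝓞 K))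
    (hb : heckeValueExtZero ξ' vbar = (heckeValueExtZero ξ v)⁻¹)
    (hv : heckeValueExtZero ξ' v = (heckeValueExtZero ξ vbar)⁻¹) :
    typeTwoEulerFactor p ((p : ℂ) / α) ξ' v vbar = typeTwoEulerFactor p α ξ v vbar := by
  rw [typeTwoEulerFactor_div α hα hp, typeTwoEulerFactor_dual α ξ ξ' v vbar hb hv]

/-! ## §2 (g39) Integral functional-equation factors: unit for free, `≡ 1` on the fixed line -/

section IntegralFEFactor

variable {R S : Type*} [CommRing R] [CommRing S]

/-- support: **an integral FE factor is inverse to its own twist.** If `G = U * τ G` with `τ (τ G) = G` and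
`G ≠ 0` in a domain, then `U * τ U = 1`. (Apply `τ`: `τ G = τ U * G`; substitute.) -/
theorem feFactor_mul_map_eq_one [IsDomain R] (τ : R →+* R) (G U : R) (hG : G ≠ 0)
    (hτ : τ (τ G) = G) (h : G = U * τ G) : U * τ U = 1 := by
  have h1 : τ G = τ U * G := by
    conv_lhs => rw [h]
    rw [map_mul, hτ]
  have h2 : G * (U * τ U) = G * 1 := by
    rw [mul_one]
    conv_rhs => rw [h, h1]
    ring
  exact mul_left_cancel₀ hG h2

/-- support: hence **an integral FE factor is automatically a unit** — a typed G3a needs no `IsUnit` clause. -/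
theorem isUnit_feFactor [IsDomain R] (τ : R →+* R) (G U : R) (hG : G ≠ 0)
    (hτ : τ (τ G) = G) (h : G = U * τ G) : IsUnit U :=
  isUnit_iff_exists_inv.mpr ⟨τ U, feFactor_mul_map_eq_one τ G U hG hτ h⟩

/-- support: **the G3a shape from the weakest FE.** `G = U * τ G` (with `τ (τ G) = G`, `G ≠ 0`) gives
`Ideal.span {τ G} = Ideal.span {G}` — the statement door 5 consumes (`G3-CHECK-g36.md` §2; `Ideas/splitslice.md` G3). -/
theorem span_map_eq_of_fe [IsDomain R] (τ : R →+* R) (G U : R) (hG : G ≠ 0)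
    (hτ : τ (τ G) = G) (h : G = U * τ G) : Ideal.span {τ G} = Ideal.span {G} := by
  have hU : IsUnit U := isUnit_feFactor τ G U hG hτ h
  conv_rhs => rw [h]
  exact (Ideal.span_singleton_mul_left_unit hU (τ G)).symm

/-- support: the trivial zero case, for completeness: if `G = 0` the G3a shape holds with no hypothesis. -/
theorem span_map_eq_of_eq_zero (τ : R →+* R) (G : R) (hG : G = 0) :
    Ideal.span {τ G} = Ideal.span {G} := by
  subst hG
  simp

/-- support: **the FE factor is `1` wherever `τ` acts trivially.** If a ring map `π : R → S` into a domain
does not see the twist on `G` (`π (τ G) = π G`) and `π G ≠ 0`, then `π U = 1`. -/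
theorem map_feFactor_eq_one [IsDomain S] (τ : R →+* R) (π : R →+* S) (G U : R)
    (hπ : π (τ G) = π G) (hG : π G ≠ 0) (h : G = U * τ G) : π U = 1 := by
  have h2 : π G * π U = π G * 1 := by
    rw [mul_one, mul_comm]
    conv_rhs => rw [h]
    rw [map_mul, hπ]
  exact mul_left_cancel₀ hG h2

/-- support: a ring map out of a power-series ring that KILLS the variable only sees the constant term
(no continuity needed: `F = X * F' + C (constantCoeff F)` exactly). -/
theorem ringHom_apply_eq_of_map_X_eq_zero (φ : PowerSeries R →+* S) (hX : φ PowerSeries.X = 0)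
    (F : PowerSeries R) : φ F = φ (PowerSeries.C (PowerSeries.constantCoeff F)) := by
  conv_lhs => rw [PowerSeries.eq_X_mul_shift_add_const F]
  rw [map_add, map_mul, hX, zero_mul, zero_add]

/-- support: **the `τ₂` pattern fixes constant terms in the inverted variable.** On `PowerSeries (PowerSeries R)`
(outer variable `X` ↔ `γ_cyc − 1`, inner coefficients ↔ the anticyclotomic algebra), a ring endomorphism `τ` with
`(1 + X) * τ (1 + X) = 1` (outer variable inverted) and `τ (C g) = C g` (inner algebra fixed) — the shape of
`SplitsliceG2ct.tau₂` (`one_add_X_mul_tau₂_one_add_X`, `tau₂_C_C`/`tau₂_one_add_CX`) — satisfies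
`constantCoeff (τ F) = constantCoeff F`: restriction to the anticyclotomic line `X = 0` does not see `τ`. -/
theorem constantCoeff_map_eq_of_fixes_C
    (τ : PowerSeries (PowerSeries R) →+* PowerSeries (PowerSeries R))
    (hX : (1 + PowerSeries.X) * τ (1 + PowerSeries.X) = 1)
    (hC : ∀ g : PowerSeries R, τ (PowerSeries.C g) = PowerSeries.C g)
    (F : PowerSeries (PowerSeries R)) :
    PowerSeries.constantCoeff (τ F) = PowerSeries.constantCoeff F := by
  -- the composite `constantCoeff ∘ τ` kills `X`:
  have h1 : PowerSeries.constantCoeff (τ (1 + PowerSeries.X)) = (1 : PowerSeries R) := by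
    have := congrArg PowerSeries.constantCoeff hX
    simpa using this
  have h0 : PowerSeries.constantCoeff (τ PowerSeries.X) = (0 : PowerSeries R) := by
    have h1' : PowerSeries.constantCoeff (τ 1) + PowerSeries.constantCoeff (τ PowerSeries.X) = 1 := by
      rw [← map_add, ← map_add]; exact h1
    rw [map_one, map_one] at h1'
    -- `1 + c = 1` ⇒ `c = 0`
    have := congrArg (fun t => t - 1) h1'
    simpa using this
  have key := ringHom_apply_eq_of_map_X_eq_zero
    ((PowerSeries.constantCoeff (R := PowerSeries R)).comp τ) (by simpa using h0) F
  simp only [RingHom.comp_apply] at key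
  rw [key, hC, PowerSeries.constantCoeff_C]

/-- support: **the FE unit is `≡ 1` on the anticyclotomic line.** In the `τ₂` pattern of the previous lemma, an FE
`G = U * τ G` with `G(0, ·) ≠ 0` (for the crux's type-II `G`: the non-zero BDP-type anticyclotomic function) forces
`U(0, ·) = 1`. Any typed G3a must pass this; type I fails it by design (`𝒢_f^{ac} = ε(f/K) = −1`, BL19 Thm. 3.9,
whence `𝔏^{ac}_{α,α} = 0`, BL19 Cor. 3.10 / CW16 Cor. 2.6). -/
theorem constantCoeff_feFactor_eq_one [IsDomain R]
    (τ : PowerSeries (PowerSeries R) →+* PowerSeries (PowerSeries R))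
    (hX : (1 + PowerSeries.X) * τ (1 + PowerSeries.X) = 1)
    (hC : ∀ g : PowerSeries R, τ (PowerSeries.C g) = PowerSeries.C g)
    (G U : PowerSeries (PowerSeries R)) (hG : PowerSeries.constantCoeff G ≠ 0) (h : G = U * τ G) :
    PowerSeries.constantCoeff U = 1 :=
  map_feFactor_eq_one τ (PowerSeries.constantCoeff (R := PowerSeries R)) G U
    (constantCoeff_map_eq_of_fixes_C τ hX hC G) hG h

end IntegralFEFactor

/-! ## §3 (g39) G3b — THE FRAME PINS `G`: uniqueness of a series framed by `IsGreenbergLFunctionAnyRoot₂`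
from a FIBRED SUPPLY of interpolation data (kernel reduction of G3b to a supply statement)

The value frame `IsGreenbergLFunctionAnyRoot₂ ι v vbar κ₁ κ₂ g₁ g₂ f D hK LK G` prescribes, at every point
`(r(g₁) − 1, r(g₂) − 1)` of the open polydisc carrying interpolation DATA (a Hecke character `ξ` of infinity type
`(−(m+1), n+1)` unramified everywhere with `p`-adic avatar `r` factoring through `(κ₁, κ₂)`, a root `α` of the Hecke
polynomial at `p`, a CM newform `θ` of `ξ/N^{m+1}`, an entire continuation `L` of the Rankin–Selberg product, a value
`y` of the Katz series `LK` at `(0, r(g₂)² − 1)`), a value of `G` that depends ONLY ON THE DATA, not on `G`. Hence two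
series framed by the same frame take a common value at every data point, and the tree's fibred identity principle
`IntSeries.eq_of_infinite_hasValueAt₂_eq_fibred` (Gouvêa Cor. 5.6.4 / de Shalit II.6.4 proof, PROVED in the tree) turns a
FIBRED SUPPLY of data points — for each `c` of an infinite set of first coordinates inside a closed disc `‖c‖ ≤ ‖ϖ‖ < 1`,
infinitely many second coordinates inside some closed disc `‖y‖ ≤ ‖ϖ_c‖ < 1`, each carrying data — into `G = G'`.

So G3b ("normalisation / uniqueness of `G`", card §F G3b, memo `G3-CHECK-g36.md` §4) is REDUCED IN THE KERNEL to the
supply statement `FrameSupply …` below (an `∃`-statement about Hecke characters of `K` and their avatars: existence and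
Zariski-density in the fibred sense of unramified characters of the infinity types `(−(m+1), n+1)`, `m n : ℕ`, factoring
through the chosen `ℤ_p²`-extension, together with the three pieces of analytic data the frame asks for). The supply is
where the arithmetic content of G3b lives (CM theory: such characters exist for all `(m, n)` with `m + n` in a fixed
class mod `#𝒪_K^× ∣ 2` since `D ≠ −3, −4` is in the route's binders … — NOT asserted here; a typer's fact or a prover's
lemma); this section proves only the reduction, with NO hypothesis on `G`, `G'` beyond the frame.

Consequence for G3a (memo `G3A-CHECK-g39.md` §5): once the supply is available, the analytic functional equation of
`G` under `τ₂` follows from exhibiting ANY series `U * τ₂ G` satisfying the same frame — the frame-internal form of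
g36's typing proposal (`g₁ ↦ g₁⁻¹` on the evaluation points) — by this uniqueness; no separate "uniqueness of the
`p`-adic `L`-function" fact is needed.
-/

section FramePinsG

open IntSeries Field Literature.NumberTheory.EllipticCurves.ModularForms

variable [Fact p.Prime] {N : ℕ}

/-- **A fibred supply of interpolation data for the frame `IsGreenbergLFunctionAnyRoot₂ ι v vbar κ₁ κ₂ g₁ g₂ f D hK LK ·`**
(the hypothesis of G3b♭ below; an honest `∃`/density statement about Hecke characters of `K`, their `p`-adic avatars and
the frame's analytic data — nothing about any `G`): there are `ϖ ∈ ℂ_p` with `0 < ‖ϖ‖ < 1` and an infinite set `D₁` of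
first coordinates `c`, `‖c‖ ≤ ‖ϖ‖`, such that for each `c ∈ D₁` there are `ϖ_c` with `0 < ‖ϖ_c‖ < 1` and infinitely many
second coordinates `y₂`, `‖y₂‖ ≤ ‖ϖ_c‖`, for which SOME data `(ξ, r, m, n, α, θ, L, y)` of the frame sits at the point
`(c, y₂) = (r(g₁) − 1, r(g₂) − 1)`. -/
def FrameSupply (ι : PadicAlgCl p ≃+* ℂ) (κ₁ κ₂ : ZpExtension K p) (g₁ g₂ : absoluteGaloisGroup K)
    (f : CuspForm (CongruenceSubgroup.Gamma0 N) 2) (D : ℕ) [NeZero D]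
    (LK : PowerSeries (PowerSeries (PadicComplexInt p))) : Prop :=
  ∃ ϖ : ℂ_[p], ϖ ≠ 0 ∧ ‖ϖ‖ < 1 ∧ ∃ D₁ : Set (PadicComplexInt p), D₁.Infinite ∧
    (∀ c ∈ D₁, ‖(c : ℂ_[p])‖ ≤ ‖ϖ‖) ∧
    ∀ c ∈ D₁, ∃ ϖ' : ℂ_[p], ϖ' ≠ 0 ∧ ‖ϖ'‖ < 1 ∧
      {y₂ : ℂ_[p] | ‖y₂‖ ≤ ‖ϖ'‖ ∧
        ∃ (ξ : HeckeCharacter K) (r : FramedGaloisRep K (PadicAlgCl p) 1) (m n : ℕ) (α : ℂ)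
          (θ : CuspForm (CongruenceSubgroup.Gamma1 D) ((m + n + 3 : ℕ) : ℤ)) (L : ℂ → ℂ) (y : ℂ_[p]),
          IsPAdicAvatarOf ι ξ r ∧ FactorsThroughPair κ₁ κ₂ r ∧
          (∀ w : IsDedekindDomain.HeightOneSpectrum (NumberField.RingOfIntegers K), ξ.IsUnramifiedAt w) ∧
          ξ.HasInfinityType (fun _ ↦ -((m : ℤ) + 1)) (fun _ ↦ (n : ℤ) + 1) ∧
          α ^ 2 - cuspCoeff f p * α + p = 0 ∧
          IsCMNewformOf (ξ / HeckeCharacter.normCharacter K ^ (m + 1)) θ ∧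
          Differentiable ℂ L ∧
          (∀ s : ℂ, (m : ℝ) + n + 3 < s.re → L s = rankinSelbergEulerProductHecke f ξ s) ∧
          IntSeries.HasValueAt₂ LK 0 (avatarValueAt r g₂ ^ 2 - 1) y ∧
          (c : ℂ_[p]) = avatarValueAt r g₁ - 1 ∧ y₂ = avatarValueAt r g₂ - 1}.Infinite

/-- **G3b♭ (g39) — the frame pins `G`**: two series `G`, `G'` both framed by
`IsGreenbergLFunctionAnyRoot₂ ι v vbar κ₁ κ₂ g₁ g₂ f D hK LK` are EQUAL as soon as the frame has a fibred supply of
interpolation data (`FrameSupply`). Proof: at every data point both frames prescribe the SAME value (it depends only on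
the data), and `IntSeries.eq_of_infinite_hasValueAt₂_eq_fibred` (proved in the tree) concludes. No hypothesis on `G`,
`G'` beyond the frame; in particular no boundedness / non-vanishing / normalisation input. -/
theorem eq_of_isGreenbergLFunctionAnyRoot₂_of_frameSupply {ι : PadicAlgCl p ≃+* ℂ}
    {v vbar : IsDedekindDomain.HeightOneSpectrum (NumberField.RingOfIntegers K)} {κ₁ κ₂ : ZpExtension K p}
    {g₁ g₂ : absoluteGaloisGroup K} {f : CuspForm (CongruenceSubgroup.Gamma0 N) 2} {D : ℕ} [NeZero D] {hK : ℕ}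
    {LK G G' : PowerSeries (PowerSeries (PadicComplexInt p))}
    (hG : IsGreenbergLFunctionAnyRoot₂ ι v vbar κ₁ κ₂ g₁ g₂ f D hK LK G)
    (hG' : IsGreenbergLFunctionAnyRoot₂ ι v vbar κ₁ κ₂ g₁ g₂ f D hK LK G')
    (hsupply : FrameSupply ι κ₁ κ₂ g₁ g₂ f D LK) : G = G' := by
  obtain ⟨ϖ, hϖ0, hϖ, D₁, hD₁, hD₁ϖ, h⟩ := hsupply
  refine eq_of_infinite_hasValueAt₂_eq_fibred hϖ0 hϖ hD₁ hD₁ϖ fun c hc => ?_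
  obtain ⟨ϖ', hϖ'0, hϖ', hinf⟩ := h c hc
  refine ⟨ϖ', hϖ'0, hϖ', hinf.mono fun y₂ hy₂ => ⟨hy₂.1, ?_⟩⟩
  obtain ⟨ξ, r, m, n, α, θ, L, y, hr, hκ, hunr, hinfty, hα, hθ, hL, hL', hy, hc₁, hy₂'⟩ := hy₂.2
  subst hy₂'
  rw [hc₁]
  exact ⟨_, hG.hasValueAt₂ hr hκ hunr hinfty hα hθ hL hL' hy, hG'.hasValueAt₂ hr hκ hunr hinfty hα hθ hL hL' hy⟩

/-- **Corollary (shape of G3a once the supply is in hand)**: if `G` is framed and some `H` is ALSO framed by the same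
frame, then `H = G`; applied with `H := U * τ₂ G` (the candidate produced by the type-II functional equation of the
VALUES, memo `G3A-CHECK-g39.md` §4) it yields the analytic functional equation `G = U * τ₂ G` of §2's shape
(`§2 isUnit_feFactor`: then `U` is a unit for free). Stated for an arbitrary candidate `H`. -/
theorem frame_functionalEquation_of_frameSupply {ι : PadicAlgCl p ≃+* ℂ}
    {v vbar : IsDedekindDomain.HeightOneSpectrum (NumberField.RingOfIntegers K)} {κ₁ κ₂ : ZpExtension K p}
    {g₁ g₂ : absoluteGaloisGroup K} {f : CuspForm (CongruenceSubgroup.Gamma0 N) 2} {D : ℕ} [NeZero D] {hK : ℕ}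
    {LK G H : PowerSeries (PowerSeries (PadicComplexInt p))}
    (hG : IsGreenbergLFunctionAnyRoot₂ ι v vbar κ₁ κ₂ g₁ g₂ f D hK LK G)
    (hH : IsGreenbergLFunctionAnyRoot₂ ι v vbar κ₁ κ₂ g₁ g₂ f D hK LK H)
    (hsupply : FrameSupply ι κ₁ κ₂ g₁ g₂ f D LK) : G = H :=
  eq_of_isGreenbergLFunctionAnyRoot₂_of_frameSupply hG hH hsupply

/-- **Without a supply the frame pins nothing** (the honest converse, recorded so that no reader mistakes the frame for a
definition of `G`): if NO data point exists at all — `FrameSupply` fails in the strongest way, the data set being empty —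
then EVERY series is framed; in particular `0` and `1` are, and they differ. Hence some supply hypothesis is NECESSARY in
G3b♭; the one above is the weakest the tree's identity principle consumes. -/
theorem isGreenbergLFunctionAnyRoot₂_of_no_data {ι : PadicAlgCl p ≃+* ℂ}
    {v vbar : IsDedekindDomain.HeightOneSpectrum (NumberField.RingOfIntegers K)} {κ₁ κ₂ : ZpExtension K p}
    {g₁ g₂ : absoluteGaloisGroup K} {f : CuspForm (CongruenceSubgroup.Gamma0 N) 2} {D : ℕ} [NeZero D] {hK : ℕ}
    {LK : PowerSeries (PowerSeries (PadicComplexInt p))}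
    (hno : ∀ (ξ : HeckeCharacter K) (r : FramedGaloisRep K (PadicAlgCl p) 1),
      IsPAdicAvatarOf ι ξ r → FactorsThroughPair κ₁ κ₂ r → False)
    (G : PowerSeries (PowerSeries (PadicComplexInt p))) :
    IsGreenbergLFunctionAnyRoot₂ ι v vbar κ₁ κ₂ g₁ g₂ f D hK LK G :=
  fun ξ r _ _ _ hr hκ => (hno ξ r hr hκ).elim


/-! ### §3·S (g39) The served inputs of the supply, discharged: root `α` (S4) and Katz value `y` (S7)
(memo `G3B-CHECK-g39.md` §1). `CharSupply` = `FrameSupply` with the two served data `α`, `y` removed; the glue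
`frameSupply_of_charSupply` puts them back (a root of the Hecke polynomial exists in `ℂ`; `LK` HAS a value at
`(0, r(g₂)² − 1)` because `‖r(g₂) − 1‖ < 1` for `r` through the `ℤ_p²`-tower, tree
`norm_avatarValueAt_sub_one_lt_of_factorsThroughPair`, and bounded double series converge on the open bidisc, tree
`IntSeries.summable_coeff_mul_pow_mul_pow`). What remains in `CharSupply` is exactly the memo's S1–S3, S5, S6, S8. -/

omit [Fact p.Prime] in
/-- A complex root of the Hecke polynomial `X² − a_p X + p` (S4; `ℂ` is algebraically closed). -/
theorem exists_heckeRoot (f : CuspForm (CongruenceSubgroup.Gamma0 N) 2) :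
    ∃ α : ℂ, α ^ 2 - cuspCoeff f p * α + p = 0 := by
  obtain ⟨α, hα⟩ := IsAlgClosed.exists_root
    (Polynomial.X ^ 2 - Polynomial.C (cuspCoeff f p) * Polynomial.X + Polynomial.C (p : ℂ))
    (by
      rw [Polynomial.degree_add_eq_left_of_degree_lt] <;>
        rw [Polynomial.degree_sub_eq_left_of_degree_lt] <;>
        simp only [Polynomial.degree_pow, Polynomial.degree_X, nsmul_eq_mul, Nat.cast_ofNat, mul_one]
      · norm_num
      · exact (Polynomial.degree_C_mul_X_le _).trans_lt (by norm_num)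
      · refine (Polynomial.degree_C_le).trans_lt ?_
        norm_num
      · exact (Polynomial.degree_C_mul_X_le _).trans_lt (by norm_num))
  refine ⟨α, ?_⟩
  simpa [Polynomial.IsRoot, Polynomial.eval_sub, Polynomial.eval_add, Polynomial.eval_mul,
    Polynomial.eval_pow, Polynomial.eval_X, Polynomial.eval_C] using hα

/-- `‖r(σ)² − 1‖ < 1` for `r` through the `ℤ_p²`-tower (ultrametric: `r² − 1 = (r − 1)·((r − 1) + 2)`). -/
theorem norm_avatarValueAt_sq_sub_one_lt {κ₁ κ₂ : ZpExtension K p} {r : FramedGaloisRep K (PadicAlgCl p) 1}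
    (h : FactorsThroughPair κ₁ κ₂ r) (σ : absoluteGaloisGroup K) :
    ‖avatarValueAt r σ ^ 2 - 1‖ < 1 := by
  have h1 := norm_avatarValueAt_sub_one_lt_of_factorsThroughPair h σ
  have h2 : ‖avatarValueAt r σ - 1 + 2‖ ≤ 1 := by
    refine (IsUltrametricDist.norm_add_le_max _ _).trans (max_le h1.le ?_)
    simpa using IsUltrametricDist.norm_natCast_le_one ℂ_[p] 2
  calc ‖avatarValueAt r σ ^ 2 - 1‖ = ‖(avatarValueAt r σ - 1) * (avatarValueAt r σ - 1 + 2)‖ := by ring_nf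
    _ = ‖avatarValueAt r σ - 1‖ * ‖avatarValueAt r σ - 1 + 2‖ := norm_mul _ _
    _ < 1 := by
      calc ‖avatarValueAt r σ - 1‖ * ‖avatarValueAt r σ - 1 + 2‖ ≤ ‖avatarValueAt r σ - 1‖ * 1 :=
            mul_le_mul_of_nonneg_left h2 (norm_nonneg _)
        _ < 1 := by simpa using h1

/-- `LK` has a value at `(0, z)` for every `‖z‖ < 1` (S7; absolute convergence on the open bidisc). -/
theorem exists_hasValueAt₂_zero_left (LK : PowerSeries (PowerSeries (PadicComplexInt p))) {z : ℂ_[p]}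
    (hz : ‖z‖ < 1) : ∃ y : ℂ_[p], IntSeries.HasValueAt₂ LK 0 z y :=
  ⟨_, (IntSeries.summable_coeff_mul_pow_mul_pow LK (c := 0) (by simp) hz).hasSum⟩

/-- **`CharSupply`** = `FrameSupply` with the served data `α` (root) and `y` (Katz value) removed: a fibred supply of points
`(c, y₂) = (r(g₁) − 1, r(g₂) − 1)` each carrying `(ξ, r, m, n, θ, L)` with S1–S3, S5, S6 (memo `G3B-CHECK-g39.md`). -/
def CharSupply (ι : PadicAlgCl p ≃+* ℂ) (κ₁ κ₂ : ZpExtension K p) (g₁ g₂ : absoluteGaloisGroup K)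
    (f : CuspForm (CongruenceSubgroup.Gamma0 N) 2) (D : ℕ) [NeZero D] : Prop :=
  ∃ ϖ : ℂ_[p], ϖ ≠ 0 ∧ ‖ϖ‖ < 1 ∧ ∃ D₁ : Set (PadicComplexInt p), D₁.Infinite ∧
    (∀ c ∈ D₁, ‖(c : ℂ_[p])‖ ≤ ‖ϖ‖) ∧
    ∀ c ∈ D₁, ∃ ϖ' : ℂ_[p], ϖ' ≠ 0 ∧ ‖ϖ'‖ < 1 ∧
      {y₂ : ℂ_[p] | ‖y₂‖ ≤ ‖ϖ'‖ ∧
        ∃ (ξ : HeckeCharacter K) (r : FramedGaloisRep K (PadicAlgCl p) 1) (m n : ℕ)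
          (θ : CuspForm (CongruenceSubgroup.Gamma1 D) ((m + n + 3 : ℕ) : ℤ)) (L : ℂ → ℂ),
          IsPAdicAvatarOf ι ξ r ∧ FactorsThroughPair κ₁ κ₂ r ∧
          (∀ w : IsDedekindDomain.HeightOneSpectrum (NumberField.RingOfIntegers K), ξ.IsUnramifiedAt w) ∧
          ξ.HasInfinityType (fun _ ↦ -((m : ℤ) + 1)) (fun _ ↦ (n : ℤ) + 1) ∧
          IsCMNewformOf (ξ / HeckeCharacter.normCharacter K ^ (m + 1)) θ ∧
          Differentiable ℂ L ∧
          (∀ s : ℂ, (m : ℝ) + n + 3 < s.re → L s = rankinSelbergEulerProductHecke f ξ s) ∧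
          (c : ℂ_[p]) = avatarValueAt r g₁ - 1 ∧ y₂ = avatarValueAt r g₂ - 1}.Infinite

/-- **Glue**: `CharSupply → FrameSupply` (S4 and S7 discharged in the kernel). -/
theorem frameSupply_of_charSupply {ι : PadicAlgCl p ≃+* ℂ} {κ₁ κ₂ : ZpExtension K p} {g₁ g₂ : absoluteGaloisGroup K}
    {f : CuspForm (CongruenceSubgroup.Gamma0 N) 2} {D : ℕ} [NeZero D]
    (h : CharSupply ι κ₁ κ₂ g₁ g₂ f D) (LK : PowerSeries (PowerSeries (PadicComplexInt p))) :
    FrameSupply ι κ₁ κ₂ g₁ g₂ f D LK := by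
  obtain ⟨ϖ, hϖ0, hϖ, D₁, hD₁, hD₁ϖ, h⟩ := h
  refine ⟨ϖ, hϖ0, hϖ, D₁, hD₁, hD₁ϖ, fun c hc => ?_⟩
  obtain ⟨ϖ', hϖ'0, hϖ', hinf⟩ := h c hc
  refine ⟨ϖ', hϖ'0, hϖ', hinf.mono fun y₂ hy₂ => ⟨hy₂.1, ?_⟩⟩
  obtain ⟨ξ, r, m, n, θ, L, hr, hκ, hunr, hinfty, hθ, hL, hL', hc₁, hy₂'⟩ := hy₂.2
  obtain ⟨α, hα⟩ := exists_heckeRoot (p := p) f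
  obtain ⟨y, hy⟩ := exists_hasValueAt₂_zero_left LK (norm_avatarValueAt_sq_sub_one_lt hκ g₂)
  exact ⟨ξ, r, m, n, α, θ, L, y, hr, hκ, hunr, hinfty, hα, hθ, hL, hL', hy, hc₁, hy₂'⟩

/-- **G3b♭ from `CharSupply`** (the form the memo's GAPs 1–3 feed). -/
theorem eq_of_isGreenbergLFunctionAnyRoot₂_of_charSupply {ι : PadicAlgCl p ≃+* ℂ}
    {v vbar : IsDedekindDomain.HeightOneSpectrum (NumberField.RingOfIntegers K)} {κ₁ κ₂ : ZpExtension K p}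
    {g₁ g₂ : absoluteGaloisGroup K} {f : CuspForm (CongruenceSubgroup.Gamma0 N) 2} {D : ℕ} [NeZero D] {hK : ℕ}
    {LK G G' : PowerSeries (PowerSeries (PadicComplexInt p))}
    (hG : IsGreenbergLFunctionAnyRoot₂ ι v vbar κ₁ κ₂ g₁ g₂ f D hK LK G)
    (hG' : IsGreenbergLFunctionAnyRoot₂ ι v vbar κ₁ κ₂ g₁ g₂ f D hK LK G')
    (hsupply : CharSupply ι κ₁ κ₂ g₁ g₂ f D) : G = G' :=
  eq_of_isGreenbergLFunctionAnyRoot₂_of_frameSupply hG hG' (frameSupply_of_charSupply hsupply LK)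

end FramePinsG

/-! ### §3·T (g39) GAP 3♭ — the avatar is determined by its two base points: de Shalit II.4.17 (52)–(53)
in TWO variables (`r(σ) = (1 + (r(γ₁) − 1))^{κ₁σ} · (1 + (r(γ₂) − 1))^{κ₂σ}` for `r` through the pair), the
kernel part of memo `G3B-CHECK-g39.md` GAP 3 (critic V#26bt #39e (c): «`pairChar_add` splits the descended character,
each factor is a continuous character of `ℤ_p` to which the one-variable density argument applies verbatim» — done
here at once for `ℤ_p²` by density of `ℕ × ℕ`). What GAP 3 still needs after this is ARITHMETIC: the two base points
`r_ξ(γ₁)`, `r_ξ(γ₂)` as functions of the infinity type of `ξ` (multiplicativity in `ξ` + one base character per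
direction), not analysis. -/

section GapThree

open IntSeries ZpExtension Field

variable [Fact p.Prime]

/-- **A continuous character of `ℤ_p²` with principal-unit values at the basis is the product of two `p`-adic
powers**: `F(a, b) = (1 + (F(1,0) − 1))^a · (1 + (F(0,1) − 1))^b` for ALL `a b : ℤ_p` (both sides are continuous
on `ℤ_p²` — tree `continuous_onePlusPow` — and agree on the dense `ℕ × ℕ` by `IsContinuousChar₂.apply_natCast` and
`onePlusPow_natCast`). The two-variable form of the density step of the tree's `avatarValueAt_eq_onePlusPow`. -/
theorem isContinuousChar₂_apply_eq_onePlusPow_mul {F : ℤ_[p] × ℤ_[p] → ℂ_[p]} (hF : IsContinuousChar₂ F)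
    (a b : ℤ_[p]) : F (a, b) = onePlusPow a (F (1, 0) - 1) * onePlusPow b (F (0, 1) - 1) := by
  have hc' : Continuous fun z : ℤ_[p] × ℤ_[p] ↦ onePlusPow z.1 (F (1, 0) - 1) * onePlusPow z.2 (F (0, 1) - 1) :=
    ((continuous_onePlusPow hF.norm_fst_sub_one_lt).comp continuous_fst).mul
      ((continuous_onePlusPow hF.norm_snd_sub_one_lt).comp continuous_snd)
  have hd : DenseRange (Prod.map (Nat.cast : ℕ → ℤ_[p]) (Nat.cast : ℕ → ℤ_[p])) :=
    PadicInt.denseRange_natCast.prodMap PadicInt.denseRange_natCast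
  have key : F = fun z : ℤ_[p] × ℤ_[p] ↦ onePlusPow z.1 (F (1, 0) - 1) * onePlusPow z.2 (F (0, 1) - 1) := by
    refine Continuous.ext_on hd hF.continuous hc' ?_
    rintro _ ⟨⟨m, n⟩, rfl⟩
    simp only [Prod.map_apply, hF.apply_natCast, onePlusPow_natCast, add_sub_cancel]
  exact congrFun key (a, b)

/-- **de Shalit II.4.17 (52)–(53) in two variables**: for `r` factoring through the pair `(κ₁, κ₂)` with generator
pair `(γ₁, γ₂)`, `r(σ) = (1 + (r(γ₁) − 1))^{κ₁σ} · (1 + (r(γ₂) − 1))^{κ₂σ}` for EVERY `σ ∈ Γ_K`. So the avatar — hence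
every evaluation point `(r(g₁) − 1, r(g₂) − 1)` of the frame, for any `g₁ g₂` — is determined by the two base points
`r(γ₁)`, `r(γ₂)`; combined with the tree's descent `ZpExtension.pairChar` this is the dictionary «character ↦ point»
the supply S8 and TOY-1/TOY-2 consume. -/
theorem avatarValueAt_eq_onePlusPow_mul {κ₁ κ₂ : ZpExtension K p} {r : FramedGaloisRep K (PadicAlgCl p) 1}
    (hr : FactorsThroughPair κ₁ κ₂ r) {γ₁ γ₂ : absoluteGaloisGroup K} (hγ : IsTopGeneratorPair κ₁ κ₂ γ₁ γ₂)
    (σ : absoluteGaloisGroup K) :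
    avatarValueAt r σ =
      onePlusPow (Multiplicative.toAdd (κ₁ σ)) (avatarValueAt r γ₁ - 1) *
        onePlusPow (Multiplicative.toAdd (κ₂ σ)) (avatarValueAt r γ₂ - 1) := by
  have hind := hγ.isIndependent
  have hF := isContinuousChar₂_pairChar hr hγ hind
  rw [← pairChar_pairCoord hind hr σ, pairCoord_apply, isContinuousChar₂_apply_eq_onePlusPow_mul hF,
    pairChar_one_zero hr hγ hind, pairChar_zero_one hr hγ hind]

omit [NumberField K] in
/-- **The frame's evaluation point at `(g₁, g₂) = (γ₁⁻¹, γ₂⁻¹)`** (the crux's choice): `r(γᵢ⁻¹) = r(γᵢ)⁻¹ =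
(1 + (r(γᵢ) − 1))^{−1}` — the point of `ξ` in the crux's frame is the INVERSE base point, coordinatewise. -/
theorem avatarValueAt_inv_eq {r : FramedGaloisRep K (PadicAlgCl p) 1} (γ : absoluteGaloisGroup K) :
    avatarValueAt r γ⁻¹ = (avatarValueAt r γ)⁻¹ := by
  have h := avatarValueAt_mul r γ⁻¹ γ
  rw [inv_mul_cancel, avatarValueAt_one] at h
  exact (eq_inv_of_mul_eq_one_left h.symm)

/-- The inverse base point read through `onePlusPow`: `r(γ⁻¹) = (1 + (r(γ) − 1))^{−1}` for `r` through the pair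
(so in the crux's frame `(γ₁⁻¹, γ₂⁻¹)` the evaluation point of `r` is `((1 + u₁)^{−1} − 1, (1 + u₂)^{−1} − 1)` with
`uᵢ = r(γᵢ) − 1` — exponent `−1` in BOTH coordinates of `avatarValueAt_eq_onePlusPow_mul`). -/
theorem avatarValueAt_inv_eq_onePlusPow_neg_one {κ₁ κ₂ : ZpExtension K p} {r : FramedGaloisRep K (PadicAlgCl p) 1}
    (hr : FactorsThroughPair κ₁ κ₂ r) (γ : absoluteGaloisGroup K) :
    avatarValueAt r γ⁻¹ = onePlusPow (-1) (avatarValueAt r γ - 1) := by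
  rw [onePlusPow_neg 1 (norm_avatarValueAt_sub_one_lt_of_factorsThroughPair hr γ), onePlusPow_one, add_sub_cancel,
    avatarValueAt_inv_eq]

end GapThree

/-! ### §3·V (g39) G3b♭′ — the LINE version of «the frame pins `G`», shaped to the sibling crux's PROVED supplies.
The tree already proves frame UNIQUENESS FROM LINE SUPPLIES for the Katz frame `IsKatzMeasure₂`
(`Theorems.CycTangentCMCycTangentBoundFrameUniqueness.isKatzMeasure₂_ext_of_lineSupplies`, crux 22628) and BUILDS such line
supplies (`Theorems.CycTangentCMCycTangentBoundPairSupply.exists_isPAdicAvatarOf_pow_factorsThroughPair` p584708: powers of an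
algebraic character unramified outside `p` have avatars through ANY generator pair, `r_n(γ) = r_1(γ)ⁿ`;
`Theorems.PrintCf2.KatzPeriodRigidity.exists_frameSupply₂_lin`: lines `κ_s` through the pair with pairwise non-proportional
directions, characters `ρ s t` through `κ_s`, node base `g`). The geometry there is LINES THROUGH THE ORIGIN (one `ℤ_p`-quotient
`κ_s ≥ pairKer κ₁ κ₂` per line, points accumulating along it), not the vertical fibres of §3's `FrameSupply`. This section gives
the Greenberg frame the same door: `LineSupply` (data points ON monomial lines `x ↦ ((1+x)^{a_s} − 1, (1+x)^{b_s} − 1)`,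
infinitely many lines, infinitely many points per line accumulating at `0`) ⇒ `G = G'`, by the tree's one-variable identity
principle on each line (`IntSeries.eq_of_infinite_hasValueAt_eq` + `IntSeries.hasValueAt_monomialLine_iff`) and the tree's
lines rigidity `IntSeries.eq_of_monomialLine_eq` (p587151). `lineSupply_point_of_factorsThroughZp` shows how a character through a
line `κ ≥ pairKer` with generator `γ` lands on the monomial line `(κ g₁, κ g₂)` at `x = r(γ) − 1` (tree
`avatarValueAt_eq_onePlusPow`), i.e. exactly the sibling supplies' output shape. With this door GAP 3 of memo `G3B-CHECK-g39.md`
is not needed at all (no base-point arithmetic: the line generator's value IS the parameter), and S1/S2/S8 of `CharSupply` are the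
sibling theorems by name; what stays RS-specific is S5 (GAP 2), S6 (GAP 1) and everywhere-unramifiedness of the supplied `ξ`. -/

section LineDoor

open IntSeries Field Literature.NumberTheory.EllipticCurves.ModularForms ZpExtension

variable [Fact p.Prime] {N : ℕ}

/-- **Line supply of interpolation data** for the frame `IsGreenbergLFunctionAnyRoot₂ ι v vbar κ₁ κ₂ g₁ g₂ f D hK LK`: infinitely
many monomial lines `(a_s, b_s)` (`b_s ≠ 0`, pairwise non-proportional) and on each, data points `(ξ, r, m, n, α, θ, L, y)` of the
frame whose evaluation point is `((1+x)^{a_s} − 1, (1+x)^{b_s} − 1)` for an infinite set of parameters `x` in a closed disc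
`‖x‖ ≤ ‖ϖ_s‖ < 1` (the shape delivered by a character through a line `κ_s ≥ pairKer κ₁ κ₂`: `lineSupply_point_of_factorsThroughZp`). -/
def LineSupply (ι : PadicAlgCl p ≃+* ℂ) (κ₁ κ₂ : ZpExtension K p) (g₁ g₂ : absoluteGaloisGroup K)
    (f : CuspForm (CongruenceSubgroup.Gamma0 N) 2) (D : ℕ) [NeZero D]
    (LK : PowerSeries (PowerSeries (PadicComplexInt p))) : Prop :=
  ∃ a b : ℕ → ℤ_[p], (∀ s, b s ≠ 0) ∧ (∀ s t, s ≠ t → a s * b t ≠ a t * b s) ∧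
    ∀ s, ∃ ϖ : ℂ_[p], ϖ ≠ 0 ∧ ‖ϖ‖ < 1 ∧
      {x : ℂ_[p] | ‖x‖ ≤ ‖ϖ‖ ∧
        ∃ (ξ : HeckeCharacter K) (r : FramedGaloisRep K (PadicAlgCl p) 1) (m n : ℕ) (α : ℂ)
          (θ : CuspForm (CongruenceSubgroup.Gamma1 D) ((m + n + 3 : ℕ) : ℤ)) (L : ℂ → ℂ) (y : ℂ_[p]),
          IsPAdicAvatarOf ι ξ r ∧ FactorsThroughPair κ₁ κ₂ r ∧
          (∀ w : IsDedekindDomain.HeightOneSpectrum (NumberField.RingOfIntegers K), ξ.IsUnramifiedAt w) ∧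
          ξ.HasInfinityType (fun _ ↦ -((m : ℤ) + 1)) (fun _ ↦ (n : ℤ) + 1) ∧
          α ^ 2 - cuspCoeff f p * α + p = 0 ∧
          IsCMNewformOf (ξ / HeckeCharacter.normCharacter K ^ (m + 1)) θ ∧
          Differentiable ℂ L ∧
          (∀ s : ℂ, (m : ℝ) + n + 3 < s.re → L s = rankinSelbergEulerProductHecke f ξ s) ∧
          IntSeries.HasValueAt₂ LK 0 (avatarValueAt r g₂ ^ 2 - 1) y ∧
          avatarValueAt r g₁ = onePlusPow (a s) x ∧ avatarValueAt r g₂ = onePlusPow (b s) x}.Infinite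

/-- **G3b♭′ — the frame pins `G`, line version**: two series framed by the same `IsGreenbergLFunctionAnyRoot₂` frame are
equal as soon as the frame has a `LineSupply`. On each line both monomial-line restrictions take the same values at the
supplied parameters (the value depends only on the data; `hasValueAt_monomialLine_iff`), so they are equal
(`eq_of_infinite_hasValueAt_eq`); infinitely many non-proportional lines then force `G = G'` (`eq_of_monomialLine_eq`). -/
theorem eq_of_isGreenbergLFunctionAnyRoot₂_of_lineSupply {ι : PadicAlgCl p ≃+* ℂ}
    {v vbar : IsDedekindDomain.HeightOneSpectrum (NumberField.RingOfIntegers K)} {κ₁ κ₂ : ZpExtension K p}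
    {g₁ g₂ : absoluteGaloisGroup K} {f : CuspForm (CongruenceSubgroup.Gamma0 N) 2} {D : ℕ} [NeZero D] {hK : ℕ}
    {LK G G' : PowerSeries (PowerSeries (PadicComplexInt p))}
    (hG : IsGreenbergLFunctionAnyRoot₂ ι v vbar κ₁ κ₂ g₁ g₂ f D hK LK G)
    (hG' : IsGreenbergLFunctionAnyRoot₂ ι v vbar κ₁ κ₂ g₁ g₂ f D hK LK G')
    (hsupply : LineSupply ι κ₁ κ₂ g₁ g₂ f D LK) : G = G' := by
  obtain ⟨a, b, hb, hprop, h⟩ := hsupply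
  refine eq_of_monomialLine_eq G G' a b hb hprop fun s => ?_
  obtain ⟨ϖ, hϖ0, hϖ, hinf⟩ := h s
  refine eq_of_infinite_hasValueAt_eq hϖ0 hϖ (hinf.mono fun x hx => ⟨hx.1, ?_⟩)
  have hx1 : ‖x‖ < 1 := hx.1.trans_lt hϖ
  obtain ⟨ξ, r, m, n, α, θ, L, y, hr, hκ, hunr, hinfty, hα, hθ, hL, hL', hy, h₁, h₂⟩ := hx.2
  have e₁ := hG.hasValueAt₂ hr hκ hunr hinfty hα hθ hL hL' hy
  have e₂ := hG'.hasValueAt₂ hr hκ hunr hinfty hα hθ hL hL' hy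
  rw [h₁, h₂] at e₁ e₂
  exact ⟨_, (hasValueAt_monomialLine_iff (a s) (b s) G hx1 _).mpr e₁,
    (hasValueAt_monomialLine_iff (a s) (b s) G' hx1 _).mpr e₂⟩

/-- **How a character through a LINE lands on a monomial line** (the sibling supplies' output shape ↦ `LineSupply`'s
point clause): if `r` factors through a `ℤ_p`-quotient `κ` with topological generator `γ`, then for ANY `g₁ g₂`,
`r(gᵢ) = (1 + (r(γ) − 1))^{κ gᵢ}` — the evaluation point `(r(g₁) − 1, r(g₂) − 1)` of the frame lies on the monomial line
`(κ g₁, κ g₂)` at the parameter `x = r(γ) − 1` (tree `avatarValueAt_eq_onePlusPow`, de Shalit II.4.17 (52)). If moreover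
`pairKer κ₁ κ₂ ≤ ker κ` then `r` factors through the pair (tree `FactorsThroughPair`, by definition of `pairKer`). -/
theorem lineSupply_point_of_factorsThroughZp {κ : ZpExtension K p} {r : FramedGaloisRep K (PadicAlgCl p) 1}
    (h : FactorsThroughZp κ r) {γ : absoluteGaloisGroup K} (hγ : κ.IsTopGenerator γ) (g₁ g₂ : absoluteGaloisGroup K) :
    avatarValueAt r g₁ = onePlusPow (Multiplicative.toAdd (κ g₁)) (avatarValueAt r γ - 1) ∧
      avatarValueAt r g₂ = onePlusPow (Multiplicative.toAdd (κ g₂)) (avatarValueAt r γ - 1) :=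
  ⟨avatarValueAt_eq_onePlusPow h hγ g₁, avatarValueAt_eq_onePlusPow h hγ g₂⟩

omit [NumberField K] in
/-- A character through a line `κ` containing the common kernel of the pair factors through the pair. -/
theorem factorsThroughPair_of_factorsThroughZp_of_pairKer_le {κ κ₁ κ₂ : ZpExtension K p}
    {A : Type*} [CommRing A] [TopologicalSpace A] {r : FramedGaloisRep K A 1}
    (h : FactorsThroughZp κ r) (hle : pairKer κ₁ κ₂ ≤ κ.kerSubgroup) : FactorsThroughPair κ₁ κ₂ r := by
  intro σ h₁ h₂
  exact h σ (mem_kerSubgroup.mp (hle (mem_pairKer_iff.mpr ⟨h₁, h₂⟩)))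


/-- **Adapter: line data in the sibling crux's shape ⇒ `LineSupply`.** Lines `κ_s` (any `ℤ_p`-quotients of `Γ_K`) with
generators `γ_s`, directions read at the frame's base `(g₁, g₂)` — `b_s = κ_s g₂ ≠ 0`, `(κ_s g₁, κ_s g₂)` pairwise
non-proportional (for the crux's `(g₁, g₂) = (γ₁⁻¹, γ₂⁻¹)` these are the NEGATIVES of the hypotheses `hc₂`, `hprop` of
`Theorems.CycTangentCMCycTangentBoundFrameUniqueness.isKatzMeasure₂_ext_of_lineSupplies`, equivalent to them) — and, per line,
an infinite set of frame data `(ξ, r, …)` with `r` through `κ_s`, parametrised by `x = r(γ_s) − 1` in a closed disc of radius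
`< 1`. Then `LineSupply` holds with `a_s = κ_s g₁`, `b_s = κ_s g₂` (`lineSupply_point_of_factorsThroughZp`). -/
theorem lineSupply_of_lineData {ι : PadicAlgCl p ≃+* ℂ} {κ₁ κ₂ : ZpExtension K p} {g₁ g₂ : absoluteGaloisGroup K}
    {f : CuspForm (CongruenceSubgroup.Gamma0 N) 2} {D : ℕ} [NeZero D]
    {LK : PowerSeries (PowerSeries (PadicComplexInt p))}
    (κ : ℕ → ZpExtension K p) (γ : ℕ → absoluteGaloisGroup K) (hγ : ∀ s, (κ s).IsTopGenerator (γ s))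
    (hb : ∀ s, Multiplicative.toAdd (κ s g₂) ≠ 0)
    (hprop : ∀ s t, s ≠ t → Multiplicative.toAdd (κ s g₁) * Multiplicative.toAdd (κ t g₂) ≠
      Multiplicative.toAdd (κ t g₁) * Multiplicative.toAdd (κ s g₂))
    (hdata : ∀ s, ∃ ϖ : ℂ_[p], ϖ ≠ 0 ∧ ‖ϖ‖ < 1 ∧
      {x : ℂ_[p] | ‖x‖ ≤ ‖ϖ‖ ∧
        ∃ (ξ : HeckeCharacter K) (r : FramedGaloisRep K (PadicAlgCl p) 1) (m n : ℕ) (α : ℂ)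
          (θ : CuspForm (CongruenceSubgroup.Gamma1 D) ((m + n + 3 : ℕ) : ℤ)) (L : ℂ → ℂ) (y : ℂ_[p]),
          IsPAdicAvatarOf ι ξ r ∧ FactorsThroughPair κ₁ κ₂ r ∧
          (∀ w : IsDedekindDomain.HeightOneSpectrum (NumberField.RingOfIntegers K), ξ.IsUnramifiedAt w) ∧
          ξ.HasInfinityType (fun _ ↦ -((m : ℤ) + 1)) (fun _ ↦ (n : ℤ) + 1) ∧
          α ^ 2 - cuspCoeff f p * α + p = 0 ∧
          IsCMNewformOf (ξ / HeckeCharacter.normCharacter K ^ (m + 1)) θ ∧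
          Differentiable ℂ L ∧
          (∀ s : ℂ, (m : ℝ) + n + 3 < s.re → L s = rankinSelbergEulerProductHecke f ξ s) ∧
          IntSeries.HasValueAt₂ LK 0 (avatarValueAt r g₂ ^ 2 - 1) y ∧
          FactorsThroughZp (κ s) r ∧ x = avatarValueAt r (γ s) - 1}.Infinite) :
    LineSupply ι κ₁ κ₂ g₁ g₂ f D LK := by
  refine ⟨fun s ↦ Multiplicative.toAdd (κ s g₁), fun s ↦ Multiplicative.toAdd (κ s g₂), hb, hprop, fun s ↦ ?_⟩
  obtain ⟨ϖ, hϖ0, hϖ, hinf⟩ := hdata s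
  refine ⟨ϖ, hϖ0, hϖ, hinf.mono fun x hx ↦ ⟨hx.1, ?_⟩⟩
  obtain ⟨ξ, r, m, n, α, θ, L, y, hr, hκ, hunr, hinfty, hα, hθ, hL, hL', hy, hline, hx'⟩ := hx.2
  obtain ⟨h₁, h₂⟩ := lineSupply_point_of_factorsThroughZp hline (hγ s) g₁ g₂
  subst hx'
  exact ⟨ξ, r, m, n, α, θ, L, y, hr, hκ, hunr, hinfty, hα, hθ, hL, hL', hy, h₁, h₂⟩

omit [NumberField K] in
/-- Directions at inverse base elements are negated (`κ g⁻¹ = −κ g` additively), so `b_s ≠ 0` and pairwise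
non-proportionality at `(γ₁⁻¹, γ₂⁻¹)` are equivalent to the same conditions at `(γ₁, γ₂)`. -/
theorem toAdd_apply_inv (κ : ZpExtension K p) (g : absoluteGaloisGroup K) :
    Multiplicative.toAdd (κ g⁻¹) = -Multiplicative.toAdd (κ g) := by
  rw [map_inv, toAdd_inv]

end LineDoor

/-! ### §3·W (g39) From SEQUENCES to `LineSupply`: the sibling's hypothesis list verbatim.
`isKatzMeasure₂_ext_of_lineSupplies` (crux 22628) consumes, per line `s`, a SEQUENCE `k ↦ (ρ s k, r s k, …)` with
`r s k (γ_s) → 1` and `r s k (γ_s) ≠ 1` frequently; `LineSupply` wants an infinite SET of parameters in a closed disc. The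
conversion is elementary topology (`infinite_setOf_of_tendsto_zero`: a sequence tending to `0` and frequently nonzero has
infinitely many values in every closed disc `‖x‖ ≤ ‖ϖ‖`, `ϖ ≠ 0`), whence `lineSupply_of_lineSeq`, whose hypotheses are those
of the sibling theorem with the Katz data clause replaced by the Greenberg frame's. -/

section LineSeq

open Filter Topology IntSeries Field Literature.NumberTheory.EllipticCurves.ModularForms ZpExtension

variable [Fact p.Prime] {N : ℕ}

omit [NumberField K] in
/-- `‖p‖ < 1` and `p ≠ 0` in `ℂ_p`. [folklore] -/
theorem norm_natCast_p_lt_one_and_ne_zero : ‖((p : ℕ) : ℂ_[p])‖ < 1 ∧ ((p : ℕ) : ℂ_[p]) ≠ 0 := by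
  have hnorm : ‖((p : ℕ) : ℂ_[p])‖ = (p : ℝ)⁻¹ := by
    rw [← map_natCast (algebraMap ℚ_[p] ℂ_[p]) p]
    exact (PadicComplex.norm_extends' (p := p) (p : ℚ_[p])).trans Padic.norm_p
  refine ⟨?_, ?_⟩
  · rw [hnorm]
    exact inv_lt_one_of_one_lt₀ (by exact_mod_cast (Fact.out : p.Prime).one_lt)
  · rw [← norm_pos_iff, hnorm]
    exact inv_pos.mpr (by exact_mod_cast (Fact.out : p.Prime).pos)

omit [NumberField K] in
/-- **A sequence tending to `0` and frequently nonzero has infinitely many values in every closed disc `‖x‖ ≤ ‖ϖ‖`,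
`ϖ ≠ 0`** — together with any property `P` holding along the sequence. (If the set were finite, its nonzero members stay
at distance `≥ δ > 0` from `0`, so eventually the sequence avoids them while lying in the disc: eventually `0`.) -/
theorem infinite_setOf_of_tendsto_zero {x : ℕ → ℂ_[p]} (hlim : Tendsto x atTop (𝓝 0)) (hne : ∃ᶠ k in atTop, x k ≠ 0)
    {ϖ : ℂ_[p]} (hϖ0 : ϖ ≠ 0) {P : ℂ_[p] → Prop} (hP : ∀ k, P (x k)) :
    {y : ℂ_[p] | ‖y‖ ≤ ‖ϖ‖ ∧ P y}.Infinite := by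
  intro hfin
  have hT : ({y : ℂ_[p] | ‖y‖ ≤ ‖ϖ‖ ∧ P y} \ {0}).Finite := hfin.sdiff
  have h1 : ∀ᶠ k in atTop, ∀ y ∈ {y : ℂ_[p] | ‖y‖ ≤ ‖ϖ‖ ∧ P y} \ {0}, x k ≠ y := by
    refine (eventually_all_finite hT).mpr fun y hy ↦ ?_
    have hy0 : y ≠ 0 := fun h ↦ hy.2 h
    have hev : ∀ᶠ k in atTop, dist (x k) 0 < ‖y‖ := Metric.tendsto_nhds.mp hlim ‖y‖ (norm_pos_iff.mpr hy0)
    exact hev.mono fun k hk h ↦ by rw [dist_zero_right, h] at hk; exact lt_irrefl _ hk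
  have h2 : ∀ᶠ k in atTop, ‖x k‖ ≤ ‖ϖ‖ :=
    (Metric.tendsto_nhds.mp hlim ‖ϖ‖ (norm_pos_iff.mpr hϖ0)).mono fun k hk ↦ by
      rw [dist_zero_right] at hk; exact hk.le
  have h3 : ∀ᶠ k in atTop, x k = 0 := (h1.and h2).mono fun k hk ↦ by
    by_contra h0
    exact hk.1 (x k) ⟨⟨hk.2, hP k⟩, h0⟩ rfl
  obtain ⟨k, hk, hk0⟩ := (hne.and_eventually h3).exists
  exact hk hk0

/-- **`LineSupply` from line SEQUENCES (the sibling crux's hypothesis list).** Lines `κ_s` with generators `γ_s`, directions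
at `(g₁, g₂)` with `κ_s g₂ ≠ 0` and pairwise non-proportional; per `(s, k)` a frame datum `(ξ s k, r s k, …)` with `r s k`
through `κ_s` AND through the pair; along each line `r s k (γ_s) → 1`, `≠ 1` frequently. Then `LineSupply`, hence (§3·V) the
frame pins `G`. Compare `Theorems.CycTangentCMCycTangentBoundFrameUniqueness.isKatzMeasure₂_ext_of_lineSupplies`: same
`κ γ hγ hc₂ hprop hr hκr hlim hne`, Katz data clause ↦ Greenberg data clause. -/
theorem lineSupply_of_lineSeq {ι : PadicAlgCl p ≃+* ℂ} {κ₁ κ₂ : ZpExtension K p} {g₁ g₂ : absoluteGaloisGroup K}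
    {f : CuspForm (CongruenceSubgroup.Gamma0 N) 2} {D : ℕ} [NeZero D]
    {LK : PowerSeries (PowerSeries (PadicComplexInt p))}
    (κ : ℕ → ZpExtension K p) (γ : ℕ → absoluteGaloisGroup K) (hγ : ∀ s, (κ s).IsTopGenerator (γ s))
    (hb : ∀ s, Multiplicative.toAdd (κ s g₂) ≠ 0)
    (hprop : ∀ s t, s ≠ t → Multiplicative.toAdd (κ s g₁) * Multiplicative.toAdd (κ t g₂) ≠
      Multiplicative.toAdd (κ t g₁) * Multiplicative.toAdd (κ s g₂))
    (ξ : ℕ → ℕ → HeckeCharacter K) (r : ℕ → ℕ → FramedGaloisRep K (PadicAlgCl p) 1) (m n : ℕ → ℕ → ℕ)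
    (α : ℕ → ℕ → ℂ) (θ : (s k : ℕ) → CuspForm (CongruenceSubgroup.Gamma1 D) ((m s k + n s k + 3 : ℕ) : ℤ))
    (L : ℕ → ℕ → ℂ → ℂ) (y : ℕ → ℕ → ℂ_[p])
    (hr : ∀ s k, IsPAdicAvatarOf ι (ξ s k) (r s k)) (hκ : ∀ s k, FactorsThroughPair κ₁ κ₂ (r s k))
    (hκr : ∀ s k, FactorsThroughZp (κ s) (r s k))
    (hunr : ∀ s k (w : IsDedekindDomain.HeightOneSpectrum (NumberField.RingOfIntegers K)), (ξ s k).IsUnramifiedAt w)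
    (hinf : ∀ s k, (ξ s k).HasInfinityType (fun _ ↦ -((m s k : ℤ) + 1)) (fun _ ↦ (n s k : ℤ) + 1))
    (hα : ∀ s k, α s k ^ 2 - cuspCoeff f p * α s k + p = 0)
    (hθ : ∀ s k, IsCMNewformOf (ξ s k / HeckeCharacter.normCharacter K ^ (m s k + 1)) (θ s k))
    (hL : ∀ s k, Differentiable ℂ (L s k))
    (hL' : ∀ s k (z : ℂ), (m s k : ℝ) + n s k + 3 < z.re → L s k z = rankinSelbergEulerProductHecke f (ξ s k) z)
    (hy : ∀ s k, IntSeries.HasValueAt₂ LK 0 (avatarValueAt (r s k) g₂ ^ 2 - 1) (y s k))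
    (hlim : ∀ s, Tendsto (fun k ↦ avatarValueAt (r s k) (γ s)) atTop (𝓝 1))
    (hne : ∀ s, ∃ᶠ k in atTop, avatarValueAt (r s k) (γ s) ≠ 1) :
    LineSupply ι κ₁ κ₂ g₁ g₂ f D LK := by
  refine lineSupply_of_lineData κ γ hγ hb hprop fun s ↦ ?_
  obtain ⟨hp1, hp0⟩ := norm_natCast_p_lt_one_and_ne_zero (p := p)
  refine ⟨((p : ℕ) : ℂ_[p]), hp0, hp1, ?_⟩
  have hlim0 : Tendsto (fun k ↦ avatarValueAt (r s k) (γ s) - 1) atTop (𝓝 0) := by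
    simpa using (hlim s).sub_const 1
  have hne0 : ∃ᶠ k in atTop, avatarValueAt (r s k) (γ s) - 1 ≠ 0 :=
    (hne s).mono fun k hk h ↦ hk (sub_eq_zero.mp h)
  refine infinite_setOf_of_tendsto_zero hlim0 hne0 hp0 (P := fun x ↦ ∃ (ξ' : HeckeCharacter K)
      (r' : FramedGaloisRep K (PadicAlgCl p) 1) (m' n' : ℕ) (α' : ℂ)
      (θ' : CuspForm (CongruenceSubgroup.Gamma1 D) ((m' + n' + 3 : ℕ) : ℤ)) (L' : ℂ → ℂ) (y' : ℂ_[p]),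
      IsPAdicAvatarOf ι ξ' r' ∧ FactorsThroughPair κ₁ κ₂ r' ∧
      (∀ w : IsDedekindDomain.HeightOneSpectrum (NumberField.RingOfIntegers K), ξ'.IsUnramifiedAt w) ∧
      ξ'.HasInfinityType (fun _ ↦ -((m' : ℤ) + 1)) (fun _ ↦ (n' : ℤ) + 1) ∧
      α' ^ 2 - cuspCoeff f p * α' + p = 0 ∧
      IsCMNewformOf (ξ' / HeckeCharacter.normCharacter K ^ (m' + 1)) θ' ∧
      Differentiable ℂ L' ∧
      (∀ z : ℂ, (m' : ℝ) + n' + 3 < z.re → L' z = rankinSelbergEulerProductHecke f ξ' z) ∧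
      IntSeries.HasValueAt₂ LK 0 (avatarValueAt r' g₂ ^ 2 - 1) y' ∧
      FactorsThroughZp (κ s) r' ∧ x = avatarValueAt r' (γ s) - 1) fun k ↦ ?_
  exact ⟨ξ s k, r s k, m s k, n s k, α s k, θ s k, L s k, y s k, hr s k, hκ s k, hunr s k, hinf s k, hα s k,
    hθ s k, hL s k, hL' s k, hy s k, hκr s k, rfl⟩

end LineSeq

/-! ### §5 (g40 · v1.3; v1.4: even taming exponent, GAP 2 consumed in its even-parity form) CM LINE SEQUENCES — `LineSupply`
for the Greenberg frame IN THE KERNEL, modulo exactly two named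
literature typings: GAP 1 `CMNewformLevelSupply` (the CM newform of an everywhere-unramified character sits at level `Γ₁(D)`)
and GAP 2 `RankinSelbergContinuationSupply[Even]` (Rankin–Selberg continuation for `f`; §5·G proves the even-parity form from
the tree's Jacquet fact). A port of the sibling crux 22628's PROVED
`Theorems.CycTangentCMCycTangentBoundFrameUniquenessCM.isKatzMeasure₂_unique_of_cm`, Steps 1–8, to the frame
`IsGreenbergLFunctionAnyRoot₂`, feeding §3·W `lineSupply_of_lineSeq` (whose hypothesis list is the sibling's by design).

SEED (critic V#26bv r1). The sibling starts from its route's `ψ` of type `(1, 0)`; the Greenberg frame carries no character,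
so the seed is CONSTRUCTED for every imaginary quadratic `K` of ANY class number: `exists_hasInfinityType_one_zero` — source
`Rank1Residual.X11b.Three.LambdaSupply.exists_character_quotient_type_one` (Weil 1956 §1: an algebraic `Ψ`, of some type
`(a, b)`, with `Ψ·(Ψ∘c)⁻¹` of type `(1, −1)`), uniqueness of infinity types on a totally complex field
(`HeckeCharacter.HasInfinityType.eq_of_isTotallyComplex`, so `a − b = 1`) and the twist `ψ := Ψ · ‖·‖^{b}` of exact type
`(1, 0)`. Then verbatim as in the sibling: `Ψ₁ := (ψ^N)⁻¹` with `ψ^N` unramified EVERYWHERE (`exists_pow_forall_isUnramifiedAt`),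
type `(−N, 0)`, `N ≥ 1`; tamed pair-avatars `e∘χ₁ⁿ` of `Ψ₁^{W n}` (p584708 + `exists_pow_norm_sub_one_lt`); the split-prime line
`κ_𝔭` (`exists_splitPrimeLine_factorsThroughZp`); `θ_c` = outer complex conjugation; lines `κ_s = p(s+1)κ_𝔭 − κ_𝔭∘θ_c`
(`exists_line_of_direction`), characters `φ_s = χ₁^{a_s}(χ₁∘θ_c)⁻¹`. The `≠ 1` step (Step 7) keys on the avatar `e∘χ₁` of
`Ψ₁^{W}`, of type `(−N·W, 0) ≠ (0, 0)`, which is RAMIFIED at `v`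
(`Theorems.CycTangentCMCycTangentBoundAvatarRamified.not_isUnramifiedAt_avatar_of_hasInfinityType_ne_zero`).

WHAT CHANGES vs the sibling (Step 8 only). No `ψ⁻¹` twist and no `j < m`: the supplied characters are
`ρ_{s,k} = Ψ₁^{W a_s p^k} · (Ψ₁^{W p^k} ∘ c)⁻¹`, of type `(−(m+1), n+1)` with `m + 1 = N W a_s p^k`, `n + 1 = N W p^k` (both
`≥ 1`), unramified at EVERY finite place (the frame's clause `∀ w, ξ.IsUnramifiedAt w`); `FactorsThroughPair` comes from the line
containing `pairKer` (§3·V `factorsThroughPair_of_factorsThroughZp_of_pairKer_le`); the root `α` and the Katz value `y` are §3·S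
(`exists_heckeRoot`, `exists_hasValueAt₂_zero_left` + `norm_avatarValueAt_sq_sub_one_lt`); the CM newform `θ_{s,k}` and the
continuation `L_{s,k}` are the two named inputs; the frame's base is `(γ₁⁻¹, γ₂⁻¹)` (directions negate, `toAdd_apply_inv`, so
`b_s ≠ 0` and pairwise non-proportionality transfer from `(γ₁, γ₂)`). Headline: `lineSupply_of_cm` and
`eq_of_isGreenbergLFunctionAnyRoot₂_of_cm` — two series framed by the same CM-supplied Greenberg frame are EQUAL — and its
instance `eq_of_isGreenbergLFunctionAnyRoot₂_of_cm_cruxFrame` at the crux's literal frame parameters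
`(D, h_K) = (|d_K|, h(K))`. Residual G3b = `LineSupply` is thereby CLOSED in the kernel modulo GAP 1 / GAP 2 (literature-typing
wants [S]/[M] on the card's residual table). Nothing about any curve is asserted; no summit statement is proved; BSD is not proved. -/

section CMLineSeq

open Filter Topology Field Literature Literature.NumberTheory.EllipticCurves.ModularForms
open Summit.BirchSwinnertonDyer.Rank1Residual.X11b Summit.BirchSwinnertonDyer.Rank1Residual.X11b.LambdaSupply
open Summit.BirchSwinnertonDyer.Rank1Residual.X11b.Three.LambdaSupply
open Summit.BirchSwinnertonDyer.BirchSwinnertonDyer.Theorems.CycTangentCMCycTangentBoundUniquenessLines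
open Summit.BirchSwinnertonDyer.BirchSwinnertonDyer.Theorems.CycTangentCMCycTangentBoundFrameUniquenessCM

variable [Fact p.Prime] {N : ℕ}

/-- **Seed (critic V#26bv r1): every imaginary quadratic field carries a Hecke character of infinity type `(1, 0)`** — any
class number, no curve. From `X11b.Three.LambdaSupply.exists_character_quotient_type_one` (an algebraic `Ψ` of some type
`(a, b)` whose quotient `Ψ·(Ψ∘c)⁻¹`, of type `(a − b, b − a)`, has type `(1, −1)`): uniqueness of the infinity type on the
totally complex `K` gives `a − b = 1`, and `Ψ · ‖·‖^{b}` (`‖·‖` of type `(−1, −1)`) has type `(a − b, 0) = (1, 0)`.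
[cite: Weil1956, §1] [cite: SerreAbelianLadic1968, Ch. II §2.3–2.4] -/
theorem exists_hasInfinityType_one_zero (hK : IsImaginaryQuadratic K) :
    ∃ ψ : HeckeCharacter K, ψ.HasInfinityType (fun _ ↦ 1) (fun _ ↦ 0) := by
  classical
  haveI : IsCMField K := hK.isCMField
  haveI : IsTotallyComplex K := hK.2
  haveI : Subsingleton (InfinitePlace K) := subsingleton_infinitePlace hK.1
  obtain ⟨Ψ, hΨa, -, -, hQ⟩ := exists_character_quotient_type_one (K := K) hK.1 (p := 2) le_rfl
  obtain ⟨a, b, hab⟩ := (HeckeCharacter.isAlgebraic_iff_exists_hasInfinityType Ψ).mp hΨa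
  have hc : (HeckeCharacter.galConj ((IsCMField.complexConj K).restrictScalars ℚ) Ψ).HasInfinityType b a :=
    hab.galConj_complexConj
  obtain ⟨h1, -⟩ := (hab.mul' hc.inv).eq_of_isTotallyComplex hQ
  obtain ⟨w₀⟩ := (inferInstance : Nonempty (InfinitePlace K))
  have hab1 : a w₀ + -b w₀ = 1 := by
    have := congr_fun h1 w₀
    simpa only [Pi.add_apply, Pi.neg_apply] using this
  refine ⟨Ψ * HeckeCharacter.normCharacter K ^ (b w₀), ?_⟩
  have hN := (HeckeCharacter.hasInfinityType_normCharacter' (K := K)).zpow' (b w₀)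
  have h := hab.mul' hN
  have hw : ∀ w : InfinitePlace K, ¬ w.IsReal := fun w ↦
    InfinitePlace.not_isReal_iff_isComplex.mpr (hK.2.isComplex w)
  convert h using 2 with w w
  · rw [Subsingleton.elim w w₀]
    simp only [Pi.add_apply, Pi.smul_apply, smul_eq_mul]
    linarith
  · rw [Subsingleton.elim w w₀]
    simp only [Pi.add_apply, Pi.smul_apply, smul_eq_mul, if_neg (hw w₀)]
    ring

variable (K) in
/-- **GAP 1 (named `Prop` input) — the CM newform of an everywhere-unramified character, at the prescribed level `Γ₁(D)`.**
For every Hecke character `ξ` of `K` unramified at all finite places, of infinity type `(−(m+1), n+1)`, the character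
`ξ·‖·‖^{−(m+1)}` (type `(0, m+n+2)`, still everywhere unramified) has a CM newform `θ ∈ S_{m+n+3}(Γ₁(D))` in the frame's
sense `IsCMNewformOf`. TRUE for `K` imaginary quadratic and `D = |d_K|` (Hecke–Shimura: the theta series of a Grössencharacter
of conductor `𝔣` is a newform of level `|d_K|·N𝔣`, here `𝔣 = 1`; Ribet's packaging); the tree's
`ModularForms.exists_isCMNewformOf` (named fact `Ribet1977_cmNewform_of_heckeCharacter`) gives `∃ M`, not the sharp `M = |d_K|`
— that sharpening is the literature-typing want this input names (residual table, [S]). An INPUT here, never asserted.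
[cite: Ribet1977Nebentypus, §3 Thm. (3.4), Cor. (3.5)] [cite: Shimura1971, Lemma 3] [cite: MiyakeModularForms1989, Thm. 4.8.2] -/
def CMNewformLevelSupply (D : ℕ) [NeZero D] : Prop :=
  ∀ (ξ : HeckeCharacter K) (m n : ℕ), (∀ w : HeightOneSpectrum (𝓞 K), ξ.IsUnramifiedAt w) →
    ξ.HasInfinityType (fun _ ↦ -((m : ℤ) + 1)) (fun _ ↦ (n : ℤ) + 1) →
    ∃ θ : CuspForm (CongruenceSubgroup.Gamma1 D) ((m + n + 3 : ℕ) : ℤ),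
      IsCMNewformOf (ξ / HeckeCharacter.normCharacter K ^ (m + 1)) θ

variable (K) in
/-- **GAP 2 (named `Prop` input) — Rankin–Selberg continuation for `f`.** For every everywhere-unramified `ξ` of type
`(−(m+1), n+1)` the Euler product `rankinSelbergEulerProductHecke f ξ s` (absolutely convergent on `re s > 3/2 + (n − m)/2`,
in particular on the frame's half-plane `re s > m + n + 3`) is the restriction of an ENTIRE function. TRUE for the crux's `f`
(the newform of `E/ℚ`, `IsNewformOf W f`): `ξ ≠ ξ∘c` (the type is not symmetric), so `AI(ξ)` is cuspidal of weight
`m + n + 3 ≥ 3 ≠ 2`, and the naive product is `L(BC_K π_f ⊗ ξ, s)` factor by factor (`ξ` unramified everywhere; Steinberg /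
zero / residue-degree-one factors at `ℓ ∣ N`, `ℓ ∣ d_K`), entire by Rankin–Selberg (Jacquet; Li 1979 Thm. 2.2). For a
non-eigenform `f` nothing is claimed: this is an INPUT consumed at the crux's `f` (residual table, [M]).
[cite: Li1979, Thm. 2.2] [cite: Jacquet1972, Thm. 19.14] [cite: BuyukbodukLei2019IntegralColeman, Thm. 2.18] -/
def RankinSelbergContinuationSupply (f : CuspForm (CongruenceSubgroup.Gamma0 N) 2) : Prop :=
  ∀ (ξ : HeckeCharacter K) (m n : ℕ), (∀ w : HeightOneSpectrum (𝓞 K), ξ.IsUnramifiedAt w) →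
    ξ.HasInfinityType (fun _ ↦ -((m : ℤ) + 1)) (fun _ ↦ (n : ℤ) + 1) →
    ∃ L : ℂ → ℂ, Differentiable ℂ L ∧
      ∀ s : ℂ, (m : ℝ) + n + 3 < s.re → L s = rankinSelbergEulerProductHecke f ξ s

variable (K) in
/-- **GAP 2, even parity (v1.4) — the form the construction actually consumes.** `RankinSelbergContinuationSupply K f`
restricted to the characters with `m + n` EVEN: the CM line sequences of `lineSupply_of_cm` have `m + 1 = N W a_s p^k`,
`n + 1 = N W p^k` with `W` EVEN (v1.4 doubles the taming exponent), so only this parity is ever used — and this parity is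
exactly what the tree's Jacquet fact delivers (§5·G `rankinSelbergContinuationSupplyEven_of_jacquet`): for `2r = m + n` the
character `(ξ∘c)·‖·‖^{n−r}` is everywhere unramified of the unitary type `(r+1, −(r+1))`, and
`L(f/K, (ξ∘c)‖·‖^{t}, s) = L(f/K, ξ, s + t)`. [cite: Jacquet1972, §19 Cor. 19.15] [cite: Li1979, Thm. 2.2] -/
def RankinSelbergContinuationSupplyEven (f : CuspForm (CongruenceSubgroup.Gamma0 N) 2) : Prop :=
  ∀ (ξ : HeckeCharacter K) (m n : ℕ), Even (m + n) → (∀ w : HeightOneSpectrum (𝓞 K), ξ.IsUnramifiedAt w) →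
    ξ.HasInfinityType (fun _ ↦ -((m : ℤ) + 1)) (fun _ ↦ (n : ℤ) + 1) →
    ∃ L : ℂ → ℂ, Differentiable ℂ L ∧
      ∀ s : ℂ, (m : ℝ) + n + 3 < s.re → L s = rankinSelbergEulerProductHecke f ξ s

/-- The full supply restricts to the even-parity supply (so every v1.3 / v1.3.1 statement granted
`RankinSelbergContinuationSupply K f` is recovered from its v1.4 form by `.toEven`). [folklore] -/
theorem RankinSelbergContinuationSupply.toEven {f : CuspForm (CongruenceSubgroup.Gamma0 N) 2}
    (h : RankinSelbergContinuationSupply K f) : RankinSelbergContinuationSupplyEven K f :=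
  fun ξ m n _ hu ht ↦ h ξ m n hu ht

/-- **`LineSupply` for the Greenberg frame from CM line sequences (sibling Steps 1–8, kernel; GAP 1 / GAP 2 the only inputs).**
`K` imaginary quadratic (any class number), `p` odd and split (`v ≠ v̄` above `p`, `ι` inducing `v`), `(κ₁, κ₂; γ₁, γ₂)` a
generator pair, `f ∈ S₂(Γ₀(N))`, any `D`, any `LK`: granted `CMNewformLevelSupply K D` and (v1.4) the EVEN-parity
`RankinSelbergContinuationSupplyEven K f` (the sequences built here have `m + n` even: `W` is even), the frame
`IsGreenbergLFunctionAnyRoot₂ ι v v̄ κ₁ κ₂ γ₁⁻¹ γ₂⁻¹ f D · LK` has a `LineSupply`. See the section docstring.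
[cite: deShalit1987, II.4.16 (49)–(50), II.4.17 (52)–(54), II.6.4 proof (p. 85)] [cite: Katz1978, (5.3.0)] [cite: Weil1956, §1] -/
theorem lineSupply_of_cm (hK : IsImaginaryQuadratic K) (hp2 : p ≠ 2)
    {ι : PadicAlgCl p ≃+* ℂ} {v vbar : HeightOneSpectrum (𝓞 K)}
    (hv : ((p : ℕ) : 𝓞 K) ∈ v.asIdeal) (hvbar : ((p : ℕ) : 𝓞 K) ∈ vbar.asIdeal) (hne : vbar ≠ v)
    (hι : ∀ (w : InfinitePlace K) (d : 𝓞 K), d ∈ v.asIdeal ↔ ‖ι.symm (w.embedding (d : K))‖ < 1)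
    {κ₁ κ₂ : ZpExtension K p} {γ₁ γ₂ : absoluteGaloisGroup K}
    (hpair : ZpExtension.IsTopGeneratorPair κ₁ κ₂ γ₁ γ₂)
    (f : CuspForm (CongruenceSubgroup.Gamma0 N) 2) {D : ℕ} [NeZero D]
    (LK : PowerSeries (PowerSeries (PadicComplexInt p)))
    (h₁ : CMNewformLevelSupply K D) (h₂ : RankinSelbergContinuationSupplyEven K f) :
    LineSupply ι κ₁ κ₂ γ₁⁻¹ γ₂⁻¹ f D LK := by
  haveI : Algebra.IsQuadraticExtension ℚ K := ⟨hK.1⟩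
  haveI : IsGalois ℚ K := inferInstance
  haveI : IsCMField K := hK.isCMField
  haveI : IsTotallyComplex K := hK.2
  have himag : ∀ w : InfinitePlace K, w.IsComplex := fun w ↦ hK.2.isComplex w
  have hp : p.Prime := Fact.out
  set e := (FramedRep.unitsContinuousMulEquivOfUnique (Fin 1) (PadicAlgCl p) :
    (PadicAlgCl p)ˣ →ₜ* GL (Fin 1) (PadicAlgCl p)) with he
  -- Step 0: the seed `ψ` of type `(1, 0)` (any class number)
  obtain ⟨ψ, hψ⟩ := exists_hasInfinityType_one_zero hK
  -- Step 1: `Ψ₁ = ψ^{-N}`, type `(-N, 0)`, unramified everywhere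
  obtain ⟨N, hN, hψN⟩ := exists_pow_forall_isUnramifiedAt ψ
  set Ψ₁ : HeckeCharacter K := (ψ ^ N)⁻¹ with hΨ₁
  have hΨ₁t : Ψ₁.HasInfinityType (fun _ ↦ -(N : ℤ)) (fun _ ↦ 0) := by
    have h := (HasInfinityType.pow_nat hψ N).inv
    convert h using 2 <;> simp
  have hΨ₁a : Ψ₁.IsAlgebraic :=
    (HeckeCharacter.isAlgebraic_iff_exists_hasInfinityType _).mpr ⟨_, _, hΨ₁t⟩
  have hΨ₁u : ∀ w : HeightOneSpectrum (𝓞 K), Ψ₁.IsUnramifiedAt w := fun w ↦ (hψN w).inv'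
  have hΨ₁pow_t : ∀ n : ℕ, (Ψ₁ ^ n).HasInfinityType (fun _ ↦ -((N * n : ℕ) : ℤ)) (fun _ ↦ 0) := by
    intro n
    have h := HasInfinityType.pow_nat hΨ₁t n
    convert h using 2 <;> push_cast <;> ring
  have hΨ₁pow_u : ∀ (n : ℕ) (w : HeightOneSpectrum (𝓞 K)), (Ψ₁ ^ n).IsUnramifiedAt w :=
    fun n w ↦ isUnramifiedAt_pow' (hΨ₁u w) n
  -- Step 2: avatars of the powers of `Ψ₁` through the pair, tamed
  obtain ⟨M, χ₀, hM, hall⟩ :=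
    Theorems.CycTangentCMCycTangentBoundPairSupply.exists_isPAdicAvatarOf_pow_factorsThroughPair
      ι hK.1 himag hΨ₁a (fun w _ ↦ hΨ₁u w) hpair
  obtain ⟨N₀, hN₀, hsmall₀⟩ := exists_pow_norm_sub_one_lt χ₀
  -- v1.4: the taming exponent is DOUBLED (`χ₁ = χ₀^{2N₀}`, `W = 2MN₀`), so that `W` is even and the exponents
  -- `m + 1 = NWa_sp^k`, `n + 1 = NWp^k` of Step 8 have `m + n` even (the parity GAP 2♭ = Jacquet's fact delivers)
  set χ₁ : absoluteGaloisGroup K →ₜ* (PadicAlgCl p)ˣ := χ₀ ^ (2 * N₀) with hχ₁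
  set W : ℕ := M * (2 * N₀) with hW
  have hWpos : 0 < W := Nat.mul_pos hM (by omega)
  have hWeven : Even W := ⟨M * N₀, by rw [hW]; ring⟩
  have havatar : ∀ n : ℕ, IsPAdicAvatarOf ι (Ψ₁ ^ (W * n)) (e.comp (χ₁ ^ n)) := by
    intro n
    have h := (hall (2 * N₀ * n)).1
    rw [hχ₁, ← pow_mul, hW, mul_assoc]
    exact h
  have hsmall : ∀ (n : ℕ) (σ : absoluteGaloisGroup K),
      ‖avatarValueAt (e.comp (χ₁ ^ n)) σ - 1‖ < ‖(p : ℂ_[p])‖ := by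
    intro n σ
    rw [hχ₁, ← pow_mul, show 2 * N₀ * n = N₀ * (2 * n) by ring, pow_mul, he, avatarValueAt_unitsChar_pow]
    exact (UnrUnits.norm_pow_sub_one_le (norm_avatarValueAt_eq_one _ σ).le (2 * n)).trans_lt (hsmall₀ σ)
  have hpair_n : ∀ n : ℕ, FactorsThroughPair κ₁ κ₂ (e.comp (χ₁ ^ n)) := by
    intro n
    rw [hχ₁, ← pow_mul]
    exact (hall (2 * N₀ * n)).2
  -- Step 3: the split-prime line `κ` carrying `χ₁`
  obtain ⟨κ, hκpair, hκinert, hsat⟩ :=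
    Theorems.exists_splitPrimeLine_factorsThroughZp hK hp2 ι hv hvbar hne hι hpair
  have hχ₁κ' : FactorsThroughZp κ (e.comp χ₁) := by
    have h := hsat (Ψ₁ ^ (W * 1)) (-((N * (W * 1) : ℕ) : ℤ)) ∅ (e.comp (χ₁ ^ 1)) (hΨ₁pow_t _)
      (fun w _ ↦ hΨ₁pow_u _ w) (hΨ₁pow_u _ vbar) (havatar 1) (hpair_n 1) (hsmall 1)
    rwa [pow_one] at h
  have hχ₁κ : ∀ σ, κ σ = 1 → χ₁ σ = 1 := (factorsThroughZp_unitsChar_iff κ χ₁).mp hχ₁κ'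
  set γ : absoluteGaloisGroup K := κ.lift 1 with hγdef
  have hγ : κ.IsTopGenerator γ := κ.apply_lift 1
  -- Step 4: complex conjugation, its outer action `θc`
  obtain ⟨c, hc, hc2⟩ := exists_not_mem_range_absGaloisRestrict (K := ℚ) (L := K) (Rat.castHom ℝ) himag
  set θc := absGaloisOuterConj ℚ K c with hθc
  have hθθ : ∀ σ, θc (θc σ) = σ := fun σ ↦ by
    rw [hθc, ← absGaloisOuterConj_mul_apply, hc2, absGaloisOuterConj_one_apply]
  have hθres : ∀ σ, absGaloisRestrict ℚ K (θc σ) = c * absGaloisRestrict ℚ K σ * c⁻¹ :=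
    fun σ ↦ absGaloisRestrict_absGaloisOuterConj ℚ K c σ
  -- Step 5: non-degeneracy of the directions of `κ`, `κ ∘ θc`
  have hNW : (-((N * (W * 1) : ℕ) : ℤ)) ≠ 0 := by
    have : 0 < N * (W * 1) := Nat.mul_pos hN (by omega)
    omega
  have havatar1 : IsPAdicAvatarOf ι (Ψ₁ ^ (W * 1)) (e.comp χ₁) := by
    have h := havatar 1; rwa [pow_one] at h
  have hdet := toAdd_mul_ne_of_isPAdicAvatarOf ι hK hv hvbar hne hι hpair hκinert hNW (hΨ₁pow_t _)
    (hΨ₁pow_u _) havatar1 hχ₁κ hc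
  set d₁ := Multiplicative.toAdd (κ γ₁) with hd₁
  set d₂ := Multiplicative.toAdd (κ γ₂) with hd₂
  set d₁' := Multiplicative.toAdd (κ (θc γ₁)) with hd₁'
  set d₂' := Multiplicative.toAdd (κ (θc γ₂)) with hd₂'
  -- Step 6: the lines `κ_s = p(s+1)·κ − κ∘θc` through the pair
  have hlines := fun s : ℕ ↦ exists_line_of_direction (p := p) hK hpair hκpair hγ θc hθθ (s + 1)
  choose κL γL hκLpair hγL hκLval hκLchar using hlines
  have hval2 : ∀ s, Multiplicative.toAdd (κL s γ₂) = ((p * (s + 1) : ℕ) : ℤ_[p]) * d₂ - d₂' :=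
    fun s ↦ hκLval s γ₂
  have hval1 : ∀ s, Multiplicative.toAdd (κL s γ₁) = ((p * (s + 1) : ℕ) : ℤ_[p]) * d₁ - d₁' :=
    fun s ↦ hκLval s γ₁
  -- at most one line has `κ_s(γ₂) = 0`: shift past it
  have huniq : ∀ s t, Multiplicative.toAdd (κL s γ₂) = 0 → Multiplicative.toAdd (κL t γ₂) = 0 → s = t := by
    intro s t hs ht
    rw [hval2] at hs ht
    by_contra hst
    have hd2 : d₂ = 0 := by
      have h1 : (((p * (s + 1) : ℕ) : ℤ_[p]) - ((p * (t + 1) : ℕ) : ℤ_[p])) * d₂ = 0 := by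
        linear_combination hs - ht
      rcases mul_eq_zero.mp h1 with h | h
      · exfalso
        have : ((p * (s + 1) : ℕ) : ℤ_[p]) = ((p * (t + 1) : ℕ) : ℤ_[p]) := sub_eq_zero.mp h
        have h2 : p * (s + 1) = p * (t + 1) := by exact_mod_cast this
        have := Nat.eq_of_mul_eq_mul_left hp.pos h2
        omega
      · exact h
    have hd2' : d₂' = 0 := by rw [hd2, mul_zero, zero_sub, neg_eq_zero] at hs; exact hs
    apply hdet
    rw [hd2, hd2', mul_zero, zero_mul]
  obtain ⟨shift, hshift⟩ : ∃ shift : ℕ, ∀ s, Multiplicative.toAdd (κL (s + shift) γ₂) ≠ 0 := by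
    by_cases hbad : ∃ s₀, Multiplicative.toAdd (κL s₀ γ₂) = 0
    · obtain ⟨s₀, hs₀⟩ := hbad
      refine ⟨s₀ + 1, fun s hs ↦ ?_⟩
      have := huniq _ _ hs hs₀
      omega
    · push Not at hbad
      exact ⟨0, fun s ↦ hbad _⟩
  -- the final family of lines
  set κF : ℕ → ZpExtension K p := fun s ↦ κL (s + shift) with hκF
  set γF : ℕ → absoluteGaloisGroup K := fun s ↦ γL (s + shift) with hγF
  set aF : ℕ → ℕ := fun s ↦ p * (s + shift + 1) with haF
  have haFpos : ∀ s, 0 < aF s := fun s ↦ Nat.mul_pos hp.pos (Nat.succ_pos _)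
  have hprop : ∀ s t, s ≠ t → Multiplicative.toAdd (κF s γ₁) * Multiplicative.toAdd (κF t γ₂) ≠
      Multiplicative.toAdd (κF t γ₁) * Multiplicative.toAdd (κF s γ₂) := by
    intro s t hst heq
    simp only [hκF, hval1, hval2] at heq
    have key : (((p * (s + shift + 1) : ℕ) : ℤ_[p]) - ((p * (t + shift + 1) : ℕ) : ℤ_[p])) *
        (d₁' * d₂ - d₁ * d₂') = 0 := by
      linear_combination heq
    rcases mul_eq_zero.mp key with h | h
    · have : ((p * (s + shift + 1) : ℕ) : ℤ_[p]) = ((p * (t + shift + 1) : ℕ) : ℤ_[p]) := sub_eq_zero.mp h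
      have h2 : p * (s + shift + 1) = p * (t + shift + 1) := by exact_mod_cast this
      have := Nat.eq_of_mul_eq_mul_left hp.pos h2
      omega
    · exact hdet (by linear_combination -h)
  -- directions read at the Greenberg frame's base `(γ₁⁻¹, γ₂⁻¹)`: negated, so the two conditions transfer
  have hb : ∀ s, Multiplicative.toAdd (κF s γ₂⁻¹) ≠ 0 := fun s h0 ↦
    hshift s (by rwa [toAdd_apply_inv, neg_eq_zero] at h0)
  have hprop' : ∀ s t, s ≠ t → Multiplicative.toAdd (κF s γ₁⁻¹) * Multiplicative.toAdd (κF t γ₂⁻¹) ≠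
      Multiplicative.toAdd (κF t γ₁⁻¹) * Multiplicative.toAdd (κF s γ₂⁻¹) := by
    intro s t hst h
    simp only [toAdd_apply_inv, neg_mul_neg] at h
    exact hprop s t hst h
  -- Step 7: the characters `φ_s = χ₁^{a_s} (χ₁∘θc)⁻¹` through `κF s`
  set φ : ℕ → (absoluteGaloisGroup K →ₜ* (PadicAlgCl p)ˣ) :=
    fun s ↦ χ₁ ^ (aF s) * (χ₁.comp θc)⁻¹ with hφdef
  have hφκ : ∀ s, FactorsThroughZp (κF s) (e.comp (φ s)) := fun s ↦
    (factorsThroughZp_unitsChar_iff (κF s) (φ s)).mpr (hκLchar (s + shift) χ₁ hχ₁κ)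
  have hφpow : ∀ s n, (φ s) ^ n = χ₁ ^ (aF s * n) * ((χ₁ ^ n).comp θc)⁻¹ := by
    intro s n
    refine ContinuousMonoidHom.ext fun σ ↦ ?_
    simp only [hφdef, ContinuousMonoidHom.pow_apply, ContinuousMonoidHom.mul_apply, unitsChar_inv_apply,
      ContinuousMonoidHom.coe_comp, Function.comp_apply, mul_pow, inv_pow, pow_mul]
  -- small values of `φ_s`
  have hφsmall : ∀ s σ, ‖avatarValueAt (e.comp (φ s)) σ - 1‖ < ‖(p : ℂ_[p])‖ := by
    intro s σ
    have h1 := hsmall (aF s) σ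
    have h2 := hsmall 1 (θc σ)
    rw [pow_one] at h2
    rw [hφdef, he, avatarValueAt_unitsChar_mul, ← he]
    have e3 : avatarValueAt (e.comp (χ₁.comp θc)⁻¹) σ = (avatarValueAt (e.comp χ₁) (θc σ))⁻¹ := by
      rw [he, avatarValueAt_unitsChar, avatarValueAt_unitsChar, unitsChar_inv_apply,
        ContinuousMonoidHom.coe_comp, Function.comp_apply, Units.val_inv_eq_inv_val, PadicComplex.coe_eq,
        PadicComplex.coe_eq, map_inv₀]
    rw [e3]
    exact norm_mul_inv_sub_one_lt (norm_avatarValueAt_eq_one _ _) h1 h2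
  -- `φ_s(γ_s)` is a principal unit, not `1` (the avatar of `Ψ₁^W`, type `(-N·W, 0) ≠ 0`, is ramified at `v`)
  have hφne : ∀ s, avatarValueAt (e.comp (φ s)) (γF s) ≠ 1 := by
    intro s h1
    -- then `φ_s ≡ 1`
    have hall1 : ∀ σ, avatarValueAt (e.comp (φ s)) σ = 1 := fun σ ↦ by
      rw [ZpExtension.avatarValueAt_eq_onePlusPow (hφκ s) (hγL (s + shift)) σ, h1, sub_self]
      have h := IntSeries.norm_onePlusPow_sub_one_le (Multiplicative.toAdd (κF s σ)) (x := (0 : ℂ_[p]))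
        (by rw [norm_zero]; exact one_pos)
      rw [norm_zero] at h
      exact sub_eq_zero.mp (norm_le_zero_iff.mp h)
    -- hence `χ₁` kills `θc(I_𝔓)` for `𝔓 ∣ v̄`: `e∘χ₁` unramified at `v`
    have hχθ : ∀ 𝔓 ∈ vbar.primesAbove, ∀ τ ∈ 𝔓.inertia (absoluteGaloisGroup K), χ₁ (θc τ) = 1 := by
      intro 𝔓 h𝔓 τ hτ
      have hκτ : κ τ = 1 := ZpExtension.mem_kerSubgroup.mp (hκinert 𝔓 h𝔓 hτ)
      have hχτ : χ₁ τ = 1 := hχ₁κ τ hκτ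
      have h := hall1 τ
      rw [he, avatarValueAt_unitsChar, hφdef, ContinuousMonoidHom.mul_apply, ContinuousMonoidHom.pow_apply,
        hχτ, one_pow, one_mul, unitsChar_inv_apply, ContinuousMonoidHom.coe_comp, Function.comp_apply,
        ← UniformSpace.Completion.coe_one, UniformSpace.Completion.coe_inj] at h
      exact inv_eq_one.mp (Units.ext h)
    have hunrθ : (FramedGaloisRep.outerConj c (e.comp χ₁)).IsUnramifiedAt vbar := by
      intro 𝔓 h𝔓 τ hτ
      rw [FramedGaloisRep.outerConj_apply, ← hθc, ContinuousMonoidHom.coe_comp, Function.comp_apply,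
        hχθ 𝔓 h𝔓 τ hτ, map_one]
    have hcbar : absGaloisQuot ℚ K c ≠ 1 := fun h1 ↦ by
      obtain ⟨x, hx⟩ := (absGaloisQuot_eq_one_iff ℚ K c).1 h1
      exact hc ⟨x, hx⟩
    have hunrv : FramedGaloisRep.IsUnramifiedAt v (e.comp χ₁) := by
      have h := (FramedGaloisRep.isUnramifiedAt_outerConj_iff c (e.comp χ₁) vbar).mp hunrθ
      rwa [Theorems.CycTangentCMCycTangentBoundAvatarRamified.smul_eq_of_ne_one hK.1 hv hvbar hne hcbar] at h
    exact Theorems.CycTangentCMCycTangentBoundAvatarRamified.not_isUnramifiedAt_avatar_of_hasInfinityType_ne_zero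
      ι hK hv hvbar hne hι hNW (hΨ₁pow_t _) (T := ∅) (fun w _ ↦ hΨ₁pow_u _ w) (hΨ₁pow_u _ v) havatar1 hunrv
  -- Step 8: the supply data for the Greenberg frame (no `ψ⁻¹` twist; everywhere unramified; exponents `m+1`, `n+1 ≥ 1`)
  set ρ : ℕ → ℕ → HeckeCharacter K := fun s k ↦
    Ψ₁ ^ (W * (aF s * p ^ k)) * (HeckeCharacter.galConj (IsCMField.complexConj K) (Ψ₁ ^ (W * p ^ k)))⁻¹
    with hρdef
  set r : ℕ → ℕ → FramedGaloisRep K (PadicAlgCl p) 1 := fun s k ↦ e.comp ((φ s) ^ (p ^ k)) with hrdef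
  set m : ℕ → ℕ → ℕ := fun s k ↦ N * (W * (aF s * p ^ k)) - 1 with hmdef
  set n : ℕ → ℕ → ℕ := fun s k ↦ N * (W * p ^ k) - 1 with hndef
  have hm1 : ∀ s k, m s k + 1 = N * (W * (aF s * p ^ k)) := fun s k ↦
    Nat.sub_add_cancel (Nat.mul_pos hN (Nat.mul_pos hWpos (Nat.mul_pos (haFpos s) (pow_pos hp.pos k))))
  have hn1 : ∀ s k, n s k + 1 = N * (W * p ^ k) := fun s k ↦
    Nat.sub_add_cancel (Nat.mul_pos hN (Nat.mul_pos hWpos (pow_pos hp.pos k)))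
  have hr : ∀ s k, IsPAdicAvatarOf ι (ρ s k) (r s k) := by
    intro s k
    have h1 : IsPAdicAvatarOf ι (Ψ₁ ^ (W * (aF s * p ^ k))) (e.comp (χ₁ ^ (aF s * p ^ k))) := havatar _
    have h2 : IsPAdicAvatarOf ι (HeckeCharacter.galConj (IsCMField.complexConj K) (Ψ₁ ^ (W * p ^ k)))
        (e.comp ((χ₁ ^ p ^ k).comp θc)) := by
      have h := isPAdicAvatarOf_galConj_complexConj_comp hK.1 ι (havatar (p ^ k)) hc hθres
      exact h
    have h3 := isPAdicAvatarOf_mul ι h1 (isPAdicAvatarOf_inv ι h2)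
      (hram_of_forall (fun w _ ↦ hΨ₁pow_u _ w) (fun w _ ↦ ?_))
    · rw [hrdef, hρdef]
      simp only
      rw [hφpow s (p ^ k)]
      exact h3
    · rw [← inv_inv (HeckeCharacter.galConj _ _)]
      refine HeckeCharacter.IsUnramifiedAt.inv' ?_
      rw [inv_inv, HeckeCharacter.isUnramifiedAt_galConj_iff]
      exact hΨ₁pow_u _ _
  have hκr : ∀ s k, FactorsThroughZp (κF s) (r s k) := fun s k ↦ factorsThroughZp_unitsChar_pow _ (hφκ s) _
  have hκ : ∀ s k, FactorsThroughPair κ₁ κ₂ (r s k) := fun s k ↦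
    factorsThroughPair_of_factorsThroughZp_of_pairKer_le (hκr s k) (hκLpair (s + shift))
  have hinf : ∀ s k, (ρ s k).HasInfinityType (fun _ ↦ -((m s k : ℤ) + 1)) (fun _ ↦ (n s k : ℤ) + 1) := by
    intro s k
    have h := (hΨ₁pow_t (W * (aF s * p ^ k))).mul' ((hΨ₁pow_t (W * p ^ k)).galConj_complexConj.inv)
    have e1 : ((m s k : ℤ) + 1) = ((N * (W * (aF s * p ^ k)) : ℕ) : ℤ) := by exact_mod_cast hm1 s k
    have e2 : ((n s k : ℤ) + 1) = ((N * (W * p ^ k) : ℕ) : ℤ) := by exact_mod_cast hn1 s k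
    rw [e1, e2]
    show (Ψ₁ ^ (W * (aF s * p ^ k)) *
        (HeckeCharacter.galConj (IsCMField.complexConj K) (Ψ₁ ^ (W * p ^ k)))⁻¹).HasInfinityType
      (fun _ ↦ -((N * (W * (aF s * p ^ k)) : ℕ) : ℤ)) (fun _ ↦ ((N * (W * p ^ k) : ℕ) : ℤ))
    convert h using 2 <;> simp only [Pi.add_apply, Pi.neg_apply] <;> push_cast <;> ring
  have hunr : ∀ s k (w : HeightOneSpectrum (𝓞 K)), (ρ s k).IsUnramifiedAt w := by
    intro s k w
    show (Ψ₁ ^ (W * (aF s * p ^ k)) *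
        (HeckeCharacter.galConj (IsCMField.complexConj K) (Ψ₁ ^ (W * p ^ k)))⁻¹).IsUnramifiedAt w
    refine (hΨ₁pow_u _ w).mul' ?_
    rw [← inv_inv (HeckeCharacter.galConj _ _)]
    refine HeckeCharacter.IsUnramifiedAt.inv' ?_
    rw [inv_inv, HeckeCharacter.isUnramifiedAt_galConj_iff]
    exact hΨ₁pow_u _ _
  have hrval : ∀ s k, avatarValueAt (r s k) (γF s) = avatarValueAt (e.comp (φ s)) (γF s) ^ p ^ k :=
    fun s k ↦ by rw [hrdef, he, avatarValueAt_unitsChar_pow]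
  have hlim : ∀ s, Tendsto (fun k ↦ avatarValueAt (r s k) (γF s)) atTop (𝓝 1) := by
    intro s
    have h := tendsto_pow_prime_pow_padicComplex
      (ZpExtension.norm_avatarValueAt_sub_one_lt (hφκ s) (hγL (s + shift)))
    exact h.congr fun k ↦ (hrval s k).symm
  have hne' : ∀ s, ∃ᶠ k in atTop, avatarValueAt (r s k) (γF s) ≠ 1 := by
    intro s
    refine (Filter.Eventually.of_forall fun k hk ↦ ?_).frequently
    rw [hrval] at hk
    exact hφne s (Theorems.avatarValueAt_torsionFree_of_norm_sub_one_lt (hφsmall s) (γF s) k hk)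
  -- the RS-specific data: root `α` (§3·S), CM newforms (GAP 1), continuations (GAP 2), Katz values (§3·S)
  obtain ⟨α, hα⟩ := exists_heckeRoot (p := p) f
  have hθex : ∀ s k, ∃ θ : CuspForm (CongruenceSubgroup.Gamma1 D) ((m s k + n s k + 3 : ℕ) : ℤ),
      IsCMNewformOf (ρ s k / HeckeCharacter.normCharacter K ^ (m s k + 1)) θ :=
    fun s k ↦ h₁ (ρ s k) (m s k) (n s k) (hunr s k) (hinf s k)
  choose θ hθ using hθex
  -- parity (v1.4): `m + n + 2 = NW(a_s p^k + p^k)` with `W` even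
  have heven : ∀ s k, Even (m s k + n s k) := by
    intro s k
    have h1 : Even (m s k + 1 + (n s k + 1)) := by
      rw [hm1 s k, hn1 s k]
      exact ((hWeven.mul_right (aF s * p ^ k)).mul_left N).add ((hWeven.mul_right (p ^ k)).mul_left N)
    rw [show m s k + 1 + (n s k + 1) = m s k + n s k + 2 by ring] at h1
    exact (Nat.even_add.mp h1).mpr even_two
  have hLex : ∀ s k, ∃ L : ℂ → ℂ, Differentiable ℂ L ∧
      ∀ z : ℂ, (m s k : ℝ) + n s k + 3 < z.re → L z = rankinSelbergEulerProductHecke f (ρ s k) z :=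
    fun s k ↦ h₂ (ρ s k) (m s k) (n s k) (heven s k) (hunr s k) (hinf s k)
  choose L hL hL' using hLex
  have hyex : ∀ s k, ∃ y : ℂ_[p], IntSeries.HasValueAt₂ LK 0 (avatarValueAt (r s k) γ₂⁻¹ ^ 2 - 1) y :=
    fun s k ↦ exists_hasValueAt₂_zero_left LK (norm_avatarValueAt_sq_sub_one_lt (hκ s k) γ₂⁻¹)
  choose y hy using hyex
  exact lineSupply_of_lineSeq κF γF (fun s ↦ hγL _) hb hprop' ρ r m n (fun _ _ ↦ α) θ L y hr hκ hκr hunr hinf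
    (fun _ _ ↦ hα) hθ hL hL' hy hlim hne'

/-- **Two series framed by the same CM-supplied Greenberg frame are EQUAL** (G3b♭′ through the line door, §3·V
`eq_of_isGreenbergLFunctionAnyRoot₂_of_lineSupply` + `lineSupply_of_cm`): for `K` imaginary quadratic, `p` odd split, a
generator pair, any `f ∈ S₂(Γ₀(N))`, `D`, class-number slot `h_K`, `LK`, granted GAP 1 and GAP 2.
[cite: deShalit1987, II.6.4 proof (p. 85)] [cite: Katz1978, (5.3.0)] -/
theorem eq_of_isGreenbergLFunctionAnyRoot₂_of_cm (hK : IsImaginaryQuadratic K) (hp2 : p ≠ 2)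
    {ι : PadicAlgCl p ≃+* ℂ} {v vbar : HeightOneSpectrum (𝓞 K)}
    (hv : ((p : ℕ) : 𝓞 K) ∈ v.asIdeal) (hvbar : ((p : ℕ) : 𝓞 K) ∈ vbar.asIdeal) (hne : vbar ≠ v)
    (hι : ∀ (w : InfinitePlace K) (d : 𝓞 K), d ∈ v.asIdeal ↔ ‖ι.symm (w.embedding (d : K))‖ < 1)
    {κ₁ κ₂ : ZpExtension K p} {γ₁ γ₂ : absoluteGaloisGroup K}
    (hpair : ZpExtension.IsTopGeneratorPair κ₁ κ₂ γ₁ γ₂)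
    {f : CuspForm (CongruenceSubgroup.Gamma0 N) 2} {D : ℕ} [NeZero D] {h_K : ℕ}
    {LK G G' : PowerSeries (PowerSeries (PadicComplexInt p))}
    (h₁ : CMNewformLevelSupply K D) (h₂ : RankinSelbergContinuationSupplyEven K f)
    (hG : IsGreenbergLFunctionAnyRoot₂ ι v vbar κ₁ κ₂ γ₁⁻¹ γ₂⁻¹ f D h_K LK G)
    (hG' : IsGreenbergLFunctionAnyRoot₂ ι v vbar κ₁ κ₂ γ₁⁻¹ γ₂⁻¹ f D h_K LK G') : G = G' :=
  eq_of_isGreenbergLFunctionAnyRoot₂_of_lineSupply hG hG' (lineSupply_of_cm hK hp2 hv hvbar hne hι hpair f LK h₁ h₂)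

/-- The same at the crux's LITERAL frame parameters `(γ₁⁻¹, γ₂⁻¹; D, h_K) = (γ₁⁻¹, γ₂⁻¹; |d_K|, h(K))` and its instance
binder `[Fact (IsTopGeneratorPair κ₁ κ₂ γ₁ γ₂)]`: the two `G`-slots of `TwoVariableEulerSystemDivisibility`'s frame
`IsGreenbergLFunctionAnyRoot₂ ι v v̄ κ₁ κ₂ γ₁⁻¹ γ₂⁻¹ f |d_K| h(K) LK ·` agree, granted GAP 1 at `D = |d_K|` and GAP 2 at `f`.
[cite: deShalit1987, II.6.4 proof (p. 85)] -/
theorem eq_of_isGreenbergLFunctionAnyRoot₂_of_cm_cruxFrame (hK : IsImaginaryQuadratic K) (hp5 : 5 ≤ p)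
    {ι : PadicAlgCl p ≃+* ℂ} {v vbar : HeightOneSpectrum (𝓞 K)}
    (hv : ((p : ℕ) : 𝓞 K) ∈ v.asIdeal) (hvbar : ((p : ℕ) : 𝓞 K) ∈ vbar.asIdeal) (hne : vbar ≠ v)
    (hι : ∀ (w : InfinitePlace K) (d : 𝓞 K), d ∈ v.asIdeal ↔ ‖ι.symm (w.embedding (d : K))‖ < 1)
    {κ₁ κ₂ : ZpExtension K p} {γ₁ γ₂ : absoluteGaloisGroup K}
    [Fact (ZpExtension.IsTopGeneratorPair κ₁ κ₂ γ₁ γ₂)] [NeZero (NumberField.discr K).natAbs]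
    {f : CuspForm (CongruenceSubgroup.Gamma0 N) 2}
    {LK G G' : PowerSeries (PowerSeries (PadicComplexInt p))}
    (h₁ : CMNewformLevelSupply K (NumberField.discr K).natAbs) (h₂ : RankinSelbergContinuationSupplyEven K f)
    (hG : IsGreenbergLFunctionAnyRoot₂ ι v vbar κ₁ κ₂ γ₁⁻¹ γ₂⁻¹ f (NumberField.discr K).natAbs
      (NumberField.classNumber K) LK G)
    (hG' : IsGreenbergLFunctionAnyRoot₂ ι v vbar κ₁ κ₂ γ₁⁻¹ γ₂⁻¹ f (NumberField.discr K).natAbs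
      (NumberField.classNumber K) LK G') : G = G' :=
  eq_of_isGreenbergLFunctionAnyRoot₂_of_cm hK (by omega) hv hvbar hne hι Fact.out h₁ h₂ hG hG'

end CMLineSeq

/-! ### §5·F (g40, v1.3.1) GAP 1♭ — GAP 1 reduced to its printed form: Hecke–Shimura–Ribet with the SHARP level for
characters of conductor one

`CMNewformOfHeckeCharacter.lean` (the home of the tree's named fact `Ribet1977_cmNewform_of_heckeCharacter`) carries the
line «TODO(general form): the level is exactly `|d_K| · N(𝔣_ψ)` …»: the tree's fact gives the CM newform at SOME level `∃ N`.
GAP 1 (`CMNewformLevelSupply K |d_K|`) needs the level for characters UNRAMIFIED EVERYWHERE only (`𝔣_ψ = (1)`, level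
`|d_K| · N(1) = |d_K|`), which requires no conductor-ideal API. Below, `Ribet1977UnramifiedSharpLevel : Prop` is the tree's
fact VERBATIM with two changes — the hypothesis `∀ w, ψ.IsUnramifiedAt w` is added and the level is PINNED to
`(NumberField.discr K).natAbs` (Ribet 1977 §3: Thm. (3.4) «level `DM`, `M = N(𝔪)`», Cor. (3.5) «`a_p(f) = a_p` for all
`p ∤ DM`», Remark (3.5) «`g` is a newform if `𝔪` is the conductor of `ψ`», at `𝔪 = 𝔣_ψ = (1)`; Miyake Thm. 4.8.2; Shimura 1971
Lemma 3); the two ramification conjuncts of the tree's fact are dropped (they are theorems here: `ℓ ∤ d_K ⇒ e_ℓ = 1`,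
`ModularForms.ramificationIdxIn_eq_one_of_not_dvd_discr`, and `ψ` is unramified by hypothesis), which only WEAKENS the
statement. It is a faithfully printed theorem, typed as a `Prop` INPUT (never asserted): its typing into `Literature/` with a
cite tag is a pure move (director typing ask want #8). `cmNewformLevelSupply_discr` then DISCHARGES GAP 1 at `D = |d_K|` from
it in the kernel (`ξ / ‖·‖^{m+1}` has type `(0, m+n+2)` and is unramified everywhere), and
`eq_of_isGreenbergLFunctionAnyRoot₂_of_cm_ribet` is the crux-frame uniqueness with GAP 1 replaced by the printed fact. -/

section GapOneFlat

open Field Literature Literature.NumberTheory.EllipticCurves.ModularForms Polynomial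

variable [Fact p.Prime] {N : ℕ}

/-- **Hecke–Shimura–Ribet, sharp level for conductor-one characters (printed theorem, typed as an INPUT).** For `K`
imaginary quadratic, `k ≥ 2` and a Hecke character `ψ` of `K` UNRAMIFIED AT EVERY FINITE PLACE, of infinity type
`(k − 1, 0)` or `(0, k − 1)`: there is a newform `f ∈ S_k(Γ₁(|d_K|))` (`IsNewform1`) whose Hecke polynomial at every rational
prime `ℓ ∤ d_K` is `∏_{w ∣ ℓ}(X^{f_w} − ψ(ϖ_w))` (`inducedFrobPolynomial`) — the theta series `g = ∑ ψ(𝔞) q^{N𝔞}` of level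
`D·N(𝔪)` with `𝔪 = 𝔣_ψ = (1)`. The tree's `Ribet1977_cmNewform_of_heckeCharacter` verbatim but for the added unramifiedness
hypothesis, the level pinned to `|d_K|`, and the two (here automatic) ramification conjuncts dropped.
[cite: Ribet1977Nebentypus, §3 Thm. (3.4), Cor. (3.5), Remark (3.5) (LNM 601, pp. 34–35)] [cite: MiyakeModularForms1989, Thm. 4.8.2]
[cite: Shimura1971, Lemma 3] -/
def Ribet1977UnramifiedSharpLevel : Prop :=
  ∀ (K : Type) [Field K] [NumberField K] [NeZero (NumberField.discr K).natAbs],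
    Module.finrank ℚ K = 2 → ¬ IsTotallyReal K →
    ∀ (k : ℕ), 2 ≤ k → ∀ (ψ : HeckeCharacter K),
    (∀ w : HeightOneSpectrum (𝓞 K), ψ.IsUnramifiedAt w) →
    (ψ.HasInfinityType (fun _ ↦ (k : ℤ) - 1) (fun _ ↦ 0) ∨
      ψ.HasInfinityType (fun _ ↦ 0) (fun _ ↦ (k : ℤ) - 1)) →
    ∃ f : CuspForm (CongruenceSubgroup.Gamma1 (NumberField.discr K).natAbs) (k : ℤ), IsNewform1 f ∧
      ∀ v : HeightOneSpectrum (𝓞 ℚ),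
        ¬ ((Rat.HeightOneSpectrum.primesEquiv v : Nat.Primes) : ℕ) ∣ (NumberField.discr K).natAbs →
        (heckePolynomial f (Rat.HeightOneSpectrum.primesEquiv v : Nat.Primes)).map
            (algebraMap (coeffCharField f) ℂ) =
          inducedFrobPolynomial v (fun w ↦ X - C (ψ.valueAtUniformizer w))

/-- **GAP 1 at `D = |d_K|` DISCHARGED from the printed fact** (kernel): for `ξ` everywhere unramified of type `(−(m+1), n+1)`
the character `ξ / ‖·‖^{m+1}` is everywhere unramified (`isUnramifiedAt_normCharacter'`) of type `(0, m+n+2) = (0, k−1)`,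
`k = m+n+3 ≥ 3` (`hasInfinityType_normCharacter'`: `‖·‖` has type `(−1, −1)` on the totally complex `K`), so the fact hands
a newform `θ ∈ S_k(Γ₁(|d_K|))` with the induced Hecke polynomials off `|d_K|` — `IsCMNewformOf (ξ / ‖·‖^{m+1}) θ` verbatim.
[cite: Ribet1977Nebentypus, §3 Thm. (3.4), Cor. (3.5), Remark (3.5)] [cite: SerreAbelianLadic1968, Ch. II §2.3] -/
theorem cmNewformLevelSupply_discr (hK : IsImaginaryQuadratic K) [NeZero (NumberField.discr K).natAbs]
    (h : Ribet1977UnramifiedSharpLevel) : CMNewformLevelSupply K (NumberField.discr K).natAbs := by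
  classical
  intro ξ m n hunr hinf
  haveI : IsCMField K := hK.isCMField
  haveI : IsTotallyComplex K := hK.2
  have hw : ∀ w : InfinitePlace K, ¬ w.IsReal := fun w ↦
    InfinitePlace.not_isReal_iff_isComplex.mpr (IsTotallyComplex.isComplex w)
  have hKr : ¬ IsTotallyReal K := fun hr ↦ by
    obtain ⟨w⟩ := (inferInstance : Nonempty (InfinitePlace K))
    exact hw w (hr.isReal w)
  have hNu : ∀ w : HeightOneSpectrum (𝓞 K), (HeckeCharacter.normCharacter K ^ (m + 1)).IsUnramifiedAt w :=
    fun w ↦ by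
      simpa only [zpow_natCast] using
        (HeckeCharacter.isUnramifiedAt_normCharacter' (K := K) w).zpow' ((m + 1 : ℕ) : ℤ)
  have hψu : ∀ w : HeightOneSpectrum (𝓞 K),
      (ξ / HeckeCharacter.normCharacter K ^ (m + 1)).IsUnramifiedAt w := fun w ↦ by
    rw [div_eq_mul_inv]
    exact (hunr w).mul' (hNu w).inv'
  have hNt := ((HeckeCharacter.hasInfinityType_normCharacter' (K := K)).zpow' ((m + 1 : ℕ) : ℤ)).inv
  have hψt' := hinf.mul' hNt
  have hψt : (ξ / HeckeCharacter.normCharacter K ^ (m + 1)).HasInfinityType (fun _ ↦ 0)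
      (fun _ ↦ (((m + n + 3 : ℕ) : ℕ) : ℤ) - 1) := by
    rw [div_eq_mul_inv, ← zpow_natCast]
    convert hψt' using 2 with w w
    · simp only [Pi.add_apply, Pi.neg_apply, Pi.smul_apply, smul_eq_mul]
      push_cast
      ring
    · simp only [Pi.add_apply, Pi.neg_apply, Pi.smul_apply, smul_eq_mul, if_neg (hw w)]
      push_cast
      ring
  obtain ⟨θ, hθ, hmatch⟩ := h K hK.1 hKr (m + n + 3) (by omega) _ hψu (Or.inr hψt)
  exact ⟨θ, hθ, hmatch⟩

/-- **Crux-frame uniqueness with GAP 1 replaced by the printed fact**: at the crux's literal frame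
`IsGreenbergLFunctionAnyRoot₂ ι v v̄ κ₁ κ₂ γ₁⁻¹ γ₂⁻¹ f |d_K| h(K) LK ·`, granted Hecke–Shimura–Ribet with the sharp level for
conductor-one characters (`Ribet1977UnramifiedSharpLevel`) and GAP 2 at `f`, two framed series are equal.
[cite: Ribet1977Nebentypus, §3 Thm. (3.4), Cor. (3.5), Remark (3.5)] [cite: deShalit1987, II.6.4 proof (p. 85)] -/
theorem eq_of_isGreenbergLFunctionAnyRoot₂_of_cm_ribet (hK : IsImaginaryQuadratic K) (hp5 : 5 ≤ p)
    {ι : PadicAlgCl p ≃+* ℂ} {v vbar : HeightOneSpectrum (𝓞 K)}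
    (hv : ((p : ℕ) : 𝓞 K) ∈ v.asIdeal) (hvbar : ((p : ℕ) : 𝓞 K) ∈ vbar.asIdeal) (hne : vbar ≠ v)
    (hι : ∀ (w : InfinitePlace K) (d : 𝓞 K), d ∈ v.asIdeal ↔ ‖ι.symm (w.embedding (d : K))‖ < 1)
    {κ₁ κ₂ : ZpExtension K p} {γ₁ γ₂ : absoluteGaloisGroup K}
    [Fact (ZpExtension.IsTopGeneratorPair κ₁ κ₂ γ₁ γ₂)] [NeZero (NumberField.discr K).natAbs]
    {f : CuspForm (CongruenceSubgroup.Gamma0 N) 2}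
    {LK G G' : PowerSeries (PowerSeries (PadicComplexInt p))}
    (h₁ : Ribet1977UnramifiedSharpLevel) (h₂ : RankinSelbergContinuationSupplyEven K f)
    (hG : IsGreenbergLFunctionAnyRoot₂ ι v vbar κ₁ κ₂ γ₁⁻¹ γ₂⁻¹ f (NumberField.discr K).natAbs
      (NumberField.classNumber K) LK G)
    (hG' : IsGreenbergLFunctionAnyRoot₂ ι v vbar κ₁ κ₂ γ₁⁻¹ γ₂⁻¹ f (NumberField.discr K).natAbs
      (NumberField.classNumber K) LK G') : G = G' :=
  eq_of_isGreenbergLFunctionAnyRoot₂_of_cm_cruxFrame hK hp5 hv hvbar hne hι (cmNewformLevelSupply_discr hK h₁) h₂ hG hG'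

end GapOneFlat

/-! ### §5·G (g40, v1.4) GAP 2♭ — GAP 2 DISCHARGED in the kernel from the tree's named fact
`jacquet1972_exists_entire_rankinSelbergHecke` (Jacquet 1972, Cor. 19.15: `L(f/K, φ, s)` entire for a newform
`f ∈ S₂(Γ₀(N))` and an everywhere-unramified `φ` of unitary type `(n', −n')`, `n' ≥ 1`)

`Literature/NumberTheory/EllipticCurves/RankinSelbergHeckeContinuation.lean` states Jacquet's corollary in exactly the binder shape of
`IsRankinSelbergValueHecke` — for characters of the UNITARY type `(n', −n')` and the half-plane `re s > 3/2`. The CM line sequences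
need it for `ξ` of type `(−(m+1), n+1)` on `re s > m+n+3`. The passage is two identities of Euler products, both termwise and
unconditional (no convergence is used: `tprod_congr`-by-`simp` and `Equiv.tprod_eq`):

* NORM SHIFT `rankinSelbergEulerProductHecke_mul_normCharacter_zpow`: `L(f/K, φ·‖·‖^u, s) = L(f/K, φ, s + u)` — at every `v`,
  `(φ‖·‖^u)(ϖ_v) = φ(ϖ_v)·N(v)^{−u}` (`valueAtUniformizer_normCharacter'`; both sides extended by zero at the ramified `v` of `φ`,
  `‖·‖` being unramified everywhere), and `N(v)^{−u}N(v)^{−s} = N(v)^{−(s+u)}`;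
* GALOIS TRANSPORT `rankinSelbergEulerProductHecke_galConj`: `L(f/K, φ∘σ, s) = L(f/K, φ, s)` for any `σ ∈ Aut(K/F₀)` — at every
  `v`, `(φ∘σ)(ϖ_v) = φ(ϖ_{σv})` (`valueAtUniformizer_galConj_of_isUnramifiedAt`, `isUnramifiedAt_galConj_iff`) and `N(σv) = N(v)`
  (`HeightOneSpectrum.absNorm_algEquiv_smul`), the local data `(ℓ, k, a_ℓ(f), 𝟙_{ℓ∤N})` of the factor depending on `v` only
  through `N(v)`; then reindex the `tprod` along the permutation `v ↦ σv`.

Granted these, for `ξ` everywhere unramified of type `(−(m+1), n+1)` with `m + n = 2r` EVEN, the character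
`φ₀ := (ξ∘c)·‖·‖^{t}`, `t = n − r`, is everywhere unramified of type `(n+1−t, −(m+1)−t) = (r+1, −(r+1))` (`‖·‖` has type
`(−1, −1)` on the totally complex `K`; `HasInfinityType.galConj_complexConj`), Jacquet's fact hands an entire `L₀` with
`L₀(s) = L(f/K, φ₀, s)` on `re s > 3/2`, and `L(s) := L₀(s − t)` is entire with `L(s) = L(f/K, ξ∘c, s) = L(f/K, ξ, s)` on
`re s > 3/2 + t`, which contains `re s > m + n + 3` (`m + n + 3 − 3/2 − t = (3m + n + 3)/2 > 0`):
`rankinSelbergContinuationSupplyEven_of_jacquet`. The ODD parity is not reachable from a fact about integral unitary types (a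
half-integral norm shift would be needed) — which is why v1.4 makes the construction's `W` even and consumes only
`RankinSelbergContinuationSupplyEven`.

HEADLINE `eq_of_isGreenbergLFunctionAnyRoot₂_of_cm_jacquet_ribet`: at the crux's literal frame, for `f` a newform
(`IsNewform0 f`; for the crux's `IsNewformOf W f` use `.1`), granted the two PRINTED theorems typed as inputs —
`Ribet1977UnramifiedSharpLevel` (§5·F; to be moved into Literature) and the tree's Literature fact
`jacquet1972_exists_entire_rankinSelbergHecke` — two framed series are EQUAL. Residual G3b (`LineSupply`) is thereby CLOSED
in the kernel modulo named printed theorems only (one of them already a Literature fact, the other a verbatim specialisation of one).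
Nothing here bears on the summit: no summit statement is proved; BSD is not proved. -/

section GapTwoFlat

open Field Literature.NumberTheory.Automorphic Literature.NumberTheory.GaloisRepresentations.HeckeCharacter
open Literature.NumberTheory.EllipticCurves.ModularForms

variable {F₀ : Type} [Field F₀] [Algebra F₀ K] [Fact p.Prime] {N : ℕ}

/-- **Norm twist of the extended-by-zero value**: `(φ‖·‖^u)(ϖ_v) = φ(ϖ_v)·N(v)^{−u}`, both sides `0` at the ramified
places of `φ` (`‖·‖^u` is unramified everywhere). [cite: TateThesis1967, §4.3] [cite: Nekovar1995, §3.4] -/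
theorem heckeValueExtZero_mul_normCharacter_zpow (φ : HeckeCharacter K) (u : ℤ)
    (v : HeightOneSpectrum (𝓞 K)) :
    heckeValueExtZero (φ * normCharacter K ^ u) v
      = heckeValueExtZero φ v * ((((Ideal.absNorm v.asIdeal : ℕ) : ℂ))⁻¹) ^ u := by
  by_cases hφ : φ.IsUnramifiedAt v
  · have h1 : (φ * normCharacter K ^ u).IsUnramifiedAt v :=
      hφ.mul' ((isUnramifiedAt_normCharacter' v).zpow' u)
    rw [heckeValueExtZero_of_isUnramifiedAt h1, heckeValueExtZero_of_isUnramifiedAt hφ,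
      valueAtUniformizer_mul', valueAtUniformizer_zpow', valueAtUniformizer_normCharacter']
  · have h1 : ¬ (φ * normCharacter K ^ u).IsUnramifiedAt v := by
      intro h
      apply hφ
      have h' := h.mul' ((isUnramifiedAt_normCharacter' v).zpow' u).inv'
      rwa [mul_inv_cancel_right] at h'
    rw [heckeValueExtZero_of_not_isUnramifiedAt h1, heckeValueExtZero_of_not_isUnramifiedAt hφ,
      zero_mul]

/-- **Galois transport of the extended-by-zero value**: `(φ∘σ)(ϖ_v) = φ(ϖ_{σ v})`, and `φ∘σ` is ramified at `v` iff `φ` is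
at `σ v`. [folklore] [cite: Nekovar1995, §3.4] -/
theorem heckeValueExtZero_galConj (σ : K ≃ₐ[F₀] K) (φ : HeckeCharacter K)
    (v : HeightOneSpectrum (𝓞 K)) :
    heckeValueExtZero (galConj σ φ) v = heckeValueExtZero φ (σ • v) := by
  by_cases h : φ.IsUnramifiedAt (σ • v)
  · rw [heckeValueExtZero_of_isUnramifiedAt ((isUnramifiedAt_galConj_iff σ φ v).mpr h),
      heckeValueExtZero_of_isUnramifiedAt h, valueAtUniformizer_galConj_of_isUnramifiedAt σ φ v h]
  · rw [heckeValueExtZero_of_not_isUnramifiedAt (mt (isUnramifiedAt_galConj_iff σ φ v).mp h),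
      heckeValueExtZero_of_not_isUnramifiedAt h]

/-- **Norm shift of the inverse local factor**: `P_v(f, φ‖·‖^u; s) = P_v(f, φ; s + u)`
(`N(v)^{−u}·N(v)^{−s} = N(v)^{−(s+u)}`, `N(v) ≠ 0`). [cite: Nekovar1995, (0.5) p. 611 and §3.4] -/
theorem rankinSelbergLocalFactorInvHecke_mul_normCharacter_zpow (f : CuspForm (CongruenceSubgroup.Gamma0 N) 2)
    (φ : HeckeCharacter K) (u : ℤ) (v : HeightOneSpectrum (𝓞 K)) (s : ℂ) :
    rankinSelbergLocalFactorInvHecke f (φ * normCharacter K ^ u) v s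
      = rankinSelbergLocalFactorInvHecke f φ v (s + u) := by
  have hq : ((Ideal.absNorm v.asIdeal : ℕ) : ℂ) ≠ 0 := by
    have : Ideal.absNorm v.asIdeal ≠ 0 := by
      rw [Ne, Ideal.absNorm_eq_zero_iff]; exact v.ne_bot
    exact_mod_cast this
  set q : ℂ := ((Ideal.absNorm v.asIdeal : ℕ) : ℂ) with hqdef
  have e1 : q ^ (-(s + (u : ℂ))) = q ^ (-s) * (q⁻¹) ^ u := by
    rw [neg_add, Complex.cpow_add _ _ hq, inv_zpow', ← Complex.cpow_intCast, Int.cast_neg]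
  have e2 : q ^ (-2 * (s + (u : ℂ))) = q ^ (-2 * s) * ((q⁻¹) ^ u) ^ 2 := by
    rw [show -2 * (s + (u : ℂ)) = -2 * s + (-(u : ℂ) + -(u : ℂ)) by ring, Complex.cpow_add _ _ hq,
      Complex.cpow_add _ _ hq, inv_zpow', ← Complex.cpow_intCast, Int.cast_neg, sq]
  simp only [rankinSelbergLocalFactorInvHecke, heckeValueExtZero_mul_normCharacter_zpow]
  rw [← hqdef, e1, e2]
  ring

/-- **Galois transport of the inverse local factor**: `P_v(f, φ∘σ; s) = P_{σv}(f, φ; s)` — the local data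
`(N(v), ℓ, k, a_ℓ(f), 𝟙_{ℓ∤N})` depend on `v` only through `N(v) = N(σv)`. [cite: Nekovar1995, (0.5) p. 611 and §3.4] -/
theorem rankinSelbergLocalFactorInvHecke_galConj (f : CuspForm (CongruenceSubgroup.Gamma0 N) 2) (σ : K ≃ₐ[F₀] K)
    (φ : HeckeCharacter K) (v : HeightOneSpectrum (𝓞 K)) (s : ℂ) :
    rankinSelbergLocalFactorInvHecke f (galConj σ φ) v s
      = rankinSelbergLocalFactorInvHecke f φ (σ • v) s := by
  simp only [rankinSelbergLocalFactorInvHecke, heckeValueExtZero_galConj,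
    HeightOneSpectrum.absNorm_algEquiv_smul]

/-- **`L(f/K, φ‖·‖^u, s) = L(f/K, φ, s + u)`** as Euler products (termwise; no convergence used).
[cite: Nekovar1995, (0.5) p. 611] [cite: Jacquet1972, §19 (19.15.1)] -/
theorem rankinSelbergEulerProductHecke_mul_normCharacter_zpow (f : CuspForm (CongruenceSubgroup.Gamma0 N) 2)
    (φ : HeckeCharacter K) (u : ℤ) (s : ℂ) :
    rankinSelbergEulerProductHecke f (φ * normCharacter K ^ u) s
      = rankinSelbergEulerProductHecke f φ (s + u) := by
  simp only [rankinSelbergEulerProductHecke, rankinSelbergLocalFactorInvHecke_mul_normCharacter_zpow]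

/-- **`L(f/K, φ∘σ, s) = L(f/K, φ, s)`** as Euler products: reindex the `tprod` along the permutation `v ↦ σv` of the finite
places (`Equiv.tprod_eq`; no convergence used). [cite: Nekovar1995, (0.5) p. 611] [cite: Jacquet1972, §19 Cor. 19.15] -/
theorem rankinSelbergEulerProductHecke_galConj (f : CuspForm (CongruenceSubgroup.Gamma0 N) 2) (σ : K ≃ₐ[F₀] K)
    (φ : HeckeCharacter K) (s : ℂ) :
    rankinSelbergEulerProductHecke f (galConj σ φ) s = rankinSelbergEulerProductHecke f φ s := by
  simp only [rankinSelbergEulerProductHecke, rankinSelbergLocalFactorInvHecke_galConj]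
  exact Equiv.tprod_eq (MulAction.toPerm σ) (fun v ↦ (rankinSelbergLocalFactorInvHecke f φ v s)⁻¹)

/-- **GAP 2♭ — the even-parity Rankin–Selberg supply from Jacquet 1972, Cor. 19.15 (the tree's named fact).** For `K`
imaginary quadratic and `f ∈ S₂(Γ₀(N))` a newform (`IsNewform0 f`), granted `jacquet1972_exists_entire_rankinSelbergHecke`:
every everywhere-unramified `ξ` of type `(−(m+1), n+1)` with `m + n` even has `L(f/K, ξ, s)` entire on the frame's half-plane —
apply the fact to `φ₀ = (ξ∘c)‖·‖^{n−r}` (`2r = m+n`; unitary type `(r+1, −(r+1))`), shift back by `rankinSelbergEulerProductHecke_mul_normCharacter_zpow`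
and remove `c` by `rankinSelbergEulerProductHecke_galConj`. [cite: Jacquet1972, §19 Cor. 19.15 (with Thm. 19.14)] [cite: Li1979, Thm. 2.2] -/
theorem rankinSelbergContinuationSupplyEven_of_jacquet (hK : IsImaginaryQuadratic K) [NeZero N]
    {f : CuspForm (CongruenceSubgroup.Gamma0 N) 2} (hf : IsNewform0 f)
    (hJ : jacquet1972_exists_entire_rankinSelbergHecke) :
    RankinSelbergContinuationSupplyEven K f := by
  classical
  haveI : IsCMField K := hK.isCMField
  haveI : IsTotallyComplex K := hK.2
  have hw : ∀ w : InfinitePlace K, ¬ w.IsReal := fun w ↦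
    InfinitePlace.not_isReal_iff_isComplex.mpr (IsTotallyComplex.isComplex w)
  intro ξ m n hmn hξu hξt
  obtain ⟨r, hr⟩ := hmn
  -- `t = n - r = (n - m) / 2`, unitary weight `r + 1 = (m + n) / 2 + 1`
  set t : ℤ := (n : ℤ) - r with htdef
  have ht2 : 2 * t = (n : ℤ) - m := by omega
  set φ₀ : HeckeCharacter K := galConj (IsCMField.complexConj K) ξ * normCharacter K ^ t with hφ₀def
  have hφ₀u : ∀ w : HeightOneSpectrum (𝓞 K), φ₀.IsUnramifiedAt w := fun w ↦
    ((isUnramifiedAt_galConj_iff _ _ _).mpr (hξu _)).mul' ((isUnramifiedAt_normCharacter' w).zpow' t)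
  have hφ₀t : φ₀.HasInfinityType (fun _ ↦ ((r + 1 : ℕ) : ℤ)) (fun _ ↦ -((r + 1 : ℕ) : ℤ)) := by
    have h := hξt.galConj_complexConj.mul' ((hasInfinityType_normCharacter' (K := K)).zpow' t)
    convert h using 2 with w w
    · simp only [Pi.add_apply, Pi.smul_apply, smul_eq_mul]
      push_cast
      omega
    · simp only [Pi.add_apply, Pi.smul_apply, smul_eq_mul, if_neg (hw w)]
      push_cast
      omega
  obtain ⟨L₀, hL₀d, hL₀e⟩ := hJ K hK f hf φ₀ (r + 1) (Nat.succ_pos r) hφ₀u hφ₀t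
  refine ⟨fun s ↦ L₀ (s - t), hL₀d.comp (differentiable_id.sub_const _), fun s hs ↦ ?_⟩
  have hs' : (3 : ℝ) / 2 < (s - (t : ℂ)).re := by
    have ht' : (2 : ℝ) * t = (n : ℝ) - m := by exact_mod_cast ht2
    rw [Complex.sub_re, Complex.intCast_re]
    have hm0 : (0 : ℝ) ≤ m := Nat.cast_nonneg m
    linarith
  show L₀ (s - t) = rankinSelbergEulerProductHecke f ξ s
  rw [hL₀e _ hs', hφ₀def, rankinSelbergEulerProductHecke_mul_normCharacter_zpow, sub_add_cancel,
    rankinSelbergEulerProductHecke_galConj]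

/-- **Crux-frame uniqueness from the two PRINTED theorems (v1.4 headline).** At the crux's literal frame
`IsGreenbergLFunctionAnyRoot₂ ι v v̄ κ₁ κ₂ γ₁⁻¹ γ₂⁻¹ f |d_K| h(K) LK ·`, for `K` imaginary quadratic, `p ≥ 5` split, a generator pair,
and `f ∈ S₂(Γ₀(N))` a NEWFORM: granted Hecke–Shimura–Ribet with the sharp level for conductor-one characters
(`Ribet1977UnramifiedSharpLevel`, §5·F) and Jacquet 1972 Cor. 19.15 (the tree's `jacquet1972_exists_entire_rankinSelbergHecke`),
two framed series are EQUAL — GAP 1 and GAP 2 both discharged in the kernel from printed theorems typed as inputs.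
[cite: Jacquet1972, §19 Cor. 19.15] [cite: Ribet1977Nebentypus, §3 Thm. (3.4), Cor. (3.5), Remark (3.5)] [cite: deShalit1987, II.6.4 proof (p. 85)] -/
theorem eq_of_isGreenbergLFunctionAnyRoot₂_of_cm_jacquet_ribet (hK : IsImaginaryQuadratic K) (hp5 : 5 ≤ p)
    {ι : PadicAlgCl p ≃+* ℂ} {v vbar : HeightOneSpectrum (𝓞 K)}
    (hv : ((p : ℕ) : 𝓞 K) ∈ v.asIdeal) (hvbar : ((p : ℕ) : 𝓞 K) ∈ vbar.asIdeal) (hne : vbar ≠ v)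
    (hι : ∀ (w : InfinitePlace K) (d : 𝓞 K), d ∈ v.asIdeal ↔ ‖ι.symm (w.embedding (d : K))‖ < 1)
    {κ₁ κ₂ : ZpExtension K p} {γ₁ γ₂ : absoluteGaloisGroup K}
    [Fact (ZpExtension.IsTopGeneratorPair κ₁ κ₂ γ₁ γ₂)] [NeZero (NumberField.discr K).natAbs]
    [NeZero N] {f : CuspForm (CongruenceSubgroup.Gamma0 N) 2} (hf : IsNewform0 f)
    {LK G G' : PowerSeries (PowerSeries (PadicComplexInt p))}
    (h₁ : Ribet1977UnramifiedSharpLevel) (hJ : jacquet1972_exists_entire_rankinSelbergHecke)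
    (hG : IsGreenbergLFunctionAnyRoot₂ ι v vbar κ₁ κ₂ γ₁⁻¹ γ₂⁻¹ f (NumberField.discr K).natAbs
      (NumberField.classNumber K) LK G)
    (hG' : IsGreenbergLFunctionAnyRoot₂ ι v vbar κ₁ κ₂ γ₁⁻¹ γ₂⁻¹ f (NumberField.discr K).natAbs
      (NumberField.classNumber K) LK G') : G = G' :=
  eq_of_isGreenbergLFunctionAnyRoot₂_of_cm_ribet hK hp5 hv hvbar hne hι h₁
    (rankinSelbergContinuationSupplyEven_of_jacquet hK hf hJ) hG hG'

/-- **The same at the crux's newform binder `IsNewformOf W f`** (the newform of the curve `W`; `IsNewformOf.1 : IsNewform0 f`).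
[cite: Jacquet1972, §19 Cor. 19.15] [cite: Ribet1977Nebentypus, §3 Thm. (3.4), Cor. (3.5), Remark (3.5)] -/
theorem eq_of_isGreenbergLFunctionAnyRoot₂_of_cm_jacquet_ribet_of_isNewformOf (hK : IsImaginaryQuadratic K) (hp5 : 5 ≤ p)
    {ι : PadicAlgCl p ≃+* ℂ} {v vbar : HeightOneSpectrum (𝓞 K)}
    (hv : ((p : ℕ) : 𝓞 K) ∈ v.asIdeal) (hvbar : ((p : ℕ) : 𝓞 K) ∈ vbar.asIdeal) (hne : vbar ≠ v)
    (hι : ∀ (w : InfinitePlace K) (d : 𝓞 K), d ∈ v.asIdeal ↔ ‖ι.symm (w.embedding (d : K))‖ < 1)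
    {κ₁ κ₂ : ZpExtension K p} {γ₁ γ₂ : absoluteGaloisGroup K}
    [Fact (ZpExtension.IsTopGeneratorPair κ₁ κ₂ γ₁ γ₂)] [NeZero (NumberField.discr K).natAbs]
    [NeZero N] {W : WeierstrassCurve ℚ} {f : CuspForm (CongruenceSubgroup.Gamma0 N) 2} (hf : IsNewformOf W f)
    {LK G G' : PowerSeries (PowerSeries (PadicComplexInt p))}
    (h₁ : Ribet1977UnramifiedSharpLevel) (hJ : jacquet1972_exists_entire_rankinSelbergHecke)
    (hG : IsGreenbergLFunctionAnyRoot₂ ι v vbar κ₁ κ₂ γ₁⁻¹ γ₂⁻¹ f (NumberField.discr K).natAbs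
      (NumberField.classNumber K) LK G)
    (hG' : IsGreenbergLFunctionAnyRoot₂ ι v vbar κ₁ κ₂ γ₁⁻¹ γ₂⁻¹ f (NumberField.discr K).natAbs
      (NumberField.classNumber K) LK G') : G = G' :=
  eq_of_isGreenbergLFunctionAnyRoot₂_of_cm_jacquet_ribet hK hp5 hv hvbar hne hι hf.1 h₁ hJ hG hG'

end GapTwoFlat

/-! ## §5·H (v1.5, g40) PARITY (the odd case of GAP 2 is vacuous) and the DUAL CHARACTER `ξᴰ = (ξ∘σ)⁻¹`

(i) For `K` imaginary quadratic, an everywhere-unramified `ξ` of type `(−(m+1), n+1)` has `m + n` even: `ξ` is trivial on the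
principal idele of `−1 ∈ K^×`; its finite part is a unit idele, killed because the EMPTY set is a module of definition of an
everywhere-unramified character (`IsModulus.of_isUnramifiedAt`, Neukirch VII §6 after (6.11)); so `ξ((−1)_∞) = 1`
(`map_principalIdele_eq`, Neukirch VII (6.13)), while the infinity type evaluates `ξ((−1)_∞) = (−1)^{m+1}·(−1)^{−(n+1)} = (−1)^{m−n}`
(`HasInfinityType.apply_infiniteIdeles_eq`; every infinite idele of a totally complex field is totally positive). Consequences:
`RankinSelbergContinuationSupplyEven K f ↔ RankinSelbergContinuationSupply K f`, and the all-parity GAP 2 follows from Jacquet's fact.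
(ii) The dual character of the G3a table (§1): `ξᴰ := (galConj σ ξ)⁻¹`; when `σ • v = v̄` and `σ • v̄ = v` it satisfies §1's value
relations, so §1's invariance lemmas apply to it by name; its range data (`m ↔ n`, unramified) and its Euler product
(`= L(f/K, ξ⁻¹, s)`) are recorded. Nothing about the complex functional equation is asserted. -/

section ParityDual

open scoped Pointwise
open Field Literature Literature.NumberTheory.Automorphic Literature.NumberTheory.GaloisRepresentations.HeckeCharacter
open Literature.NumberTheory.EllipticCurves.ModularForms Literature.NumberTheory.QuadraticFields
open Summit.BirchSwinnertonDyer.Rank1Residual.X11b.Three.LambdaSupply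

variable {F₀ : Type} [Field F₀] [Algebra F₀ K] {N : ℕ}

/-- **Parity of the infinity type of an everywhere-unramified character of an imaginary quadratic field**: type
`(−(m+1), n+1)` forces `m + n` even (`ξ(−1) = 1`: `−1` is a unit at every finite place and a module of definition of an
everywhere-unramified character is empty, so `ξ((−1)_∞) = 1 = (−1)^{m+1}(−1)^{−(n+1)}`).
[cite: NeukirchANT1999, Ch. VII §6 (6.11), Prop. (6.13)] [cite: Weil1956, §1] -/
theorem even_add_of_isUnramifiedAt_of_hasInfinityType (hK : IsImaginaryQuadratic K)
    {ξ : HeckeCharacter K} {m n : ℕ}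
    (hunr : ∀ w : HeightOneSpectrum (𝓞 K), ξ.IsUnramifiedAt w)
    (hinf : ξ.HasInfinityType (fun _ ↦ -((m : ℤ) + 1)) (fun _ ↦ (n : ℤ) + 1)) : Even (m + n) := by
  classical
  haveI : IsTotallyComplex K := hK.2
  haveI : Subsingleton (InfinitePlace K) := subsingleton_infinitePlace hK.1
  obtain ⟨T, e, hmod⟩ := ξ.exists_isModulus
  have hmod0 : IsModulus ξ ∅ e := hmod.of_isUnramifiedAt (fun v _ _ ↦ hunr v)
  have hS : ∀ v ∉ (∅ : Finset (HeightOneSpectrum (𝓞 K))), v.valuation K (((-1 : Kˣ)) : K) = 1 := by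
    intro v _
    rw [Units.val_neg, Units.val_one, Valuation.map_neg, map_one]
  have h1 := map_principalIdele_eq hmod0 (-1) (Finset.Subset.refl ∅) hS
  rw [Finset.prod_empty, mul_one] at h1
  have hw : ∀ w : InfinitePlace K, ¬ w.IsReal := fun w ↦
    InfinitePlace.not_isReal_iff_isComplex.mpr (hK.2.isComplex w)
  have hpos : InfiniteIdele.IsTotallyPositive (globalToInfiniteUnits K (-1 : Kˣ)) :=
    fun w hw' ↦ absurd hw' (hw w)
  have h2 := hinf.apply_infiniteIdeles_eq hpos
  rw [archFactor_globalToInfiniteUnits, h1] at h2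
  obtain ⟨w₀⟩ : Nonempty (InfinitePlace K) := inferInstance
  rw [Fintype.prod_subsingleton _ w₀] at h2
  simp only [Units.val_neg, Units.val_one, map_neg, map_one, neg_neg] at h2
  rw [← zpow_add₀ (by norm_num : (-1 : ℂ) ≠ 0)] at h2
  by_contra hodd
  rw [Nat.not_even_iff_odd] at hodd
  obtain ⟨j, hj⟩ := hodd
  have hodd' : Odd (((m : ℤ) + 1) + -((n : ℤ) + 1)) := ⟨(j : ℤ) - n, by omega⟩
  rw [hodd'.neg_one_zpow] at h2
  norm_num at h2

/-- **The odd-parity case of GAP 2 is vacuous**: the even-parity supply IS the full supply for an imaginary quadratic `K`.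
[cite: NeukirchANT1999, Ch. VII §6 Prop. (6.13)] -/
theorem RankinSelbergContinuationSupplyEven.toFull (hK : IsImaginaryQuadratic K)
    {f : CuspForm (CongruenceSubgroup.Gamma0 N) 2}
    (h : RankinSelbergContinuationSupplyEven K f) : RankinSelbergContinuationSupply K f :=
  fun ξ m n hu ht ↦ h ξ m n (even_add_of_isUnramifiedAt_of_hasInfinityType hK hu ht) hu ht

/-- `RankinSelbergContinuationSupply K f ↔ RankinSelbergContinuationSupplyEven K f` (imaginary quadratic `K`). [folklore] -/
theorem rankinSelbergContinuationSupply_iff_even (hK : IsImaginaryQuadratic K)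
    {f : CuspForm (CongruenceSubgroup.Gamma0 N) 2} :
    RankinSelbergContinuationSupply K f ↔ RankinSelbergContinuationSupplyEven K f :=
  ⟨fun h ↦ h.toEven, fun h ↦ h.toFull hK⟩

/-- **GAP 2 (all parities) for a NEWFORM from Jacquet 1972 Cor. 19.15** (the tree's Literature fact, by name) — the v1.3
input `RankinSelbergContinuationSupply K f` is a THEOREM for `IsNewform0 f`. [cite: Jacquet1972, §19 Cor. 19.15] -/
theorem rankinSelbergContinuationSupply_of_jacquet (hK : IsImaginaryQuadratic K) [NeZero N]
    {f : CuspForm (CongruenceSubgroup.Gamma0 N) 2} (hf : IsNewform0 f)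
    (hJ : jacquet1972_exists_entire_rankinSelbergHecke) : RankinSelbergContinuationSupply K f :=
  (rankinSelbergContinuationSupplyEven_of_jacquet hK hf hJ).toFull hK

/-- **Extended-by-zero value of the inverse character**: `ξ⁻¹(ϖ_v) = ξ(ϖ_v)⁻¹`, and `0 = 0⁻¹` at the ramified places.
[cite: Nekovar1995, §3.4] -/
theorem heckeValueExtZero_inv (φ : HeckeCharacter K) (v : HeightOneSpectrum (𝓞 K)) :
    heckeValueExtZero φ⁻¹ v = (heckeValueExtZero φ v)⁻¹ := by
  by_cases h : φ.IsUnramifiedAt v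
  · rw [heckeValueExtZero_of_isUnramifiedAt h.inv', heckeValueExtZero_of_isUnramifiedAt h,
      valueAtUniformizer_inv']
  · have h' : ¬ φ⁻¹.IsUnramifiedAt v := fun h' ↦ h (by simpa using h'.inv')
    rw [heckeValueExtZero_of_not_isUnramifiedAt h', heckeValueExtZero_of_not_isUnramifiedAt h, inv_zero]

/-- **The dual character `ξᴰ = (ξ∘σ)⁻¹` satisfies §1's value relations** when `σ` swaps `v` and `v̄`:
`ξᴰ(𝔭̄) = ξ(𝔭)⁻¹` and `ξᴰ(𝔭) = ξ(𝔭̄)⁻¹` (extended-by-zero currency). (G3-CHECK-g36.md §3.) [cite: Nekovar1995, §3.4] -/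
theorem dualValues_galConj_inv (σ : K ≃ₐ[F₀] K) {v vbar : HeightOneSpectrum (𝓞 K)}
    (hv : σ • v = vbar) (hvbar : σ • vbar = v) (ξ : HeckeCharacter K) :
    heckeValueExtZero (galConj σ ξ)⁻¹ vbar = (heckeValueExtZero ξ v)⁻¹ ∧
      heckeValueExtZero (galConj σ ξ)⁻¹ v = (heckeValueExtZero ξ vbar)⁻¹ := by
  constructor <;> rw [heckeValueExtZero_inv, heckeValueExtZero_galConj] <;> simp only [hv, hvbar]

/-- `𝓔(ξᴰ, f, 1) = 𝓔(ξ, f, 1)` for `ξᴰ = (ξ∘σ)⁻¹`, `σ` swapping `v`, `v̄` (§1 `typeTwoEulerFactor_dual`, hypotheses discharged).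
[cite: YanZhu2024MainConjNonCM, Thm. 3.9 (𝓔(ξ,f,1))] -/
theorem typeTwoEulerFactor_galConj_inv (σ : K ≃ₐ[F₀] K) {v vbar : HeightOneSpectrum (𝓞 K)}
    (hv : σ • v = vbar) (hvbar : σ • vbar = v) (α : ℂ) (ξ : HeckeCharacter K) :
    typeTwoEulerFactor p α (galConj σ ξ)⁻¹ v vbar = typeTwoEulerFactor p α ξ v vbar :=
  typeTwoEulerFactor_dual α ξ _ v vbar (dualValues_galConj_inv σ hv hvbar ξ).1 (dualValues_galConj_inv σ hv hvbar ξ).2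

/-- The type-II denominator is D-invariant for `ξᴰ = (ξ∘σ)⁻¹` (§1 `typeTwoDenominator_dual`, hypotheses discharged).
[cite: YanZhu2024MainConjNonCM, Thm. 3.9] -/
theorem typeTwoDenominator_galConj_inv (σ : K ≃ₐ[F₀] K) {v vbar : HeightOneSpectrum (𝓞 K)}
    (hv : σ • v = vbar) (hvbar : σ • vbar = v) (ξ : HeckeCharacter K) :
    typeTwoDenominator p (galConj σ ξ)⁻¹ v vbar = typeTwoDenominator p ξ v vbar :=
  typeTwoDenominator_dual ξ _ v vbar (dualValues_galConj_inv σ hv hvbar ξ).1 (dualValues_galConj_inv σ hv hvbar ξ).2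

/-- The `(𝓔, den)` slots of the frame's parametrised value are D-invariant: same `a b pet L1` ⇒ same value for `ξᴰ` and `ξ`
(the archimedean constant and the `L`-value slot are where the complex functional equation enters — §1
`typeTwoInterpolationValueL_dual_cross`). [cite: YanZhu2024MainConjNonCM, Thm. 3.9] -/
theorem typeTwoInterpolationValueL_galConj_inv (σ : K ≃ₐ[F₀] K) {v vbar : HeightOneSpectrum (𝓞 K)}
    (hv : σ • v = vbar) (hvbar : σ • vbar = v) (Nlev : ℕ) (α : ℂ) (ξ : HeckeCharacter K) (a b : ℤ)
    (pet : ℝ) (L1 : ℂ) :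
    typeTwoInterpolationValueL p Nlev v vbar α (galConj σ ξ)⁻¹ a b pet L1 =
      typeTwoInterpolationValueL p Nlev v vbar α ξ a b pet L1 := by
  simp only [typeTwoInterpolationValueL, typeTwoEulerFactor_galConj_inv σ hv hvbar,
    typeTwoDenominator_galConj_inv σ hv hvbar]

/-- `ξᴰ` is everywhere unramified when `ξ` is. [cite: TateThesis1967, §2.3] -/
theorem isUnramifiedAt_galConj_inv (σ : K ≃ₐ[F₀] K) {ξ : HeckeCharacter K}
    (hunr : ∀ w : HeightOneSpectrum (𝓞 K), ξ.IsUnramifiedAt w) (w : HeightOneSpectrum (𝓞 K)) :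
    ((galConj σ ξ)⁻¹).IsUnramifiedAt w :=
  ((isUnramifiedAt_galConj_iff σ ξ w).mpr (hunr (σ • w))).inv'

/-- **The frame's range is D-stable with `m ↔ n`**: `ξ` of type `(−(m+1), n+1)` ⇒ `ξᴰ = (ξ∘c)⁻¹` of type `(−(n+1), m+1)`.
[cite: Weil1956, §1] -/
theorem hasInfinityType_galConj_inv [IsCMField K] {ξ : HeckeCharacter K} {m n : ℕ}
    (hinf : ξ.HasInfinityType (fun _ ↦ -((m : ℤ) + 1)) (fun _ ↦ (n : ℤ) + 1)) :
    ((galConj (IsCMField.complexConj K) ξ)⁻¹).HasInfinityType (fun _ ↦ -((n : ℤ) + 1)) (fun _ ↦ (m : ℤ) + 1) := by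
  convert hinf.galConj_complexConj.inv using 2 <;> simp only [Pi.neg_apply, neg_neg]

/-- **`L(f/K, ξᴰ, s) = L(f/K, ξ⁻¹, s)`** as Euler products (`(ξ∘σ)⁻¹ = ξ⁻¹∘σ` and Galois transport §5·G).
[cite: Jacquet1972, §19 Cor. 19.15] [cite: Nekovar1995, (0.5) p. 611] -/
theorem rankinSelbergEulerProductHecke_galConj_inv (σ : K ≃ₐ[F₀] K) (f : CuspForm (CongruenceSubgroup.Gamma0 N) 2)
    (ξ : HeckeCharacter K) (s : ℂ) :
    rankinSelbergEulerProductHecke f (galConj σ ξ)⁻¹ s = rankinSelbergEulerProductHecke f ξ⁻¹ s := by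
  rw [← galConj_inv, rankinSelbergEulerProductHecke_galConj]

/-- **Complex conjugation swaps any two distinct primes above the same rational prime of an imaginary quadratic
field**: `v ≠ v̄` both containing `p` ⇒ `c • v = v̄` and `c • v̄ = v` (the crux's `ncard = 2` binder is not even needed). Kernel:
`Gal(K/ℚ)` (order `2 = [K:ℚ]`, `IsGalois.card_aut_eq_finrank`) acts transitively on the primes above `(p)`
(`Ideal.exists_smul_eq_of_isGaloisGroup`), the transporting `τ` is `≠ 1`, hence `τ = c|_ℚ`
(`eq_one_or_eq_of_card_eq_two`, `IsCMField.complexConj_ne_one`), and `c|_ℚ • v = c • v` definitionally; `c² = 1`.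
[cite: Marcus2018, Ch. 3, Thm. 25] [cite: CasselsFrohlichANT1967, Ch. VII Prop. 1.2 (ii)] -/
theorem complexConj_smul_eq_of_split [IsCMField K] (hK : IsImaginaryQuadratic K) [hp : Fact p.Prime]
    {v vbar : HeightOneSpectrum (𝓞 K)}
    (hv : ((p : ℕ) : 𝓞 K) ∈ v.asIdeal) (hvbar : ((p : ℕ) : 𝓞 K) ∈ vbar.asIdeal) (hne : vbar ≠ v) :
    IsCMField.complexConj K • v = vbar ∧ IsCMField.complexConj K • vbar = v := by
  classical
  haveI : Algebra.IsQuadraticExtension ℚ K := ⟨hK.1⟩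
  haveI : IsGaloisGroup (K ≃ₐ[ℚ] K) ℤ (𝓞 K) :=
    IsGaloisGroup.of_isFractionRing (K ≃ₐ[ℚ] K) ℤ (𝓞 K) ℚ K
  have hG : Nat.card (K ≃ₐ[ℚ] K) = 2 := by rw [IsGalois.card_aut_eq_finrank, hK.1]
  set P : Ideal ℤ := Ideal.span {(p : ℤ)} with hPdef
  have hPmax : P.IsMaximal := by
    have hpr : Prime (p : ℤ) := Nat.prime_iff_prime_int.mp hp.out
    exact ((Ideal.span_singleton_prime hpr.ne_zero).mpr hpr).isMaximal
      (by rw [Ne, Ideal.span_singleton_eq_bot]; exact hpr.ne_zero)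
  have hunder : ∀ w : HeightOneSpectrum (𝓞 K), ((p : ℕ) : 𝓞 K) ∈ w.asIdeal →
      w.asIdeal.under ℤ = P := by
    intro w hw
    haveI := w.isMaximal
    have hle : P ≤ w.asIdeal.under ℤ := by
      rw [hPdef, Ideal.span_le, Set.singleton_subset_iff]
      change algebraMap ℤ (𝓞 K) (p : ℤ) ∈ w.asIdeal
      rwa [map_natCast]
    exact (hPmax.eq_of_le (Ideal.IsMaximal.under ℤ w.asIdeal).ne_top hle).symm
  have hmem : ∀ w : HeightOneSpectrum (𝓞 K), ((p : ℕ) : 𝓞 K) ∈ w.asIdeal →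
      w.asIdeal ∈ P.primesOver (𝓞 K) := fun w hw ↦ ⟨w.isPrime, ⟨(hunder w hw).symm⟩⟩
  have hne' : v.asIdeal ≠ vbar.asIdeal := fun h ↦ hne (HeightOneSpectrum.ext h).symm
  haveI := v.isPrime
  haveI := vbar.isPrime
  haveI : v.asIdeal.LiesOver P := (hmem v hv).2
  haveI : vbar.asIdeal.LiesOver P := (hmem vbar hvbar).2
  obtain ⟨τ, hτ⟩ := Ideal.exists_smul_eq_of_isGaloisGroup P v.asIdeal vbar.asIdeal (K ≃ₐ[ℚ] K)
  have hτ1 : τ ≠ 1 := by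
    rintro rfl
    rw [one_smul] at hτ
    exact hne' hτ
  have hc1 : ((IsCMField.complexConj K).restrictScalars ℚ : K ≃ₐ[ℚ] K) ≠ 1 := fun h ↦
    IsCMField.complexConj_ne_one K (AlgEquiv.ext fun x ↦ AlgEquiv.congr_fun h x)
  have hτc : τ = (IsCMField.complexConj K).restrictScalars ℚ :=
    (eq_one_or_eq_of_card_eq_two hG hc1 τ).resolve_left hτ1
  have h1 : IsCMField.complexConj K • v = vbar := by
    apply HeightOneSpectrum.ext
    change ((IsCMField.complexConj K).restrictScalars ℚ : K ≃ₐ[ℚ] K) • v.asIdeal = vbar.asIdeal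
    rw [← hτc, hτ]
  refine ⟨h1, ?_⟩
  rw [← h1, ← mul_smul, complexConj_mul_self, one_smul]

/-- **At the crux's own data the dual character `ξᴰ = (ξ∘c)⁻¹` satisfies §1's value relations UNCONDITIONALLY**
(imaginary quadratic `K`, `v ≠ v̄` above `p` — the crux binders `hv hvbar hne` verbatim; `ncard = 2` unused).
[cite: Nekovar1995, §3.4] [cite: Marcus2018, Ch. 3, Thm. 25] -/
theorem dualValues_cruxFrame [IsCMField K] (hK : IsImaginaryQuadratic K) [Fact p.Prime]
    {v vbar : HeightOneSpectrum (𝓞 K)}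
    (hv : ((p : ℕ) : 𝓞 K) ∈ v.asIdeal) (hvbar : ((p : ℕ) : 𝓞 K) ∈ vbar.asIdeal) (hne : vbar ≠ v)
    (ξ : HeckeCharacter K) :
    heckeValueExtZero (galConj (IsCMField.complexConj K) ξ)⁻¹ vbar = (heckeValueExtZero ξ v)⁻¹ ∧
      heckeValueExtZero (galConj (IsCMField.complexConj K) ξ)⁻¹ v = (heckeValueExtZero ξ vbar)⁻¹ :=
  dualValues_galConj_inv _ (complexConj_smul_eq_of_split hK hv hvbar hne).1
    (complexConj_smul_eq_of_split hK hv hvbar hne).2 ξ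

/-- **`𝓔(ξᴰ, f, 1) = 𝓔(ξ, f, 1)` at the crux's data**, every root `α`. [cite: YanZhu2024MainConjNonCM, Thm. 3.9] -/
theorem typeTwoEulerFactor_cruxDual [IsCMField K] (hK : IsImaginaryQuadratic K) [Fact p.Prime]
    {v vbar : HeightOneSpectrum (𝓞 K)}
    (hv : ((p : ℕ) : 𝓞 K) ∈ v.asIdeal) (hvbar : ((p : ℕ) : 𝓞 K) ∈ vbar.asIdeal) (hne : vbar ≠ v)
    (α : ℂ) (ξ : HeckeCharacter K) :
    typeTwoEulerFactor p α (galConj (IsCMField.complexConj K) ξ)⁻¹ v vbar = typeTwoEulerFactor p α ξ v vbar :=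
  typeTwoEulerFactor_galConj_inv _ (complexConj_smul_eq_of_split hK hv hvbar hne).1
    (complexConj_smul_eq_of_split hK hv hvbar hne).2 α ξ

/-- **The frame's `(𝓔, den)` slots are D-invariant at the crux's data** (same `a b pet L1`).
[cite: YanZhu2024MainConjNonCM, Thm. 3.9] -/
theorem typeTwoInterpolationValueL_cruxDual [IsCMField K] (hK : IsImaginaryQuadratic K) [Fact p.Prime]
    {v vbar : HeightOneSpectrum (𝓞 K)}
    (hv : ((p : ℕ) : 𝓞 K) ∈ v.asIdeal) (hvbar : ((p : ℕ) : 𝓞 K) ∈ vbar.asIdeal) (hne : vbar ≠ v)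
    (Nlev : ℕ) (α : ℂ) (ξ : HeckeCharacter K) (a b : ℤ) (pet : ℝ) (L1 : ℂ) :
    typeTwoInterpolationValueL p Nlev v vbar α (galConj (IsCMField.complexConj K) ξ)⁻¹ a b pet L1 =
      typeTwoInterpolationValueL p Nlev v vbar α ξ a b pet L1 :=
  typeTwoInterpolationValueL_galConj_inv _ (complexConj_smul_eq_of_split hK hv hvbar hne).1
    (complexConj_smul_eq_of_split hK hv hvbar hne).2 Nlev α ξ a b pet L1

end ParityDual

/-! ### §5·I (v1.5.2, g40) The point involution `τ₂` on avatars (G3a table, avatar rows; memo `G3A-CHECK-g39.md` §4).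
Pure `ℤ_p²`-tower algebra first (`θ` abstract: fixes `κ₁`, inverts `κ₂`), then the discharge at the crux's tower
`(κ₁, κ₂) = (cyclotomic, anticyclotomic)` from the tree's `IsCyclotomic` / `IsAnticyclotomic`, and the assembled row with X11b's
PROVED avatar transport. No analytic input; nothing here bears on the summit. -/

section PointInvolution

open Field ZpExtension
open Summit.BirchSwinnertonDyer.Rank1Residual.X11b.Three.LambdaSupply

variable [Fact p.Prime]

omit [NumberField K] in
/-- `r σ = 1 ⇒ r̂(σ) = 1` (the `1 × 1` determinant of `1`). -/
theorem avatarValueAt_eq_one_of_apply {r : FramedGaloisRep K (PadicAlgCl p) 1} {σ : absoluteGaloisGroup K}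
    (h : r σ = 1) : avatarValueAt r σ = 1 := by
  simp [avatarValueAt, h]

omit [NumberField K] in
/-- `r̂(σ) ≠ 0` (`r̂` is a character: `r̂(σ⁻¹) r̂(σ) = 1`). -/
theorem avatarValueAt_ne_zero (r : FramedGaloisRep K (PadicAlgCl p) 1) (σ : absoluteGaloisGroup K) :
    avatarValueAt r σ ≠ 0 := by
  intro h0
  have h := avatarValueAt_mul r σ⁻¹ σ
  rw [inv_mul_cancel, avatarValueAt_one, h0, mul_zero] at h
  exact one_ne_zero h

omit [NumberField K] in
/-- **A character through the `ℤ_p²`-tower only sees the `(κ₁, κ₂)`-coordinates**: equal coordinates ⇒ equal values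
(`σ τ⁻¹ ∈ pairKer`). -/
theorem avatarValueAt_eq_of_factorsThroughPair {κ₁ κ₂ : ZpExtension K p} {r : FramedGaloisRep K (PadicAlgCl p) 1}
    (hr : FactorsThroughPair κ₁ κ₂ r) {σ τ : absoluteGaloisGroup K} (h₁ : κ₁ σ = κ₁ τ) (h₂ : κ₂ σ = κ₂ τ) :
    avatarValueAt r σ = avatarValueAt r τ := by
  have h : r (σ * τ⁻¹) = 1 :=
    hr _ (by rw [map_mul, map_inv, h₁, mul_inv_cancel]) (by rw [map_mul, map_inv, h₂, mul_inv_cancel])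
  have hv := avatarValueAt_eq_one_of_apply h
  rw [avatarValueAt_mul, avatarValueAt_inv_eq] at hv
  exact (mul_inv_eq_one₀ (avatarValueAt_ne_zero r τ)).mp hv

omit [NumberField K] in
/-- **A `θ` fixing `κ₁` and inverting `κ₂` fixes the value at `γ₁`** (`γ₁ ∈ ker κ₂`, so `θ γ₁` and `γ₁` have the same
coordinates `(κ₁ γ₁, 1)`). -/
theorem avatarValueAt_conj_left {κ₁ κ₂ : ZpExtension K p} {r : FramedGaloisRep K (PadicAlgCl p) 1}
    (hr : FactorsThroughPair κ₁ κ₂ r) {γ₁ γ₂ : absoluteGaloisGroup K} (hγ : IsTopGeneratorPair κ₁ κ₂ γ₁ γ₂)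
    {θ : absoluteGaloisGroup K → absoluteGaloisGroup K}
    (hθ₁ : ∀ g, κ₁ (θ g) = κ₁ g) (hθ₂ : ∀ g, κ₂ (θ g) = (κ₂ g)⁻¹) :
    avatarValueAt r (θ γ₁) = avatarValueAt r γ₁ :=
  avatarValueAt_eq_of_factorsThroughPair hr (hθ₁ γ₁) (by rw [hθ₂, hγ.apply_left, inv_one])

omit [NumberField K] in
/-- **… and inverts the value at `γ₂`** (`γ₂ ∈ ker κ₁`, so `θ γ₂` and `γ₂⁻¹` have the same coordinates `(1, (κ₂ γ₂)⁻¹)`). -/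
theorem avatarValueAt_conj_right {κ₁ κ₂ : ZpExtension K p} {r : FramedGaloisRep K (PadicAlgCl p) 1}
    (hr : FactorsThroughPair κ₁ κ₂ r) {γ₁ γ₂ : absoluteGaloisGroup K} (hγ : IsTopGeneratorPair κ₁ κ₂ γ₁ γ₂)
    {θ : absoluteGaloisGroup K → absoluteGaloisGroup K}
    (hθ₁ : ∀ g, κ₁ (θ g) = κ₁ g) (hθ₂ : ∀ g, κ₂ (θ g) = (κ₂ g)⁻¹) :
    avatarValueAt r (θ γ₂) = (avatarValueAt r γ₂)⁻¹ := by
  rw [← avatarValueAt_inv_eq]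
  exact avatarValueAt_eq_of_factorsThroughPair hr (by rw [hθ₁, map_inv, hγ.apply_right, inv_one])
    (by rw [hθ₂, map_inv])

omit [NumberField K] in
/-- **The point involution `τ₂` of the crux's frame, abstract form**: at the evaluation points `(g₁, g₂) = (γ₁⁻¹, γ₂⁻¹)` a dual
avatar `r'` with values `r'(g) = r(θ g)⁻¹` (`θ` a hom fixing `κ₁`, inverting `κ₂`) sits at `(x₁⁻¹, x₂)`,
`(x₁, x₂) = (r(γ₁⁻¹), r(γ₂⁻¹))` — first coordinate inverted, second fixed: the substitution `diagFrame (−1) 1` of §2. -/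
theorem dualPoint {κ₁ κ₂ : ZpExtension K p} {r r' : FramedGaloisRep K (PadicAlgCl p) 1}
    (hr : FactorsThroughPair κ₁ κ₂ r) {γ₁ γ₂ : absoluteGaloisGroup K} (hγ : IsTopGeneratorPair κ₁ κ₂ γ₁ γ₂)
    (θ : absoluteGaloisGroup K →* absoluteGaloisGroup K)
    (hθ₁ : ∀ g, κ₁ (θ g) = κ₁ g) (hθ₂ : ∀ g, κ₂ (θ g) = (κ₂ g)⁻¹)
    (hr' : ∀ g, avatarValueAt r' g = (avatarValueAt r (θ g))⁻¹) :
    avatarValueAt r' γ₁⁻¹ = (avatarValueAt r γ₁⁻¹)⁻¹ ∧ avatarValueAt r' γ₂⁻¹ = avatarValueAt r γ₂⁻¹ := by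
  constructor
  · rw [hr', map_inv, avatarValueAt_inv_eq, avatarValueAt_inv_eq,
      avatarValueAt_conj_left hr hγ (θ := θ) hθ₁ hθ₂]
  · rw [hr', map_inv, avatarValueAt_inv_eq, avatarValueAt_inv_eq,
      avatarValueAt_conj_right hr hγ (θ := θ) hθ₁ hθ₂, inv_inv]

omit [NumberField K] in
/-- The dual avatar again factors through the pair (value form: `r'(σ) = 1` on `pairKer κ₁ κ₂`). -/
theorem dual_factorsThroughPair_values {κ₁ κ₂ : ZpExtension K p} {r r' : FramedGaloisRep K (PadicAlgCl p) 1}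
    (hr : FactorsThroughPair κ₁ κ₂ r) {θ : absoluteGaloisGroup K → absoluteGaloisGroup K}
    (hθ₁ : ∀ g, κ₁ (θ g) = κ₁ g) (hθ₂ : ∀ g, κ₂ (θ g) = (κ₂ g)⁻¹)
    (hr' : ∀ g, avatarValueAt r' g = (avatarValueAt r (θ g))⁻¹) (σ : absoluteGaloisGroup K)
    (h₁ : κ₁ σ = 1) (h₂ : κ₂ σ = 1) : avatarValueAt r' σ = 1 := by
  rw [hr', avatarValueAt_eq_one_of_apply (hr _ (by rw [hθ₁, h₁]) (by rw [hθ₂, h₂, inv_one])), inv_one]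

/-- **The cyclotomic `ℤ_p`-extension is fixed by conjugation**: `κ₁(θ g) = κ₁(g)` for any `θ` lifting conjugation by
`c ∈ Γ_ℚ` (`res (θ σ) = c · res σ · c⁻¹`), because `κ₁` factors through `χ_p` (tree `IsCyclotomic.apply_eq_of_cyclotomicCharacter_eq`),
`χ_p` on `Γ_K` is the restriction of `χ_p` on `Γ_ℚ` (tree `cyclotomicCharacter_absGaloisRestrict`) and `ℤ_pˣ` is commutative. -/
theorem apply_conj_eq_of_isCyclotomic {κ₁ : ZpExtension K p} (hκ : κ₁.IsCyclotomic) {c : absoluteGaloisGroup ℚ}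
    {θ : absoluteGaloisGroup K → absoluteGaloisGroup K}
    (hθ : ∀ σ, absGaloisRestrict ℚ K (θ σ) = c * absGaloisRestrict ℚ K σ * c⁻¹) (g : absoluteGaloisGroup K) :
    κ₁ (θ g) = κ₁ g := by
  refine hκ.apply_eq_of_cyclotomicCharacter_eq ?_
  rw [← cyclotomicCharacter_absGaloisRestrict ℚ K p (θ g), ← cyclotomicCharacter_absGaloisRestrict ℚ K p g, hθ,
    map_mul, map_mul, map_inv, mul_inv_cancel_comm]

/-- **The anticyclotomic `ℤ_p`-extension is inverted by conjugation**: `κ₂(θ g) = κ₂(g)⁻¹` — the tree's definition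
`ZpExtension.IsAnticyclotomic`, read at the lift `θ` of conjugation by `c ∉ res Γ_K`. -/
theorem apply_conj_eq_inv_of_isAnticyclotomic {κ₂ : ZpExtension K p} (hκ : κ₂.IsAnticyclotomic)
    {c : absoluteGaloisGroup ℚ} (hc : c ∉ Set.range (absGaloisRestrict ℚ K))
    {θ : absoluteGaloisGroup K → absoluteGaloisGroup K}
    (hθ : ∀ σ, absGaloisRestrict ℚ K (θ σ) = c * absGaloisRestrict ℚ K σ * c⁻¹) (g : absoluteGaloisGroup K) :
    κ₂ (θ g) = (κ₂ g)⁻¹ :=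
  hκ g (θ g) c hc (hθ g)

/-- **`τ₂` at the crux's tower** `(κ₁, κ₂) = (cyclotomic, anticyclotomic)` (the crux binders `κ₁.IsCyclotomic`,
`κ₂.IsAnticyclotomic`): for any hom `θ` lifting conjugation by `c ∉ res Γ_K`, a dual avatar `r'` (`r'(g) = r(θ g)⁻¹`) sits at
`(x₁⁻¹, x₂)`. -/
theorem dualPoint_cyc_anticyc {κ₁ κ₂ : ZpExtension K p} (hκ₁ : κ₁.IsCyclotomic) (hκ₂ : κ₂.IsAnticyclotomic)
    {c : absoluteGaloisGroup ℚ} (hc : c ∉ Set.range (absGaloisRestrict ℚ K))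
    (θ : absoluteGaloisGroup K →* absoluteGaloisGroup K)
    (hθ : ∀ σ, absGaloisRestrict ℚ K (θ σ) = c * absGaloisRestrict ℚ K σ * c⁻¹)
    {r r' : FramedGaloisRep K (PadicAlgCl p) 1} (hr : FactorsThroughPair κ₁ κ₂ r)
    {γ₁ γ₂ : absoluteGaloisGroup K} (hγ : IsTopGeneratorPair κ₁ κ₂ γ₁ γ₂)
    (hr' : ∀ g, avatarValueAt r' g = (avatarValueAt r (θ g))⁻¹) :
    avatarValueAt r' γ₁⁻¹ = (avatarValueAt r γ₁⁻¹)⁻¹ ∧ avatarValueAt r' γ₂⁻¹ = avatarValueAt r γ₂⁻¹ :=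
  dualPoint hr hγ θ (apply_conj_eq_of_isCyclotomic hκ₁ hθ) (apply_conj_eq_inv_of_isAnticyclotomic hκ₂ hc hθ) hr'

/-- **The conjugate avatar at the crux's tower, assembled**: for `K` imaginary quadratic (CM, Galois over `ℚ`, `[K:ℚ] = 2` — all
three from `IsImaginaryQuadratic K`), `c ∈ Γ_ℚ ∖ res Γ_K`, `θ_c = absGaloisOuterConj ℚ K c` the tree's canonical lift
(`res (θ_c σ) = c · res σ · c⁻¹`), `(κ₁, κ₂) = (cyclotomic, anticyclotomic)` with adapted pair `(γ₁, γ₂)` and `r` the avatar of `ξ`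
through the pair: `r ∘ θ_c` IS the avatar of `ξ ∘ c` (X11b `isPAdicAvatarOf_galConj_complexConj_comp`, PROVED in the tree), factors
through the pair, and sits at `(x₁, x₂⁻¹)` where `(x₁, x₂) = (r(γ₁⁻¹), r(γ₂⁻¹))` is the crux frame's point of `ξ`; the dual
`ξᴰ = (ξ ∘ c)⁻¹` (any avatar with the inverse values, e.g. X11b `isPAdicAvatarOf_inv` in units currency) then sits at `(x₁⁻¹, x₂)`
by `dualPoint_cyc_anticyc`. This is the avatar row of the G3a functional-equation table. -/
theorem conjAvatar_cruxFrame [IsCMField K] [IsGalois ℚ K] (hK2 : Module.finrank ℚ K = 2) (ι : PadicAlgCl p ≃+* ℂ)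
    {κ₁ κ₂ : ZpExtension K p} (hκ₁ : κ₁.IsCyclotomic) (hκ₂ : κ₂.IsAnticyclotomic)
    {c : absoluteGaloisGroup ℚ} (hc : c ∉ Set.range (absGaloisRestrict ℚ K))
    {ξ : HeckeCharacter K} {r : FramedGaloisRep K (PadicAlgCl p) 1} (hξ : IsPAdicAvatarOf ι ξ r)
    (hr : FactorsThroughPair κ₁ κ₂ r) {γ₁ γ₂ : absoluteGaloisGroup K} (hγ : IsTopGeneratorPair κ₁ κ₂ γ₁ γ₂) :
    IsPAdicAvatarOf ι (HeckeCharacter.galConj (IsCMField.complexConj K) ξ) (r.comp (absGaloisOuterConj ℚ K c)) ∧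
    FactorsThroughPair κ₁ κ₂ (r.comp (absGaloisOuterConj ℚ K c)) ∧
    avatarValueAt (r.comp (absGaloisOuterConj ℚ K c)) γ₁⁻¹ = avatarValueAt r γ₁⁻¹ ∧
    avatarValueAt (r.comp (absGaloisOuterConj ℚ K c)) γ₂⁻¹ = (avatarValueAt r γ₂⁻¹)⁻¹ := by
  set θ := absGaloisOuterConj ℚ K c with hθdef
  have hθ : ∀ σ, absGaloisRestrict ℚ K (θ σ) = c * absGaloisRestrict ℚ K σ * c⁻¹ :=
    absGaloisRestrict_absGaloisOuterConj ℚ K c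
  have hθ₁ := apply_conj_eq_of_isCyclotomic (p := p) hκ₁ (θ := θ) hθ
  have hθ₂ := apply_conj_eq_inv_of_isAnticyclotomic (p := p) hκ₂ hc (θ := θ) hθ
  have hval : ∀ g, avatarValueAt (r.comp θ) g = avatarValueAt r (θ g) := fun g => rfl
  refine ⟨isPAdicAvatarOf_galConj_complexConj_comp hK2 ι hξ hc hθ, fun σ h₁ h₂ => ?_, ?_, ?_⟩
  · show r (θ σ) = 1
    exact hr _ (by rw [hθ₁, h₁]) (by rw [hθ₂, h₂, inv_one])
  · rw [hval, map_inv, avatarValueAt_inv_eq, avatarValueAt_inv_eq, avatarValueAt_conj_left hr hγ hθ₁ hθ₂]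
  · rw [hval, map_inv, avatarValueAt_inv_eq, avatarValueAt_inv_eq, avatarValueAt_conj_right hr hγ hθ₁ hθ₂]

end PointInvolution

end Summit.BirchSwinnertonDyer.BirchSwinnertonDyer.Cruxes.TwoVariableEulerSystemDivisibility.SplitsliceG3
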